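import Summits.HodgeConjecture.HodgeConjecture.Cruxes.BlochSeedDiscOne.Anchor
import Summits.Ventures.HSemireg.Pad4TowerPsiSubA1
import Summits.Ventures.HSemireg.SheafSeedOnAnchor
import Literature.AlgebraicGeometry.Modules.InvertibleModule
import Literature.AlgebraicGeometry.Modules.TensorProduct
import HarnessLib

/-!
# `Cruxes/BlochSeedDiscOne/SeedChecker.lean` — the SEED CHECKER for `stub_rung_pad4_seedAt` (crux
# `EightfoldBlochSeeds.BlochSeedDiscOne`, item stmt-HodgeConjecture-18881): the conditions C5–C8 of the cell's
# seed-condition list, TYPED as predicates on (design json, presentation), with their unpacking into the stub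

HONEST FRAMING. Typed by planner seat `hsemireg-c5c8-1` (g0; director-hodge g20 MINT block A5, 2026-08-29) for the
computation cell `pub-hsemireg`. Line of record: `Cruxes/BlochSeedDiscOne/Lines/birth.lean` 814a6a70c14e831a, stub
`stub_rung_pad4_seedAt` (positive side: ONE (A1)-clean design with `μ ≠ 0` realised by a vector bundle / an lci
subscheme = a SEED on the pad-4 anchor `S⁴`, `S = E₀ × E₀`). This file contains DEFINITIONS (predicates and two
interface structures) and small PROVED repackaging lemmas. NOTHING here is a rung: no seed is exhibited, no design is
certified, and NOTHING HERE SAYS THAT HC ∕ HC_CM ∕ HC_AV ∕ №4 ∕ 26512 ∕ 18881 ∕ H2 holds or fails. 0 `sorry`, no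
`instance`, no notation, no named fact.

WHAT A «SEED CHECKER» IS. The bc5 card's seed-condition list (cell INBOX 2026-08-29T10:18:07Z, bc5-plan g11; conditions
C0–C8) splits into json-side conditions C0–C4 (class data, support statics, (H2)-diagonal, HALL₀, (A2)₁ — decided by the
design json and run by the cell's scripts) and object-side conditions C5–C8 (realisation, the cycle `Z(s)` and its
class, Bloch-semiregularity, the typed consumer). The director's A5 row asks for the four object-side checks
  (σ)    the HODGE-CLASS CHECK — the seed's class is the target Weil class (non-zero `W_K`-component), not a class in `ℚ[h]`;
  (A1@Z) (A1)-CLEANLINESS AT THE SEED — `ch(𝓔) ∈ ℚ[h] ⊕ W` for the realised sheaf, not only for the design tensor;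
  (pad4) PAD4-TOWER COMPATIBILITY with the binders of `stub_rung_pad4_seedAt` (uniform in `(E₀, ψ₀, hE, hψ)`, anchor
         `pad4Anchor E₀ = ((S × S) × S) × S`, action `pad4Action E₀ ψ₀`, polarisation `h_K = symH (pad4Action E₀ ψ₀) e a`,
         `IsHyperbolicWeilType … 4 h_K`, `w ∈ weilClassesOf (pad4Anchor E₀) (pad4Action E₀ ψ₀) 4 1`);
  (d=1)  DISC-ONE (`K = ℚ(i)`: `ψ₀ ≫ ψ₀ = -(1 • 𝟙 E₀)`, `weilClassesOf … 4 1`, the literal `((1 : ℕ) : ℂ)` in `symH`),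
typed as predicates on (design, presentation) so that a checker exists BEFORE a candidate does. Here:

* §1 JSON SIDE (decidable, over `Pad4TowerCrossPhase.MConfig` + integer multiplicities = the design json of record, keys
  `"N"` ↦ `cfg.lower`∕`mN`, `"P"` ↦ `cfg.upper`∕`mP`, a cell key `[[α, Re β, Im β] × 4]` ↦ the `MCell`
  `f ↦ (α_f, Re β_f, Im β_f)`): `Design`, `Design.wch` (the weighted class tensor `Σ_N m_N ch N − Σ_P m_P ch P`), the C0
  recap `Design.Clean` (= the class screen (A1)∕(H1) of `Pad4TowerClassScreen`), `Design.mu`∕`mubar` (the `eeee`∕`ēēēē`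
  coefficients), `Design.rank` (the unit-word coefficient; PROVED `rank_eq`: `Σ m_N − Σ m_P`), `Design.Positive`,
  `Design.ClassData` (= C0); INTEGER VALUES on e-free words (`bphiZ`, `MCell.chZ`, `Design.wchZ`; PROVED
  `MCell.ch_eq_intCast`, `Design.wch_eq_intCast`, `Design.im_wch_of_eFree`) and the design's `ℚ[h]`-COEFFICIENTS
  `Design.coeff p` (`p ≤ 8`, the value on `refWord p` = the coefficient of `h^p∕p!`; PROVED `wch_eq_coeff_of_clean`: an
  (A1)-clean tensor takes the value `c_p` on EVERY e-free word of degree `p`; `rank_eq_coeff`); the truncated screen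
  `ClassScreenLE k` ((A1) in degrees `≤ k` — the part the lci door reads, `k = 4`) with PROVED `classScreenLE_of_classScreen`
  and `classScreenLE_add_iff_of_vanishes` ((A1) in degrees `≤ k` does not see a correction supported in degrees `> k` — the
  numerical shadow of «the presentation is exact off codimension `≥ 5`»); and ORIENTATION COVARIANCE (the binder
  `hψ : ψ₀ ≫ ψ₀ = -1` does not fix the sign of `ψ₀`; `ψ₀ ↦ -ψ₀` swaps the frame letters `e ↔ ē`): `conjWord`, `conjPt`,
  `MCell.conj`, `Design.conj`, PROVED `bphi_conjPt`, `MCell.ch_conj` (`ch(Z̄) = ch(Z) ∘ conjWord`), `Design.conj_wch`,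
  `Design.conj_mu` (`μ(D̄) = μ̄(D)`), `classScreen_comp_conjWord`, `Design.conj_clean`, `Design.conj_rank` — the json-side
  checks are covariant, so a design passes for `ψ₀` iff its conjugate passes for `-ψ₀`.
* §2 ANCHOR SIDE, CONCRETE: the frame's polarisation `h = Σ_f (u_f + v_f)` as an honest class on the stub's anchor:
  `hSurf E₀ η = pr₁^*η + pr₂^*η` on `S`, `hPad2`, `hPad3`, `hStd E₀ η` on `pad4Anchor E₀` (nested exactly as the anchor),
  `η ∈ H²(E₀(ℂ); ℂ)` the rational generator; PROVED `hStd_rational`, `map_pad4Action_hStd` (`ψ^* h_std = h_std`, from the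
  tree's `cmCurve_map_two` ∕ `af_product_symm` at `d = 1`), `symH_eq_smul_hStd` (a polarisation datum `(e, a, t)` with
  `e^*a = t·h_std` has `h_K = symH = 2t·h_std`), `isHyperbolicWeilType_symH_iff` (hyperbolicity for `h_K` ⟺ for `h_std`,
  `isHyperbolicWeilType_smul_iff`) and `symH_discOne` (the `d = 1` literal).
* §3 THE WEIL FRAME (INTERFACE; existence NOT smuggled): `WeilFrame E₀ ψ₀` = two rational, `ℂ`-independent classes
  `r₁, r₂ ∈ weilClassesOf (pad4Anchor E₀) (pad4Action E₀ ψ₀) 4 1` (dictionary with the cell's frame: `r₁ = eeee + ēēēē`,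
  `r₂ = i(eeee − ēēēē)`; constructing one is obligation O-W; the normalisation is free up to `GL₂(ℚ)`, which the consumer does
  not see); `WeilFrame.wOf μ = Re μ · r₁ + Im μ · r₂` (the class `μ·eeee + μ̄·ēēēē` of a design with `μ ∈ ℤ[i]`); PROVED
  `wOf_mem`, `wOf_rational`, `wOf_ne_zero` (`μ ≠ 0 ⟹ wOf μ ≠ 0`).
* §4 THE CHECKS AS PREDICATES ON (design, presentation) + THE UNPACKING: `Polarisation E₀ η` ((pad4)(ii): `e, a, t` with
  `e^*a = t·h_std`, `t > 0`; obligation O-pol); `HStdHyperbolic` ((pad4)(iii), obligation O-hyp); `AnchorKit E₀ ψ₀` (the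
  DESIGN-INDEPENDENT data `η`, frame, polarisation, hyperbolicity — once per anchor; PROVED `AnchorKit.hyperbolic_symH`,
  `AnchorKit.symH_eq`); `ClassCheck` ((σ): `μ ≠ 0` and `q·h_K⁴ + wOf μ` supported on `Z`); `CleanAtSeed C I` ((A1@Z) in the
  degree window `I`: `ch_p(𝓔) = c_p h^p` (`p ∈ I ∖ {4}`), `ch₄(𝓔) = q h⁴ + wOf μ`; PROVED `cleanAtSeed_smul`,
  `cleanAtSeed_symH_of_hStd` — check against `h_std`, consume against `h_K` — and `hasBFSheafSeedOn_of_cleanAtSeed`);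
  `Design.RealisedBy` (THE DICTIONARY PREDICATE «the sheaf `𝓔` realises the design `D`»: (A1)-clean AND
  `ch_p(𝓔) = (c_p(D)∕p!)·h^p`, `ch₄(𝓔) = (c₄(D)∕24)·h⁴ + wOf μ(D)`; PROVED `cleanAtSeed_of_realisedBy`: (A1@Z) ⟸ (A1) +
  faithful realisation); **`Design.SeedCheck D K i q`** (THE SEED CHECKER, lci door: C0 ∧ C5 ∧ C6 ∧ C7 ∧ (σ) on the kit `K`)
  with PROVED `seedData_of_seedCheck` (a passing pair on `(E₀, ψ₀)` gives the conclusion of `stub_rung_pad4_seedAt` for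
  that anchor, LITERALLY) and `blochSeedDiscOne_of_seedChecks` (passing pairs on every CM anchor ⟹ the crux
  `BlochSeedDiscOne` BY NAME, via `Anchor.blochSeedDiscOne_of_forall_pad4_seedAt`; hypothesis-carrying, not
  `exact?`-abusable); the record form `SeedCertificate` ∕ `seedData_of_certificate` ∕ `blochSeedDiscOne_of_certificates`;
  and **`Design.SheafSeedCheck D C I K 𝓔`** (THE SHEAF-SEED CHECKER, sheaf door: C0 ∧ `4 ∈ I ⊆ {0..8}` ∧ finite locally
  free ∧ `I`-semiregular ∧ `RealisedBy`) with PROVED `hasHyperbolicBFSheafSeedOn_of_sheafSeedCheck` (⟹ the tree's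
  `HasHyperbolicBFSheafSeedOn C 4 1 I`, the input of `SheafSeedOnAnchor`'s one-model sheaf door).

FLAGS (the memo `SEED-CHECKER-C5C8-c5c8-1-g0.md` has the table): (d=1) is VACUOUS as a check on a 𝔅(μ₄) design (the
alphabet is `ℤ[i]`; its only residue is orientation covariance, §1); (σ) at design level IS C0's `μ ≠ 0` (the Weil
coordinate of `[Z(s)] = c₄(𝓔(tH))` is `−6μ`, Newton's identity, pencil) — implied by C0 given C5 and (A1) in degrees `≤ 3`;
its object-level half (`supported`) is MATH; (A1@Z) is implied by (A1) of the design for every presentation that is a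
RESOLUTION of `𝓔` by bundles realising the cells (additivity `ChernCharacterBetti.ch_shortExact`) and differs from it
exactly by the Chern character of the non-exact part (§1 `classScreenLE_add_iff_of_vanishes` is its degree filter); for
the lci door only its degree-`≤ 4` part matters and only through (σ); (pad4) is GENUINELY NEW relative to C0–C4: the
uniformity in the binders, the nested anchor, the CHOSEN polarisation `e^*a ∈ ℚ_{>0}·h_std` (the opaque `(e, a)` of
`aimedSplitProduct_cmSquare_of_pos` carries weighted Segre classes and is NOT compatible with the frame's `ℚ[h]`), the
Weil frame O-W and the hyperbolicity of `h_std` O-hyp (design-independent, once per anchor).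

**v2 (g1, 2026-08-29) — §5, ADDITIVE (no §1–§4 declaration changed; `Lines/birth.lean` untouched).** §5.1 JSON: the RANK-FREE ∕
rank-`r` class data `ClassDataRankFree` ∕ `ClassDataR r` (director R19.262 (3); `ClassData = ClassDataR 4`), APEX PADDING
`Design.padApex a k` = `D + k·[𝒪(a h)]` with `wch ∕ μ ∕ Clean ∕ c_p ∕ rank` PROVED (`c_p ↦ c_p + k a^p`, `μ` fixed) and the object-side
warning that `k ≥ 2` EQUAL twists kill every `σ_{q'}` on the `𝔰𝔩_k ⊗ H^{0,2}` block; the DILATION `D_m` (`dilPt`, `MCell.dil`, `Design.dil`)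
with the class dilation law `ch(D_m Z)(w) = m^{deg w} ch(Z)(w)` PROVED (`MCell.ch_dil`; `μ ↦ m⁴μ`, `c_p ↦ m^p c_p`). §5.2 the
TRACE-PART TEST `Design.TraceAlive I` (memo-15 (N-a) generalised): a json-decidable NECESSARY condition for C7 at any faithful locally free
realisation, **not implied by C0–C4** (Bloch ∕ BF window `{4}`: `c₃(D) ≠ 0`; FREE on the Koszul window `koszulWindow = {1,2,3,4}` of
hsemireg-c4-1 g1's LEMMA KC, whose `KoszulCompat` (MIXING form) ∕ abstract `TwistedVanishing` are consumed BY NAME, not imported). §5.3 OBJECT: the rank-free sheaf door `SheafSeedCheckRankFree` ∕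
`SheafSeedCheckR r` with soundness `→ HasHyperbolicBFSheafSeedOn C 4 1 I` PROVED (repackaging); the TOWER-OVER-A-SEED clauses (director
ORDER (c), cycle AND sheaf version): `IsKernelCharacter` (`P_χ`, `χ ∈ (ker φ)^∨`), `TwistedNormalH1Vanishes` (C7⁺ cycle:
`H¹(Z, 𝒩 ⊗ P_χ|_Z) = 0`, `χ ≠ 1`), `TwistedEndExt2Vanishes` (C7⁺ sheaf), Mukai's `sigmaSet` and `SigmaAvoidance` (R19.222 (4)), the law
`TowerOverSeedLaw` as a NAMED `Prop` (neither proved nor asserted) with its two consumer lemmas, and the checkers-with-tower-clause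
`SeedCheckTower` ∕ `SheafSeedCheckTower` — flagged EXTRA: needed by the isogeny tower ∕ R-C room only, NOT by `stub_rung_pad4_seedAt`.
§5.4 `RealisedBy` is `[α]^*`-COVARIANT onto the dilated design (`Design.realisedBy_dil_pullback`, PROVED from `map_ch` + `map_cupPowTwo`
under the frame-scaling hypotheses `φ^*h = m h`, `φ^*r_j = m⁴ r_j` — critic memo-h3-11 σ2); `IsISemiregular` is not (defect = C7⁺).
v2 FLAGS: `TraceAlive` NEW necessary json condition; `TwistedNormalH1Vanishes`∕`TwistedEndExt2Vanishes`∕`SigmaAvoidance` NEW object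
conditions for the TOWER only; `ClassDataRankFree` WEAKER than C0 (rank and `m ≥ 1` dropped — what the sheaf door actually consumes);
padding ∕ dilation are json-innocent ((A1), `μ ≠ 0` preserved ∕ scaled). Still nothing proved toward HC ∕ HC_CM ∕ HC_AV ∕ №4 ∕ 26512 ∕
18881 ∕ H2: no seed is produced; the stub stays open.

**v3 (g2, 2026-08-29) — §6, ADDITIVE (no §1–§5 declaration changed; `Lines/birth.lean` untouched): PRESENTATIONS.** §6.1 JSON: the
side tensors `Design.wchN` ∕ `wchP` (`T = T_N − T_P`, `rfl`), words by degree (`wordsOfDeg`, `eFreeWordsOfDeg`), and `μ̄ = conj μ`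
PROVED for every design (`Design.mubar_eq_star_mu`, from `bphi_four_eq_star`: the letter `ē` is the conjugate of `e`). §6.2 THE WORD
FRAME `WordFrame E₀` (INTERFACE, obligation O-WF, design-independent: a class `cls p w ∈ H^{2p}(S⁴)` per word) with its LAWS
`WordFrame.LinksTo Φ F h` (a `Prop`: (F1) `Σ_{e-free, deg p} cls = h^p∕p!`, (F2) `r₁ = eeee + ēēēē`, `r₂ = i(eeee − ēēēē)`); the class
a tensor names `WordFrame.classOf` (additive); PROVED `Design.classOf_wch_of_ne_four` ∕ `Design.classOf_wch_four`: for an (A1)-CLEAN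
design the class its tensor names IS `(c_p∕p!) h^p` (`p ≠ 4`) ∕ `(c₄∕24) h⁴ + wOf μ` — the json ↔ frame dictionary of `RealisedBy`,
kernel-checked. §6.3 `RealisesTensor C Φ 𝓕 T` («the sheaf realises the tensor», `ch_p(𝓕) = classOf T p`, `p ≤ 8`) with THE COLLAPSE
`Design.realisedBy_of_realisesTensor` ((A1@Z) ⟸ (A1): `RealisesTensor 𝓔 T(D) → Clean → RealisedBy`), EXACTNESS lemmas from
`ChernCharacterBetti.ch_shortExact` ∕ `ch_biprod` ∕ `ch_congr` (middle term `T₁ + T₃`, kernel `T₂ − T₃`, cokernel `T₂ − T₁`, `⊞`,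
isomorphism, zero), letters with multiplicity (`HasChOfLetters`, `realisesTensor_of_hasChOfLetters`, `Design.realisesTensor_wchN ∕ P`),
and TWIST-BLINDNESS TYPED: `ChEquiv C L L'` (same `ch`; the case of record `L' = L ⊗ α`, `α ∈ Pic⁰`, `c₁(α) = 0 ∈ H²(−;ℚ)` is MATH and
stays a hypothesis — `ChernCharacterBetti` has no tensor field), `RealisesTensor.of_chEquiv`, `HasChOfCopies` + `hasChOfLetters_of_copies`
(a twisted copy counts as one more copy of the same cell: every class-side predicate of this file is blind to `Pic⁰`-twists; twists
are seen only by the display's `Hom`∕`Ext` pattern — the bc5∕monad instruments — and by the object conjuncts C5–C7). §6.4 PRESENTATIONS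
⟹ `RealisedBy`: `KernelPresentation` (`0 → 𝓔 → 𝓝 → 𝓟 → 0`), `CokernelPresentation` (`0 → 𝓟 → 𝓝 → 𝓔 → 0`), `MonadPresentation`
(`𝓐 ↪ 𝓑 ↠ 𝓒` as two short exact sequences, `T_B − T_C − T_A = T(D)`) — structures recording exactly what the class side reads
(exactness, vector-bundle ends, the side tensors) — each with `.realisesTensor` and `.realisedBy` PROVED; the LETTER KIT `LetterKit C Φ s`
(obligation O-cells: a rank-`≤ 1` bundle per cell realising `ch(Z)`), the WORD KIT `WordKit E₀ ψ₀` (= `AnchorKit` + linked word frame),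
and the sheaf door END-TO-END `Design.sheafSeedCheckRankFree_of_kernelPresentation ∕ _cokernel… ∕ _monad…` +
`hasHyperbolicBFSheafSeedOn_of_kernelPresentation`. v3 FLAGS: (A1@Z) is now DISCHARGED IN LEAN for every exact presentation by
bundles realising the cells (it was g0's pencil sentence) — so for such presentations C5–C8's class side reduces to C0's `Clean` plus
the design-independent obligations O-W ∕ O-pol ∕ O-hyp ∕ O-WF and the per-cell O-cells; what remains GENUINELY object-side is C5
(finite locally free ∕ lci) and C7 (semiregularity) — and, for the lci door, the support half of (σ). Still nothing proved toward
HC ∕ HC_CM ∕ HC_AV ∕ №4 ∕ 26512 ∕ 18881 ∕ H2: no presentation is exhibited; the stub stays open.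

**v4 (g3, 2026-08-29) — §7, ADDITIVE (no §1–§6 declaration changed; `Lines/birth.lean` untouched): TWISTS, PARTNER COVERAGE, AND
THE CLASS OF THE ZERO LOCUS.** §7.1 JSON: THE TWIST `D(t)` (`Design.tw`: every cell `(α, β) ↦ (α + t, β)` on every factor — the json
of `𝓔(tH)`, `H = Σ_f pr_f^* x₀`): the letter operator `M_t` (`twKer`; `bphi_twPt`: `φ(x + t) = M_t·φ(x)` on `(1, α, α, β, β̄, α² − |β|²)`),
the induced `ℤ[i]`-linear `M_t^{⊗4}` (`twOp`; `MCell.ch_tw`, `Design.tw_wch`), its generating function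
`Σ_{l' e-free} M_t(l, l') X^{deg l'} = (X + t)^{deg l}` (`twPoly_eq`) and THE TWIST OF `ĥ_k = h^k∕k!` (`twOp_hHat_apply`:
`M_t^{⊗4} ĥ_k = Σ_j C(j, k) t^{j−k} ĥ_j`, via `ℤ[X]` and `Polynomial.coeff_X_add_C_pow`); PROVED: `μ`, `μ̄`, the rank, positivity are
twist-INVARIANT (`tw_mu`, `tw_mubar`, `tw_rank`, `tw_positive_iff`: `M_t` fixes the letters `e`, `ē`, `1`), (A1) is twist-invariant
(`tw_clean`, from `classScreen_twOp`: `ℚ[h] ⊕ W` is `M_t^{⊗4}`-stable), hence C0 (`tw_classData`), and THE COEFFICIENT LAW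
`c_p(D(t)) = Σ_d C(p, d) t^{p−d} c_d(D)` for a clean design (`tw_coeff`, through the frame decomposition
`wch(D) = Σ_k c_k ĥ_k + μ·eeee + μ̄·ēēēē`, `wch_decomp_of_clean`). §7.2 JSON: PARTNER COVERAGE `Design.PartnerUp ∕ PartnerDown` — every
`P`-cell with `m_P > 0` has a live `N`-partner (`m_N > 0`) with `Hom(L_P, L_N) ≠ 0` (UP display `0 → ⊕L_P → ⊕L_N → 𝓔 → 0`) ∕
`Hom(L_N, L_P) ≠ 0` (DOWN display), `Hom(L_x, L_y) ≠ 0 ⟺ y − x` effective (`MCell.le`, `Pad4TowerLlite.Effective` = the HALL₀ rule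
«`Δ = 0 ∨ (Δα > 0 ∧ Δα² ≥ |Δβ|²)`») — and HALL₀ ITSELF, `Design.HallUp ∕ HallDown` (C3; the design instance of the abstract weighted
`Hall E m n` of `Cruxes/BlochSeedDiscOne/ColourForgetHall.lean`: `Σ_{P ∈ U} m_P ≤ Σ_{N ∈ Γ(U)} m_N` for every `U` in the powerset of the
`P`-support, live neighbourhoods `Design.nbhdUp ∕ nbhdDown`); PROVED: partner coverage is the singleton layer of HALL₀
(`partnerUp_of_hallUp ∕ partnerDown_of_hallDown`) and both are twist-invariant (`tw_partnerUp_iff ∕ …Down…`, `tw_hallUp_iff ∕ …Down…`,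
from `MCell.le_tw_iff`, `tw_nbhdUp`); all four decidable on a design of record (a kernel `decide` toy exercises them). §7.3 OBJECT: the Chern classes `c₁, …, c₄` FROM `ch` BY NEWTON ON THE CARRIER `H^{2p}(X(ℂ); ℂ)` (`chernOne … chernFour`
with the tree's `cupProduct`; `cupProduct_cupPowTwo_cupPowTwo`: `hⁱ ∪ hʲ = hⁱ⁺ʲ`); THE `W`-COORDINATE THEOREM `chernFour_eq_of_cleanAtSeed`
((A1@Z) in a window `⊇ {1, 2, 3}` with `W`-coordinate `μ` ⟹ `c₄ = q'·h⁴ + wOf(−6μ)`: g0's pencil sentence «the `W`-coordinate of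
`c₄(𝓔(tH))` is `−6μ`», kernel-checked — so `c₄ ∉ ℚ[h]` iff `μ ≠ 0`); THE ZERO SCHEME OF A SECTION `IsZeroSchemeOf s i` (closed immersion,
`i^*s = 0`, universal among `g` with `g^*s = 0`; Mathlib `Scheme.Modules.pullback`, the tree's `Modules.unitModule`); THE TOP-CHERN-CLASS
LOCALISATION LAW `TopChernFourLocalisation C` (a `Prop`, NOT proved, NOT asserted, consumed only as a hypothesis: `c₄` of a rank-`4`
vector bundle is supported on the zero scheme of any of its sections — Fulton Example 14.1.1 ∕ Prop. 14.1 (b) read in Betti cohomology;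
NOT derivable from `ChernCharacterBetti`'s fields); and the lci door END-TO-END GIVEN THE LAW: `supported_of_zeroScheme` ∕
`supported_symH_of_zeroScheme` ((σ) object half: `q·h_K⁴ + wOf μ` supported on `Z(s)`, explicit `q`), `Design.seedCheck_of_zeroScheme`
(C0 + rank `4` + (A1@Z) with the design's `μ` + a section whose zero scheme passes C5–C7 ⟹ `Design.SeedCheck K i q`),
`Design.seedCheck_of_twistedKernelPresentation ∕ …CokernelPresentation` (the same from a presentation of the TWISTED design `D(t)`:
`tw_clean` + `tw_mu` feed `KernelPresentation.realisedBy`), `blochSeedDiscOne_of_zeroSchemes` (hypothesis-carrying, concludes the crux BY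
NAME). v4 FLAGS: the (σ) OBJECT HALF is DISCHARGED IN LEAN MODULO ONE NAMED LAW for zero-scheme presentations — given the law it is
IMPLIED by C0 (`μ`) + C5 (rank-`4` vector bundle, `Z = Z(s)`) + (A1@Z) (itself implied by C0 + an exact presentation, v3): no separate
check remains on the class side of the lci door; the TWIST is json-innocent for everything this file reads (C0, `μ`, `μ̄`, rank, partner
coverage and HALL₀ invariant; it moves only the coefficients `c_p` — by the stated law — and the display's `Hom ∕ Ext` PATTERN OF DEGREES,
which this file does not read); PARTNER COVERAGE is IMPLIED by C3 (proved), recorded as its typed decidable first layer (the «partner-less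
orbits» the R-B screens report), not a new condition; HALL₀ typed here is C3 itself (no new condition). Still nothing proved toward
HC ∕ HC_CM ∕ HC_AV ∕ №4 ∕ 26512 ∕ 18881 ∕ H2: no bundle, section or zero scheme is exhibited, the law is a hypothesis; the stub stays open.

Imports `Cruxes/BlochSeedDiscOne/Anchor.lean` (NOT `Lines/birth.lean`: import hygiene, critic ruling L2∕T4).
-/

noncomputable section

set_option linter.dupNamespace false

open CategoryTheory AlgebraicGeometry
open Literature.AlgebraicGeometry Literature.AlgebraicGeometry.Motives Literature.AlgebraicGeometry.HodgeTheory
open Literature.AlgebraicTopology.SingularHomology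

namespace Summit.HodgeConjecture.HodgeConjecture.Cruxes.BlochSeedDiscOne.SeedChecker

open Summit.HodgeConjecture.HodgeConjecture.Cruxes.BlochSeedDiscOne.Anchor
open Summit.Ventures.HSemireg Summit.Ventures.HSemireg.Pad4Tower

/-! ## §1 JSON side: the design, the C0 recap, the truncated screen, orientation covariance -/

section JsonSide

/-- **A DESIGN** = the content of a design json of record (`…-design-rank4.json`: keys `"N"`, `"P"`, cell keys
`[[α, Re β, Im β] × 4] ↦ multiplicity`): a finite configuration of 𝔅(μ₄) cells (`cfg.lower` = the `N`-cells,
`cfg.upper` = the `P`-cells) with integer multiplicities per side. (The optional `"split"` key of monad designs —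
`A ⊂ N`, quotient `C` — is presentation data, §4.) -/
structure Design where
  /-- the support: `N`-cells below, `P`-cells above -/
  cfg : MConfig
  /-- multiplicities of the `N`-cells -/
  mN : MCell → ℤ
  /-- multiplicities of the `P`-cells -/
  mP : MCell → ℤ

namespace Design

/-- the weighted class tensor `Σ_N m_N ch(N) − Σ_P m_P ch(P)` of the design (`MConfig.wch`). -/
def wch (D : Design) : CWord → GaussianInt := D.cfg.wch D.mN D.mP

/-- C0, class screen: the design tensor passes (A1)∕(H1) (`Pad4TowerClassScreen.ClassScreen`). -/
def Clean (D : Design) : Prop := ClassScreen D.wch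

/-- the `eeee`-coefficient `μ` of the design tensor. -/
def mu (D : Design) : GaussianInt := D.wch eWord

/-- the `ēēēē`-coefficient `μ̄`. -/
def mubar (D : Design) : GaussianInt := D.wch ebarWord

/-- the unit word `1111` (degree `0`). -/
def rankWord : CWord := ![0, 0, 0, 0]

/-- the rank of the design: the coefficient of the unit word. -/
def rank (D : Design) : GaussianInt := D.wch rankWord

/-- strictly positive multiplicities on the support (`m ≥ 1`). -/
def Positive (D : Design) : Prop := (∀ Z ∈ D.cfg.lower, 0 < D.mN Z) ∧ ∀ P ∈ D.cfg.upper, 0 < D.mP P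

/-- **C0 (class data) of the seed-condition list**: (A1)-clean, `μ ≠ 0`, rank `4`, `m ≥ 1` (integrality is built in). -/
def ClassData (D : Design) : Prop := D.Clean ∧ D.mu ≠ 0 ∧ D.rank = 4 ∧ D.Positive

end Design

/-- every cell has unit-word coefficient `1` (`bphi x 0 = 1` on each factor). -/
theorem MCell.ch_rankWord (Z : MCell) : Z.ch Design.rankWord = 1 := by
  simp [MCell.ch, chTensor, bphi, phiVec, Design.rankWord]

/-- **the rank is `Σ m_N − Σ m_P`.** -/
theorem Design.rank_eq (D : Design) :
    D.rank = ((∑ Z ∈ D.cfg.lower, D.mN Z - ∑ P ∈ D.cfg.upper, D.mP P : ℤ) : GaussianInt) := by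
  simp only [Design.rank, Design.wch, MConfig.wch, Pi.sub_apply, Finset.sum_apply, Pi.smul_apply,
    MCell.ch_rankWord]
  simp only [zsmul_one, Int.cast_sub, Int.cast_sum]

theorem Design.rankWord_eq_refWord : Design.rankWord = refWord 0 := by
  decide

/-! ### Integer values on e-free words; the design's `ℚ[h]`-coefficients `c_p(D)` -/

/-- the INTEGER letter vector of a factor point on the e-free letters `1, u, v, p` (`α ↦ 1, α, α, ·, ·, α² − |β|²`;
`0` on `e, ē`, where `bphi` is `β, β̄`). -/
def bphiZ (x : BPoint) : Fin 6 → ℤ := ![1, x.1, x.1, 0, 0, x.1 ^ 2 - x.2.1 ^ 2 - x.2.2 ^ 2]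

/-- on e-free letters the Gaussian letter value is the integer one. -/
theorem bphi_eq_intCast (x : BPoint) (l : Fin 6) (h3 : l ≠ 3) (h4 : l ≠ 4) :
    bphi x l = ((bphiZ x l : ℤ) : GaussianInt) := by
  fin_cases l <;> simp_all [bphi, phiVec, bphiZ]

/-- the integer class value of a cell on a word (read on the e-free letters). -/
def MCell.chZ (Z : MCell) (w : CWord) : ℤ :=
  bphiZ (Z 0) (w 0) * bphiZ (Z 1) (w 1) * bphiZ (Z 2) (w 2) * bphiZ (Z 3) (w 3)

/-- **on an e-free word the class value of a cell is an integer.** -/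
theorem MCell.ch_eq_intCast (Z : MCell) {w : CWord} (hw : EFree w) : Z.ch w = ((MCell.chZ Z w : ℤ) : GaussianInt) := by
  simp only [MCell.ch, chTensor, MCell.chZ, bphi_eq_intCast _ _ (hw 0).1 (hw 0).2,
    bphi_eq_intCast _ _ (hw 1).1 (hw 1).2, bphi_eq_intCast _ _ (hw 2).1 (hw 2).2,
    bphi_eq_intCast _ _ (hw 3).1 (hw 3).2, Int.cast_mul]

/-- the integer weighted class value of a design on a word (read on the e-free letters) — what the cell's scripts
compute from the json. -/
def Design.wchZ (D : Design) (w : CWord) : ℤ :=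
  ∑ Z ∈ D.cfg.lower, D.mN Z * MCell.chZ Z w - ∑ P ∈ D.cfg.upper, D.mP P * MCell.chZ P w

/-- **on an e-free word the design tensor is the integer `wchZ`.** -/
theorem Design.wch_eq_intCast (D : Design) {w : CWord} (hw : EFree w) :
    D.wch w = ((D.wchZ w : ℤ) : GaussianInt) := by
  simp only [Design.wch, MConfig.wch, Pi.sub_apply, Finset.sum_apply, Pi.smul_apply]
  simp only [MCell.ch_eq_intCast _ hw, zsmul_eq_mul, Design.wchZ, Int.cast_sub, Int.cast_sum, Int.cast_mul]

theorem Design.im_wch_of_eFree (D : Design) {w : CWord} (hw : EFree w) : (D.wch w).im = 0 := by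
  rw [D.wch_eq_intCast hw, Zsqrtd.im_intCast]

/-- **THE DESIGN'S `ℚ[h]`-COEFFICIENTS `c_p(D)`, `p = 0, …, 8`**: the integer value of the design tensor on the
reference e-free word of degree `p` (`Pad4TowerClassScreen.refWord`) = the coefficient of `h^p∕p! = hHat p` when `D` is
(A1)-clean (`inQhW_iff_classScreen`: `T = Σ_p c_p · h^p∕p! + μ · eeee + μ̄ · ēēēē`); `c_0 = rank`. -/
def Design.coeff (D : Design) (p : Fin 9) : ℤ := D.wchZ (refWord p)

theorem Design.wch_refWord (D : Design) (p : Fin 9) : D.wch (refWord p) = ((D.coeff p : ℤ) : GaussianInt) :=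
  D.wch_eq_intCast (refWord_spec p).1

/-- for an (A1)-clean design EVERY e-free word of degree `p` carries the coefficient `c_p(D)`. -/
theorem Design.wch_eq_coeff_of_clean (D : Design) (hD : D.Clean) {w : CWord} (hw : EFree w) :
    D.wch w = ((D.coeff ⟨wdeg w, Nat.lt_succ_of_le (wdeg_le_eight w)⟩ : ℤ) : GaussianInt) := by
  rw [← Design.wch_refWord]
  exact hD.2 w _ hw (refWord_spec _).1 (by rw [(refWord_spec _).2])

theorem Design.rank_eq_coeff (D : Design) : D.rank = ((D.coeff 0 : ℤ) : GaussianInt) := by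
  rw [Design.rank, Design.rankWord_eq_refWord, Design.wch_refWord]

/-- **(A1) IN DEGREES `≤ k`** (the truncated class screen): clause (i) for e-mixed words of degree `≤ k`, clause (ii)
for e-free words of equal degree `≤ k`. For `k = 4` this is the part of (A1) that the class of a regular section
`[Z(s)] = c₄(𝓔(tH))` reads. -/
def ClassScreenLE {R : Type*} [Zero R] (k : ℕ) (T : CWord → R) : Prop :=
  (∀ w, wdeg w ≤ k → ¬ EFree w → w ≠ eWord → w ≠ ebarWord → T w = 0) ∧
    (∀ w w', wdeg w ≤ k → EFree w → EFree w' → wdeg w = wdeg w' → T w = T w')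

/-- the full screen implies every truncated screen. -/
theorem classScreenLE_of_classScreen {R : Type*} [Zero R] (k : ℕ) (T : CWord → R) (h : ClassScreen T) :
    ClassScreenLE k T :=
  ⟨fun w _ hw h1 h2 => h.1 w hw h1 h2, fun w w' _ hw hw' hd => h.2 w w' hw hw' hd⟩

/-- **the truncated screen does not see corrections in degrees `> k`**: if `corr` vanishes on all words of degree
`≤ k` (the numerical shadow of «the presentation is exact off codimension `≥ k + 1`»), then `T + corr` passes (A1) in
degrees `≤ k` iff `T` does. -/
theorem classScreenLE_add_iff_of_vanishes {R : Type*} [AddCommGroup R] (k : ℕ) (T corr : CWord → R)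
    (hcorr : ∀ w, wdeg w ≤ k → corr w = 0) : ClassScreenLE k (T + corr) ↔ ClassScreenLE k T := by
  constructor
  · rintro ⟨h0, hd⟩
    refine ⟨fun w hk hw h1 h2 => ?_, fun w w' hk hw hw' hdeg => ?_⟩
    · have := h0 w hk hw h1 h2
      simpa [hcorr w hk] using this
    · have := hd w w' hk hw hw' hdeg
      simpa [hcorr w hk, hcorr w' (hdeg ▸ hk)] using this
  · rintro ⟨h0, hd⟩
    refine ⟨fun w hk hw h1 h2 => ?_, fun w w' hk hw hw' hdeg => ?_⟩
    · simp [h0 w hk hw h1 h2, hcorr w hk]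
    · simp [hd w w' hk hw hw' hdeg, hcorr w hk, hcorr w' (hdeg ▸ hk)]

/-! ### Orientation covariance: `ψ₀ ↦ -ψ₀` swaps `e ↔ ē` -/

/-- the letter swap `e ↔ ē` (`3 ↔ 4`), all other letters fixed. -/
def swapE : Fin 6 → Fin 6 := ![0, 1, 2, 4, 3, 5]

/-- the conjugate word: swap `e ↔ ē` on every factor. -/
def conjWord (w : CWord) : CWord := fun f => swapE (w f)

/-- letter facts: the swap preserves e-freeness and degree and is an involution. [`decide`] -/
theorem swapE_spec : ∀ l : Fin 6,
    ((swapE l ≠ 3 ∧ swapE l ≠ 4) ↔ (l ≠ 3 ∧ l ≠ 4)) ∧ ldeg (swapE l) = ldeg l ∧ swapE (swapE l) = l := by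
  decide

theorem eFree_conjWord (w : CWord) : EFree (conjWord w) ↔ EFree w :=
  forall_congr' fun f => (swapE_spec (w f)).1

theorem ldeg_swapE (l : Fin 6) : ldeg (swapE l) = ldeg l := (swapE_spec l).2.1

theorem wdeg_conjWord (w : CWord) : wdeg (conjWord w) = wdeg w := by
  simp only [wdeg, conjWord, ldeg_swapE]

theorem conjWord_conjWord (w : CWord) : conjWord (conjWord w) = w :=
  funext fun f => (swapE_spec (w f)).2.2

theorem conjWord_eWord : conjWord eWord = ebarWord := by
  decide

theorem conjWord_rankWord : conjWord Design.rankWord = Design.rankWord := by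
  decide

theorem conjWord_ebarWord : conjWord ebarWord = eWord := by
  rw [← conjWord_eWord, conjWord_conjWord]

/-- **the class screen is orientation-covariant**: if `T` passes (A1) then so does `T ∘ conjWord`. -/
theorem classScreen_comp_conjWord {R : Type*} [Zero R] (T : CWord → R) (h : ClassScreen T) :
    ClassScreen (T ∘ conjWord) := by
  refine ⟨fun w hw h1 h2 => h.1 (conjWord w) ((eFree_conjWord w).not.2 hw) ?_ ?_, fun w w' hw hw' hd =>
    h.2 _ _ ((eFree_conjWord w).2 hw) ((eFree_conjWord w').2 hw') (by rw [wdeg_conjWord, wdeg_conjWord, hd])⟩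
  · intro hc
    apply h2
    rw [← conjWord_conjWord w, hc, conjWord_eWord]
  · intro hc
    apply h1
    rw [← conjWord_conjWord w, hc, conjWord_ebarWord]

/-- the conjugate factor point `(α, Re β, -Im β)`. -/
def conjPt (x : BPoint) : BPoint := (x.1, x.2.1, -x.2.2)

theorem conjPt_conjPt (x : BPoint) : conjPt (conjPt x) = x := by
  simp [conjPt]

/-- the letter vector of the conjugate point is the `e ↔ ē`-swapped letter vector. -/
theorem bphi_conjPt (x : BPoint) : bphi (conjPt x) = bphi x ∘ swapE := by
  funext l
  fin_cases l <;> simp [bphi, phiVec, swapE, conjPt]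

/-- the conjugate cell (conjugate every factor point) = the cell seen from `-ψ₀`. -/
def MCell.conj (Z : MCell) : MCell := fun f => conjPt (Z f)

theorem MCell.conj_conj (Z : MCell) : MCell.conj (MCell.conj Z) = Z :=
  funext fun f => conjPt_conjPt (Z f)

/-- **`ch(Z̄) = ch(Z) ∘ conjWord`.** -/
theorem MCell.ch_conj (Z : MCell) : (MCell.conj Z).ch = Z.ch ∘ conjWord := by
  funext w
  simp only [MCell.ch, chTensor, MCell.conj, bphi_conjPt, Function.comp_apply, conjWord]

/-- conjugation of cells as an embedding (it is an involution). -/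
def MCell.conjEmb : MCell ↪ MCell :=
  ⟨MCell.conj, Function.LeftInverse.injective MCell.conj_conj⟩

/-- the conjugate design `D̄`: conjugate every cell, keep its multiplicity. -/
def Design.conj (D : Design) : Design where
  cfg := ⟨D.cfg.lower.map MCell.conjEmb, D.cfg.upper.map MCell.conjEmb⟩
  mN := fun Z => D.mN (MCell.conj Z)
  mP := fun P => D.mP (MCell.conj P)

/-- **`wch(D̄) = wch(D) ∘ conjWord`.** -/
theorem Design.conj_wch (D : Design) : D.conj.wch = D.wch ∘ conjWord := by
  funext w
  simp only [Design.wch, MConfig.wch, Design.conj, Finset.sum_map, Pi.sub_apply, Finset.sum_apply,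
    Pi.smul_apply, Function.comp_apply, MCell.conjEmb, Function.Embedding.coeFn_mk, MCell.conj_conj,
    MCell.ch_conj]

/-- **`μ(D̄) = μ̄(D)`** (and symmetrically). -/
theorem Design.conj_mu (D : Design) : D.conj.mu = D.mubar := by
  rw [Design.mu, Design.conj_wch, Function.comp_apply, conjWord_eWord]; rfl

theorem Design.conj_mubar (D : Design) : D.conj.mubar = D.mu := by
  rw [Design.mubar, Design.conj_wch, Function.comp_apply, conjWord_ebarWord]; rfl

/-- **the C0 class screen is orientation-covariant.** -/
theorem Design.conj_clean (D : Design) (h : D.Clean) : D.conj.Clean := by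
  rw [Design.Clean, Design.conj_wch]
  exact classScreen_comp_conjWord _ h

/-- the rank is orientation-invariant. -/
theorem Design.conj_rank (D : Design) : D.conj.rank = D.rank := by
  rw [Design.rank, Design.conj_wch, Function.comp_apply, conjWord_rankWord]; rfl

end JsonSide

/-! ## §2 Anchor side, concrete: the frame's polarisation `h_std = Σ_f (u_f + v_f)` on `pad4Anchor E₀` -/

section AnchorSide

variable (E₀ : AbelianVariety ℂ) (ψ₀ : E₀ ⟶ E₀) (η : complexBetti E₀.X 2)

/-- `h_S = pr₁^*η + pr₂^*η` on `S = E₀ × E₀` (the frame's `u + v`, `η` the rational generator of `H²(E₀(ℂ))`). -/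
def hSurf : complexBetti (weilSurf E₀).X 2 :=
  complexBetti.map (AbelianVariety.fst E₀ E₀).hom.hom.hom 2 η +
    complexBetti.map (AbelianVariety.snd E₀ E₀).hom.hom.hom 2 η

/-- `h` on `S² = S × S`. -/
def hPad2 : complexBetti (pad2Anchor E₀).X 2 :=
  complexBetti.map (AbelianVariety.fst (weilSurf E₀) (weilSurf E₀)).hom.hom.hom 2 (hSurf E₀ η) +
    complexBetti.map (AbelianVariety.snd (weilSurf E₀) (weilSurf E₀)).hom.hom.hom 2 (hSurf E₀ η)

/-- `h` on `S³ = S² × S`. -/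
def hPad3 : complexBetti (pad3Anchor E₀).X 2 :=
  complexBetti.map (AbelianVariety.fst (pad2Anchor E₀) (weilSurf E₀)).hom.hom.hom 2 (hPad2 E₀ η) +
    complexBetti.map (AbelianVariety.snd (pad2Anchor E₀) (weilSurf E₀)).hom.hom.hom 2 (hSurf E₀ η)

/-- **`h_std = Σ_{f<4} pr_f^*(u_f + v_f)` on the pad-4 anchor `S⁴ = S³ × S`**, nested exactly as `pad4Anchor E₀`
(the polarisation the frame of record calls `h`, `h^k∕k! = hHat k`). -/
def hStd : complexBetti (pad4Anchor E₀).X 2 :=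
  complexBetti.map (AbelianVariety.fst (pad3Anchor E₀) (weilSurf E₀)).hom.hom.hom 2 (hPad3 E₀ η) +
    complexBetti.map (AbelianVariety.snd (pad3Anchor E₀) (weilSurf E₀)).hom.hom.hom 2 (hSurf E₀ η)

variable {E₀ ψ₀ η}

theorem hSurf_rational (hη : IsRationalClass η) : IsRationalClass (hSurf E₀ η) :=
  (hη.map _).add (hη.map _)

theorem hPad2_rational (hη : IsRationalClass η) : IsRationalClass (hPad2 E₀ η) :=
  ((hSurf_rational hη).map _).add ((hSurf_rational hη).map _)

theorem hPad3_rational (hη : IsRationalClass η) : IsRationalClass (hPad3 E₀ η) :=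
  ((hPad2_rational hη).map _).add ((hSurf_rational hη).map _)

/-- `h_std` is a rational class. -/
theorem hStd_rational (hη : IsRationalClass η) : IsRationalClass (hStd E₀ η) :=
  ((hPad3_rational hη).map _).add ((hSurf_rational hη).map _)

/-- `φ_S^* h_S = h_S` (`(±ψ₀)^* η = η` on the line `H²(E₀(ℂ))`, `cmCurve_map_two` at `d = 1`). -/
theorem map_weilSurfAct_hSurf (hE : E₀.dim = 1) (hψ : ψ₀ ≫ ψ₀ = -(1 • 𝟙 E₀)) :
    complexBetti.map (weilSurfAct E₀ ψ₀).hom.hom.hom 2 (hSurf E₀ η) = ((1 : ℕ) : ℂ) • hSurf E₀ η := by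
  have hψ' : (-ψ₀) ≫ (-ψ₀) = -(1 • 𝟙 E₀) := neg_comp_neg_eq hψ
  have h1 : complexBetti.map ψ₀.hom.hom.hom 2 η = ((1 : ℕ) : ℂ) • η :=
    (cmCurve_map_two hE one_pos hψ η : complexBetti.map ψ₀.hom.hom.hom 2 η = ((1 : ℕ) : ℂ) • η)
  have h2 : complexBetti.map (-ψ₀).hom.hom.hom 2 η = ((1 : ℕ) : ℂ) • η :=
    (cmCurve_map_two hE one_pos hψ' η : complexBetti.map (-ψ₀).hom.hom.hom 2 η = ((1 : ℕ) : ℂ) • η)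
  exact af_product_symm _ _ h1 h2

theorem map_pad2Action_hPad2 (hE : E₀.dim = 1) (hψ : ψ₀ ≫ ψ₀ = -(1 • 𝟙 E₀)) :
    complexBetti.map (pad2Action E₀ ψ₀).hom.hom.hom 2 (hPad2 E₀ η) = ((1 : ℕ) : ℂ) • hPad2 E₀ η :=
  af_product_symm _ _ (map_weilSurfAct_hSurf hE hψ) (map_weilSurfAct_hSurf hE hψ)

theorem map_pad3Action_hPad3 (hE : E₀.dim = 1) (hψ : ψ₀ ≫ ψ₀ = -(1 • 𝟙 E₀)) :
    complexBetti.map (pad3Action E₀ ψ₀).hom.hom.hom 2 (hPad3 E₀ η) = ((1 : ℕ) : ℂ) • hPad3 E₀ η :=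
  af_product_symm _ _ (map_pad2Action_hPad2 hE hψ) (map_weilSurfAct_hSurf hE hψ)

/-- **`ψ^* h_std = h_std`** on the pad-4 anchor. -/
theorem map_pad4Action_hStd (hE : E₀.dim = 1) (hψ : ψ₀ ≫ ψ₀ = -(1 • 𝟙 E₀)) :
    complexBetti.map (pad4Action E₀ ψ₀).hom.hom.hom 2 (hStd E₀ η) = hStd E₀ η := by
  have h := af_product_symm _ _ (map_pad3Action_hPad3 (η := η) hE hψ) (map_weilSurfAct_hSurf (η := η) hE hψ)
  rw [Nat.cast_one, one_smul] at h
  exact h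

/-- **the `K`-symmetrised class of a polarisation datum with `e^*a = t·h_std` is `2t·h_std`** (`d = 1`:
`symH = 1·e^*a + ψ^*e^*a`). -/
theorem symH_eq_smul_hStd (hE : E₀.dim = 1) (hψ : ψ₀ ≫ ψ₀ = -(1 • 𝟙 E₀))
    (e : ProjectiveEmbedding (pad4Anchor E₀).X) (a : complexBetti (projectiveSpace e.n ℂ) 2) (t : ℚ)
    (ha : complexBetti.map e.ι 2 a = ((t : ℚ) : ℂ) • hStd E₀ η) :
    symH (pad4Action E₀ ψ₀) e a = (((2 * t : ℚ)) : ℂ) • hStd E₀ η := by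
  rw [show symH (pad4Action E₀ ψ₀) e a = ((1 : ℕ) : ℂ) • complexBetti.map e.ι 2 a +
      complexBetti.map (pad4Action E₀ ψ₀).hom.hom.hom 2 (complexBetti.map e.ι 2 a) from rfl, ha, map_smul,
    map_pad4Action_hStd hE hψ, Nat.cast_one, one_smul, ← add_smul, Rat.cast_mul, Rat.cast_ofNat, two_mul]

/-- **hyperbolicity for `h_K` is hyperbolicity for `h_std`** (for a polarisation datum with `e^*a = t·h_std`, `t ≠ 0`). -/
theorem isHyperbolicWeilType_symH_iff (hE : E₀.dim = 1) (hψ : ψ₀ ≫ ψ₀ = -(1 • 𝟙 E₀))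
    (e : ProjectiveEmbedding (pad4Anchor E₀).X) (a : complexBetti (projectiveSpace e.n ℂ) 2) {t : ℚ}
    (ht : t ≠ 0) (ha : complexBetti.map e.ι 2 a = ((t : ℚ) : ℂ) • hStd E₀ η) :
    IsHyperbolicWeilType (pad4Anchor E₀) (pad4Action E₀ ψ₀) 4 (symH (pad4Action E₀ ψ₀) e a) ↔
      IsHyperbolicWeilType (pad4Anchor E₀) (pad4Action E₀ ψ₀) 4 (hStd E₀ η) := by
  rw [symH_eq_smul_hStd hE hψ e a t ha]
  exact isHyperbolicWeilType_smul_iff (by exact_mod_cast (mul_ne_zero two_ne_zero ht))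

/-- (d=1) the literal `((1 : ℕ) : ℂ)` of `symH`: at discriminant one `h_K = e^*a + ψ^*e^*a`. -/
theorem symH_discOne {P : AbelianVariety ℂ} (ψ : P ⟶ P) (e : ProjectiveEmbedding P.X)
    (a : complexBetti (projectiveSpace e.n ℂ) 2) :
    symH ψ e a = complexBetti.map e.ι 2 a + complexBetti.map ψ.hom.hom.hom 2 (complexBetti.map e.ι 2 a) := by
  rw [show symH ψ e a = ((1 : ℕ) : ℂ) • complexBetti.map e.ι 2 a +
      complexBetti.map ψ.hom.hom.hom 2 (complexBetti.map e.ι 2 a) from rfl, Nat.cast_one, one_smul]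

end AnchorSide

/-! ## §3 The Weil frame (interface) and the class `wOf μ = μ·eeee + μ̄·ēēēē` of a design -/

section WeilFrameSection

/-- **THE WEIL FRAME** of the anchor `(S⁴, ψ)` (INTERFACE — an instance is the obligation O-W, NOT asserted here): two
RATIONAL, `ℂ`-independent classes `r₁, r₂` of the Weil plane `weilClassesOf (pad4Anchor E₀) (pad4Action E₀ ψ₀) 4 1`
(dictionary with the cell's frame: `r₁ = eeee + ēēēē`, `r₂ = i·(eeee − ēēēē)`; the Weil plane is `2`-dimensional and
defined over `ℚ`, van Geemen 4.9–4.11, so such frames exist — but that existence is a CONSTRUCTION statement, not a field). -/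
structure WeilFrame (E₀ : AbelianVariety ℂ) (ψ₀ : E₀ ⟶ E₀) where
  /-- `r₁ = eeee + ēēēē` -/
  rOne : complexBetti (pad4Anchor E₀).X (2 * 4)
  /-- `r₂ = i(eeee − ēēēē)` -/
  rTwo : complexBetti (pad4Anchor E₀).X (2 * 4)
  rOne_rational : IsRationalClass rOne
  rTwo_rational : IsRationalClass rTwo
  rOne_mem : rOne ∈ weilClassesOf (pad4Anchor E₀) (pad4Action E₀ ψ₀) 4 1
  rTwo_mem : rTwo ∈ weilClassesOf (pad4Anchor E₀) (pad4Action E₀ ψ₀) 4 1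
  /-- `ℂ`-independence of `r₁, r₂` -/
  indep : ∀ s t : ℂ, s • rOne + t • rTwo = 0 → s = 0 ∧ t = 0

variable {E₀ : AbelianVariety ℂ} {ψ₀ : E₀ ⟶ E₀}

/-- **the Weil class of a design with `eeee`-coefficient `μ ∈ ℤ[i]`**: `μ·eeee + μ̄·ēēēē = Re μ · r₁ + Im μ · r₂`. -/
def WeilFrame.wOf (F : WeilFrame E₀ ψ₀) (μ : GaussianInt) : complexBetti (pad4Anchor E₀).X (2 * 4) :=
  ((μ.re : ℚ) : ℂ) • F.rOne + ((μ.im : ℚ) : ℂ) • F.rTwo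

theorem WeilFrame.wOf_mem (F : WeilFrame E₀ ψ₀) (μ : GaussianInt) :
    F.wOf μ ∈ weilClassesOf (pad4Anchor E₀) (pad4Action E₀ ψ₀) 4 1 :=
  Submodule.add_mem _ (Submodule.smul_mem _ _ F.rOne_mem) (Submodule.smul_mem _ _ F.rTwo_mem)

theorem WeilFrame.wOf_rational (F : WeilFrame E₀ ψ₀) (μ : GaussianInt) : IsRationalClass (F.wOf μ) :=
  (F.rOne_rational.smul _).add (F.rTwo_rational.smul _)

/-- **(σ) at design level: `μ ≠ 0` ⟹ the Weil class is non-zero.** -/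
theorem WeilFrame.wOf_ne_zero (F : WeilFrame E₀ ψ₀) {μ : GaussianInt} (hμ : μ ≠ 0) : F.wOf μ ≠ 0 := by
  intro h
  obtain ⟨hre, him⟩ := F.indep _ _ h
  have hre' : μ.re = 0 := by exact_mod_cast hre
  have him' : μ.im = 0 := by exact_mod_cast him
  apply hμ
  ext
  · simpa using hre'
  · simpa using him'

end WeilFrameSection

/-! ## §4 The four checks as predicates on (design, presentation); the certificates; the unpacking into the stub -/

section Checks

/-- `(c • x)ⁱ = cⁱ • xⁱ` (bilinearity of `∪`; private copy of the tree's `cupPowTwo_smul`, as in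
`ChernCharacterBettiRescale`, to stay independent of which of its three homes is imported). [cite: HatcherAT2002, §3.2] -/
private theorem cupPowTwo_smul_aux {Y : Type} [TopologicalSpace Y] (c : ℂ) (x : singularCohomology ℂ ℂ Y 2)
    (i : ℕ) : cupPowTwo (c • x) i = c ^ i • cupPowTwo x i := by
  induction i with
  | zero => rw [cupPowTwo_zero, cupPowTwo_zero, pow_zero, one_smul]
  | succ i ih =>
    rw [cupPowTwo_succ, cupPowTwo_succ, ih]
    simp only [map_smul, LinearMap.smul_apply, smul_smul, pow_succ, mul_comm]

variable (E₀ : AbelianVariety ℂ) (ψ₀ : E₀ ⟶ E₀) (η : complexBetti E₀.X 2)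

/-- **(pad4)(ii) A POLARISATION DATUM compatible with the frame**: a projective embedding `e` of the anchor and a
non-zero rational `a ∈ H²(ℙⁿ)` with `e^*a = t · h_std`, `t > 0` (e.g. the embedding by `3·h_std`, `t = 3`; then
`h_K = symH = 2t·h_std = 6·h_std`). The stub's `(e, a)` must be CHOSEN like this — the opaque datum of
`aimedSplitProduct_cmSquare_of_pos` has a weighted Segre class and does not relate to the frame's `ℚ[h]`. Existence is
the obligation O-pol (Segre additivity with equal weights, cf. `exists_symmetricSegreEmbedding`), NOT asserted here. -/
structure Polarisation where
  /-- the embedding -/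
  e : ProjectiveEmbedding (pad4Anchor E₀).X
  /-- the hyperplane class upstairs -/
  a : complexBetti (projectiveSpace e.n ℂ) 2
  /-- the scale `e^*a = t·h_std` -/
  t : ℚ
  a_rational : IsRationalClass a
  a_ne_zero : a ≠ 0
  t_pos : 0 < t
  pullback_eq : complexBetti.map e.ι 2 a = ((t : ℚ) : ℂ) • hStd E₀ η

/-- **(pad4)(iii) OBLIGATION O-hyp**: `(S⁴, ψ, h_std)` is of hyperbolic Weil type (a rational, `ψ`-stable, isotropic
`8`-plane in `H¹`; true — per factor `S` the diagonal plane `{(p, p), (ψ₀^*p, -ψ₀^*p)}` — and provable in principle with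
`isHyperbolicWeilType_prod_of_rationalModels` + `cmCurve_rationalModel`; design-independent, ONCE per anchor; NOT
asserted here). -/
def HStdHyperbolic : Prop := IsHyperbolicWeilType (pad4Anchor E₀) (pad4Action E₀ ψ₀) 4 (hStd E₀ η)

/-- **THE ANCHOR KIT of `(E₀, ψ₀)`** — the DESIGN-INDEPENDENT data every check reads, computed once per anchor: the
rational generator `η` of `H²(E₀(ℂ))`, the Weil frame (O-W), the polarisation datum (O-pol), hyperbolicity of `h_std`
(O-hyp). A structure, i.e. data: constructing one for every `(E₀, ψ₀, hE, hψ)` is the typer task (pad4)(i)–(iv). -/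
structure AnchorKit (E₀ : AbelianVariety ℂ) (ψ₀ : E₀ ⟶ E₀) where
  /-- the rational generator of `H²(E₀(ℂ); ℂ)` (the frame's `η_f`) -/
  η : complexBetti E₀.X 2
  η_rational : IsRationalClass η
  η_ne_zero : η ≠ 0
  /-- O-W -/
  F : WeilFrame E₀ ψ₀
  /-- O-pol -/
  pol : Polarisation E₀ η
  /-- O-hyp -/
  hyperbolic : HStdHyperbolic E₀ ψ₀ η

variable {E₀ ψ₀ η}

/-- the kit's `h_K = symH (pad4Action E₀ ψ₀) e a = 2t·h_std` is of hyperbolic Weil type. -/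
theorem AnchorKit.hyperbolic_symH (hE : E₀.dim = 1) (hψ : ψ₀ ≫ ψ₀ = -(1 • 𝟙 E₀)) (K : AnchorKit E₀ ψ₀) :
    IsHyperbolicWeilType (pad4Anchor E₀) (pad4Action E₀ ψ₀) 4 (symH (pad4Action E₀ ψ₀) K.pol.e K.pol.a) :=
  (isHyperbolicWeilType_symH_iff hE hψ K.pol.e K.pol.a K.pol.t_pos.ne' K.pol.pullback_eq).2 K.hyperbolic

theorem AnchorKit.symH_eq (hE : E₀.dim = 1) (hψ : ψ₀ ≫ ψ₀ = -(1 • 𝟙 E₀)) (K : AnchorKit E₀ ψ₀) :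
    symH (pad4Action E₀ ψ₀) K.pol.e K.pol.a = (((2 * K.pol.t : ℚ)) : ℂ) • hStd E₀ K.η :=
  symH_eq_smul_hStd hE hψ K.pol.e K.pol.a K.pol.t K.pol.pullback_eq

/-! ### (σ) and (A1@Z) as predicates -/

/-- **(σ) THE HODGE-CLASS CHECK** (lci door) for a seed `i : Z ↪ S⁴`, a design `eeee`-coefficient `μ` and a rational `q`:
the target class is a genuine Weil class (`μ ≠ 0`, equivalently `wOf μ ≠ 0` — NOT a class in `ℚ[h]`; at the CM anchor
«non-divisor class» can only mean «non-zero `W_K`-component», every Hodge class of `E₀⁸` being a polynomial in divisors)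
and `q·h_K⁴ + wOf μ` is supported on `Z` (by purity a rational multiple of `cl(Z)`; `q ≠ 0` is then forced since
`deg_{h} Z > 0`). Design half = C0's `μ ≠ 0`; object half = MATH (Fulton 14.1: `[Z(s)] = c₄(𝓔(tH))`, whose
`W`-coordinate is `−6μ` by Newton's identity — pencil, not Lean). -/
def ClassCheck (K : AnchorKit E₀ ψ₀) (μ : GaussianInt) {Z : Scheme.{0}} (i : Z ⟶ (pad4Anchor E₀).X.left) (q : ℚ) :
    Prop :=
  μ ≠ 0 ∧ ((q : ℚ) : ℂ) • cupPowTwo (symH (pad4Action E₀ ψ₀) K.pol.e K.pol.a) 4 + K.F.wOf μ ∈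
    classesSupportedOn (pad4Anchor E₀).X (Set.range i.base) (2 * 4)

/-- **(A1@Z) (A1)-CLEANLINESS AT THE SEED, in the degree window `I`**, for the realised sheaf `𝓔` on the anchor,
relative to a Chern character theory `C`, a polarisation class `h` and the Weil frame: `ch_p(𝓔) = c_p·hᵖ` for
`p ∈ I ∖ {4}` and `ch₄(𝓔) = q·h⁴ + wOf μ` — i.e. `ch(𝓔) ∈ ℚ[h] ⊕ W_ℚ` in the window, `W`-coordinate `μ`. This is the
SHEAF door's reading (`HasBFSheafSeedOn`'s `ch`-clauses); the lci door reads only its shadow (σ). -/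
def CleanAtSeed (C : ChernCharacterBetti) (I : Finset ℕ) (F : WeilFrame E₀ ψ₀) (h : complexBetti (pad4Anchor E₀).X 2)
    (𝓔 : (pad4Anchor E₀).X.left.Modules) (μ : GaussianInt) : Prop :=
  ∃ (c : ℕ → ℚ) (q : ℚ), (∀ p ∈ I, p ≠ 4 → C.ch (pad4Anchor E₀).X 𝓔 p = ((c p : ℚ) : ℂ) • cupPowTwo h p) ∧
    C.ch (pad4Anchor E₀).X 𝓔 4 = ((q : ℚ) : ℂ) • cupPowTwo h 4 + F.wOf μ

/-- (A1@Z) is insensitive to rescaling the polarisation class by a non-zero rational (`ℚ[r·h] = ℚ[h]`): it may be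
CHECKED against `h_std` and CONSUMED against `h_K = 2t·h_std`. -/
theorem cleanAtSeed_smul {C : ChernCharacterBetti} {I : Finset ℕ} {F : WeilFrame E₀ ψ₀}
    {h : complexBetti (pad4Anchor E₀).X 2} {𝓔 : (pad4Anchor E₀).X.left.Modules} {μ : GaussianInt}
    (hcl : CleanAtSeed C I F h 𝓔 μ) {r : ℚ} (hr : r ≠ 0) : CleanAtSeed C I F (((r : ℚ) : ℂ) • h) 𝓔 μ := by
  obtain ⟨c, q, hc, hq⟩ := hcl
  have hr' : ∀ p : ℕ, ((r : ℚ) : ℂ) ^ p ≠ 0 := fun p => pow_ne_zero _ (by exact_mod_cast hr)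
  have key : ∀ (p : ℕ) (x : ℚ), ((x : ℚ) : ℂ) • cupPowTwo h p =
      (((x / r ^ p : ℚ)) : ℂ) • cupPowTwo (((r : ℚ) : ℂ) • h) p := by
    intro p x
    rw [cupPowTwo_smul_aux, smul_smul, Rat.cast_div, Rat.cast_pow, div_mul_cancel₀ _ (hr' p)]
  refine ⟨fun p => c p / r ^ p, q / r ^ 4, fun p hpI hp => ?_, ?_⟩
  · rw [hc p hpI hp, key p (c p)]
  · rw [hq, key 4 q]

theorem cleanAtSeed_symH_of_hStd (hE : E₀.dim = 1) (hψ : ψ₀ ≫ ψ₀ = -(1 • 𝟙 E₀)) {C : ChernCharacterBetti}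
    {I : Finset ℕ} (K : AnchorKit E₀ ψ₀) {𝓔 : (pad4Anchor E₀).X.left.Modules} {μ : GaussianInt}
    (hcl : CleanAtSeed C I K.F (hStd E₀ K.η) 𝓔 μ) :
    CleanAtSeed C I K.F (symH (pad4Action E₀ ψ₀) K.pol.e K.pol.a) 𝓔 μ := by
  rw [K.symH_eq hE hψ]
  exact cleanAtSeed_smul hcl (mul_ne_zero two_ne_zero K.pol.t_pos.ne')

/-- **(A1@Z) + finite locally free + `I`-semiregular ⟹ the tree's one-model sheaf seed** `HasBFSheafSeedOn C 4 I` for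
the class `q·h⁴ + wOf μ` (`SheafSeedOnAnchor.lean`; `4 ∈ I`). Pure repackaging. -/
theorem hasBFSheafSeedOn_of_cleanAtSeed {C : ChernCharacterBetti} {I : Finset ℕ} {F : WeilFrame E₀ ψ₀}
    {h : complexBetti (pad4Anchor E₀).X 2} {𝓔 : (pad4Anchor E₀).X.left.Modules} {μ : GaussianInt}
    (h𝓔 : IsFiniteLocallyFree 𝓔) (hI : 4 ∈ I) (hsr : IsISemiregular h𝓔 {q' | q' + 1 ∈ I})
    (hcl : CleanAtSeed C I F h 𝓔 μ) : HasBFSheafSeedOn C 4 I (pad4Anchor E₀) h (F.wOf μ) := by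
  obtain ⟨c, q, hc, hq⟩ := hcl
  exact ⟨𝓔, h𝓔, q, c, hI, hsr, hq, hc⟩

/-- **THE DICTIONARY PREDICATE «the sheaf `𝓔` realises the design `D`»** ((design json, presentation) ↦ `Prop`, sheaf
door): `D` is (A1)-clean AND, read through the frame `(h, r₁, r₂)`, the Chern character of `𝓔` is the class the design
tensor names — `ch_p(𝓔) = (c_p(D)∕p!)·h^p` for `p ≤ 8`, `p ≠ 4`, and `ch₄(𝓔) = (c₄(D)∕24)·h⁴ + wOf μ(D)` (`h` = the
frame's `h_std`; `h^p∕p! = Σ_{e-free w, wdeg w = p} w` because the `u_f, v_f` are square-zero). For a RESOLUTION of `𝓔`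
by bundles whose Chern characters are the cells' tensors this is (A1) of the design (additivity of `ch`,
`ChernCharacterBetti.ch_shortExact`); for a monad ∕ non-exact presentation it is a condition on the homology. -/
def Design.RealisedBy (D : Design) (C : ChernCharacterBetti) (F : WeilFrame E₀ ψ₀)
    (h : complexBetti (pad4Anchor E₀).X 2) (𝓔 : (pad4Anchor E₀).X.left.Modules) : Prop :=
  D.Clean ∧
    (∀ p : Fin 9, (p : ℕ) ≠ 4 →
      C.ch (pad4Anchor E₀).X 𝓔 p = ((((D.coeff p : ℤ) : ℚ) / ((p : ℕ).factorial : ℚ) : ℚ) : ℂ) • cupPowTwo h p) ∧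
    C.ch (pad4Anchor E₀).X 𝓔 4 = ((((D.coeff 4 : ℤ) : ℚ) / 24 : ℚ) : ℂ) • cupPowTwo h 4 + F.wOf D.mu

/-- **a realised (A1)-clean design is (A1)-clean AT THE SEED** in every window `I ⊆ {0, …, 8}` ((A1@Z) ⟸ (A1) +
faithful realisation). -/
theorem cleanAtSeed_of_realisedBy {D : Design} {C : ChernCharacterBetti} {F : WeilFrame E₀ ψ₀}
    {h : complexBetti (pad4Anchor E₀).X 2} {𝓔 : (pad4Anchor E₀).X.left.Modules} {I : Finset ℕ}
    (hI : ∀ p ∈ I, p ≤ 8) (hR : D.RealisedBy C F h 𝓔) : CleanAtSeed C I F h 𝓔 D.mu := by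
  refine ⟨fun p => if hp : p < 9 then ((D.coeff ⟨p, hp⟩ : ℤ) : ℚ) / ((p.factorial : ℕ) : ℚ) else 0,
    ((D.coeff 4 : ℤ) : ℚ) / 24, fun p hpI hp4 => ?_, hR.2.2⟩
  have hp : p < 9 := Nat.lt_succ_of_le (hI p hpI)
  simp only [dif_pos hp]
  exact hR.2.1 ⟨p, hp⟩ hp4

/-! ### The seed checker (lci door) and its unpacking into `stub_rung_pad4_seedAt` -/

/-- **THE SEED CHECKER (lci ∕ Bloch door) — a predicate on (design json, presentation)**: the design `D` passes C0
(class data) and the presented subscheme `i : Z ↪ S⁴` with coefficient `q` passes bc5's C5 (regular immersion of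
codimension `4` = lci), C6 (integral, closed points of codimension `≥ 4`), C7 (Bloch-semiregular in the `8`-fold `S⁴`) and
the object half of (σ) (`q·h_K⁴ + wOf μ(D)` supported on `Z`), all read on the anchor kit `K` ((pad4)(ii)–(iv)); (d=1) is
in the types. -/
def Design.SeedCheck (D : Design) (K : AnchorKit E₀ ψ₀) {Z : Scheme.{0}} (i : Z ⟶ (pad4Anchor E₀).X.left) (q : ℚ) :
    Prop :=
  D.ClassData ∧ IsClosedImmersion i ∧ IsRegularImmersionOfCodim i 4 ∧ AlgebraicGeometry.IsIntegral Z ∧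
    (∀ z ∈ Set.range i.base, ((4 : ℕ) : ℕ∞) ≤ Order.coheight z) ∧ IsBlochSemiregular i (2 * 4) 4 ∧
    ((q : ℚ) : ℂ) • cupPowTwo (symH (pad4Action E₀ ψ₀) K.pol.e K.pol.a) 4 + K.F.wOf D.mu ∈
      classesSupportedOn (pad4Anchor E₀).X (Set.range i.base) (2 * 4)

/-- a passing (design, presentation) passes the class check (σ). -/
theorem Design.SeedCheck.classCheck {D : Design} {K : AnchorKit E₀ ψ₀} {Z : Scheme.{0}}
    {i : Z ⟶ (pad4Anchor E₀).X.left} {q : ℚ} (h : D.SeedCheck K i q) : ClassCheck K D.mu i q :=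
  ⟨h.1.2.1, h.2.2.2.2.2.2⟩

/-- **THE SEED CERTIFICATE (lci door) on the anchor `(E₀, ψ₀)`** — the same data as `Design.SeedCheck`, as a record
(kit, `μ ≠ 0`, the seed with C5–C7, the supported class): exactly the conjuncts of `stub_rung_pad4_seedAt`'s conclusion,
re-sorted by check. A STRUCTURE, i.e. data: nothing asserts that one exists. -/
structure SeedCertificate (E₀ : AbelianVariety ℂ) (ψ₀ : E₀ ⟶ E₀) where
  /-- (pad4): the anchor kit -/
  kit : AnchorKit E₀ ψ₀
  /-- (σ), design half: the design's `eeee`-coefficient -/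
  μ : GaussianInt
  μ_ne_zero : μ ≠ 0
  /-- the seed -/
  Z : Scheme.{0}
  /-- its embedding into the anchor -/
  i : Z ⟶ (pad4Anchor E₀).X.left
  /-- the `h_K⁴`-coefficient of the supported class -/
  q : ℚ
  closedImmersion : IsClosedImmersion i
  /-- C5: local complete intersection of codimension `4` -/
  regular : IsRegularImmersionOfCodim i 4
  /-- C6: integral, of codimension `≥ 4` pointwise -/
  integral : AlgebraicGeometry.IsIntegral Z
  coheight : ∀ z ∈ Set.range i.base, ((4 : ℕ) : ℕ∞) ≤ Order.coheight z
  /-- C7: Bloch-semiregular in `S⁴` read as an `8`-fold -/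
  semiregular : IsBlochSemiregular i (2 * 4) 4
  /-- (σ), object half: `q·h_K⁴ + wOf μ` is supported on `Z` -/
  supported : ((q : ℚ) : ℂ) • cupPowTwo (symH (pad4Action E₀ ψ₀) kit.pol.e kit.pol.a) 4 + kit.F.wOf μ ∈
    classesSupportedOn (pad4Anchor E₀).X (Set.range i.base) (2 * 4)

/-- a passing (design, presentation) IS a certificate (`μ := μ(D)`). -/
def Design.SeedCheck.certificate {D : Design} {K : AnchorKit E₀ ψ₀} {Z : Scheme.{0}}
    {i : Z ⟶ (pad4Anchor E₀).X.left} {q : ℚ} (h : D.SeedCheck K i q) : SeedCertificate E₀ ψ₀ where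
  kit := K
  μ := D.mu
  μ_ne_zero := h.1.2.1
  Z := Z
  i := i
  q := q
  closedImmersion := h.2.1
  regular := h.2.2.1
  integral := h.2.2.2.1
  coheight := h.2.2.2.2.1
  semiregular := h.2.2.2.2.2.1
  supported := h.2.2.2.2.2.2

/-- a certificate passes the class check (σ) (by construction). -/
theorem SeedCertificate.classCheck (c : SeedCertificate E₀ ψ₀) : ClassCheck c.kit c.μ c.i c.q :=
  ⟨c.μ_ne_zero, c.supported⟩

/-- **A CERTIFICATE ON `(E₀, ψ₀)` GIVES THE CONCLUSION OF `stub_rung_pad4_seedAt` FOR THAT ANCHOR, LITERALLY**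
(`e, a` from the kit, `w := wOf μ`; hyperbolicity moved from `h_std` to `h_K = 2t·h_std`). -/
theorem seedData_of_certificate (hE : E₀.dim = 1) (hψ : ψ₀ ≫ ψ₀ = -(1 • 𝟙 E₀)) (c : SeedCertificate E₀ ψ₀) :
    ∃ (e : ProjectiveEmbedding (pad4Anchor E₀).X) (a : complexBetti (projectiveSpace e.n ℂ) 2)
      (w : complexBetti (pad4Anchor E₀).X (2 * 4)),
      IsRationalClass a ∧ a ≠ 0 ∧
      IsHyperbolicWeilType (pad4Anchor E₀) (pad4Action E₀ ψ₀) 4 (symH (pad4Action E₀ ψ₀) e a) ∧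
      w ∈ weilClassesOf (pad4Anchor E₀) (pad4Action E₀ ψ₀) 4 1 ∧ IsRationalClass w ∧ w ≠ 0 ∧
      HasBlochSeedAt 4 (pad4Anchor E₀) (symH (pad4Action E₀ ψ₀) e a) w :=
  ⟨c.kit.pol.e, c.kit.pol.a, c.kit.F.wOf c.μ, c.kit.pol.a_rational, c.kit.pol.a_ne_zero,
    c.kit.hyperbolic_symH hE hψ, c.kit.F.wOf_mem c.μ, c.kit.F.wOf_rational c.μ, c.kit.F.wOf_ne_zero c.μ_ne_zero,
    ⟨c.Z, c.i, c.q, c.closedImmersion, c.regular, c.integral, c.coheight, c.semiregular, c.supported⟩⟩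

/-- the same from a passing (design, presentation). -/
theorem seedData_of_seedCheck (hE : E₀.dim = 1) (hψ : ψ₀ ≫ ψ₀ = -(1 • 𝟙 E₀)) {D : Design} {K : AnchorKit E₀ ψ₀}
    {Z : Scheme.{0}} {i : Z ⟶ (pad4Anchor E₀).X.left} {q : ℚ} (h : D.SeedCheck K i q) :
    ∃ (e : ProjectiveEmbedding (pad4Anchor E₀).X) (a : complexBetti (projectiveSpace e.n ℂ) 2)
      (w : complexBetti (pad4Anchor E₀).X (2 * 4)),
      IsRationalClass a ∧ a ≠ 0 ∧
      IsHyperbolicWeilType (pad4Anchor E₀) (pad4Action E₀ ψ₀) 4 (symH (pad4Action E₀ ψ₀) e a) ∧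
      w ∈ weilClassesOf (pad4Anchor E₀) (pad4Action E₀ ψ₀) 4 1 ∧ IsRationalClass w ∧ w ≠ 0 ∧
      HasBlochSeedAt 4 (pad4Anchor E₀) (symH (pad4Action E₀ ψ₀) e a) w :=
  seedData_of_certificate hE hψ h.certificate

/-- **CERTIFICATES ON EVERY CM ANCHOR ⟹ THE CRUX `BlochSeedDiscOne` BY NAME** ((pad4)(i): the stub's binders are
universal in `(E₀, ψ₀, hE, hψ)`, so the checker must be passed on every CM anchor — all isomorphic to `(ℂ∕ℤ[i], ±i)`;
`ψ₀ ↦ -ψ₀` is the conjugate design, §1). Hypothesis-carrying (not `exact?`-abusable); via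
`Anchor.blochSeedDiscOne_of_forall_pad4_seedAt`. -/
theorem blochSeedDiscOne_of_certificates
    (h : ∀ (E₀ : AbelianVariety ℂ) (ψ₀ : E₀ ⟶ E₀), E₀.dim = 1 → ψ₀ ≫ ψ₀ = -(1 • 𝟙 E₀) →
      Nonempty (SeedCertificate E₀ ψ₀)) :
    Summit.HodgeConjecture.HodgeConjecture.Theses.EightfoldBlochSeeds.BlochSeedDiscOne :=
  blochSeedDiscOne_of_forall_pad4_seedAt fun E₀ ψ₀ hE hψ => by
    obtain ⟨c⟩ := h E₀ ψ₀ hE hψ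
    exact seedData_of_certificate hE hψ c

/-- **PASSING (design, presentation) PAIRS ON EVERY CM ANCHOR ⟹ THE CRUX `BlochSeedDiscOne` BY NAME.** -/
theorem blochSeedDiscOne_of_seedChecks
    (h : ∀ (E₀ : AbelianVariety ℂ) (ψ₀ : E₀ ⟶ E₀), E₀.dim = 1 → ψ₀ ≫ ψ₀ = -(1 • 𝟙 E₀) →
      ∃ (D : Design) (K : AnchorKit E₀ ψ₀) (Z : Scheme.{0}) (i : Z ⟶ (pad4Anchor E₀).X.left) (q : ℚ),
        D.SeedCheck K i q) :
    Summit.HodgeConjecture.HodgeConjecture.Theses.EightfoldBlochSeeds.BlochSeedDiscOne :=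
  blochSeedDiscOne_of_certificates fun E₀ ψ₀ hE hψ => by
    obtain ⟨D, K, Z, i, q, hc⟩ := h E₀ ψ₀ hE hψ
    exact ⟨hc.certificate⟩

/-! ### The sheaf-seed checker (sheaf door, H2) -/

/-- **THE SHEAF-SEED CHECKER (sheaf door) — a predicate on (design json, presentation = a sheaf `𝓔` on `S⁴`)**: C0 for
`D`; `4 ∈ I ⊆ {0, …, 8}`; `𝓔` FINITE LOCALLY FREE (caveat C1 of `SheafSeedOnAnchor.lean`) and `I`-semiregular
(Buchweitz–Flenner's `σ_{q'}` injective for `q' + 1 ∈ I`); and `𝓔` REALISES `D` through the kit's frame ((A1@Z) with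
the design's own coefficients, against `h_std`). -/
def Design.SheafSeedCheck (D : Design) (C : ChernCharacterBetti) (I : Finset ℕ) (K : AnchorKit E₀ ψ₀)
    (𝓔 : (pad4Anchor E₀).X.left.Modules) : Prop :=
  D.ClassData ∧ 4 ∈ I ∧ (∀ p ∈ I, p ≤ 8) ∧
    (∃ h𝓔 : IsFiniteLocallyFree 𝓔, IsISemiregular h𝓔 {q' | q' + 1 ∈ I}) ∧ D.RealisedBy C K.F (hStd E₀ K.η) 𝓔

/-- **A PASSING (design, sheaf) PAIR GIVES THE TREE'S `HasHyperbolicBFSheafSeedOn C 4 1 I`** (the one-model sheaf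
door's input; `SheafSeedOnAnchor.hasLocallyAlgebraicWeilAnchor_of_BFmodel_of_hyperbolicBFSheafSeedOn` then gives
`HasLocallyAlgebraicWeilAnchor 4 1` under BF Thm. 5.1 for the model `C`). Pure repackaging. -/
theorem hasHyperbolicBFSheafSeedOn_of_sheafSeedCheck (hE : E₀.dim = 1) (hψ : ψ₀ ≫ ψ₀ = -(1 • 𝟙 E₀)) {D : Design}
    {C : ChernCharacterBetti} {I : Finset ℕ} {K : AnchorKit E₀ ψ₀} {𝓔 : (pad4Anchor E₀).X.left.Modules}
    (h : D.SheafSeedCheck C I K 𝓔) : HasHyperbolicBFSheafSeedOn C 4 1 I := by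
  obtain ⟨hC0, h4, hI8, ⟨h𝓔, hsr⟩, hR⟩ := h
  have hcl : CleanAtSeed C I K.F (symH (pad4Action E₀ ψ₀) K.pol.e K.pol.a) 𝓔 D.mu :=
    cleanAtSeed_symH_of_hStd hE hψ K (cleanAtSeed_of_realisedBy hI8 hR)
  exact ⟨pad4Anchor E₀, pad4Action E₀ ψ₀, K.pol.e, K.pol.a, K.F.wOf D.mu, pad4Anchor_dim hE,
    pad4Action_comp_self hψ, K.pol.a_rational, K.pol.a_ne_zero, K.hyperbolic_symH hE hψ, K.F.wOf_mem _,
    K.F.wOf_rational _, K.F.wOf_ne_zero hC0.2.1, hasBFSheafSeedOn_of_cleanAtSeed h𝓔 h4 hsr hcl⟩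

end Checks

/-! ## §5 v2 (g1, 2026-08-29) — ADDITIVE: rank-free sheaf door, apex padding, the trace-part test, the tower-over-a-seed clauses,
`[α]^*`-covariance of `RealisedBy`. No declaration of §1–§4 is changed. -/

section VTwo

/-! ### §5.1 JSON side: rank-free ∕ rank-`r` class data (R19.262 (3)), apex padding `D⁺ = D + k·[apex a]`, dilation `D_m` -/

section JsonSideVTwo

namespace Design

/-- **C0′ = RANK-FREE CLASS DATA** (idea-crit-6 l.6784 «C0′»; director R19.262 (3)): (A1)-clean and `μ ≠ 0` — exactly what the sheaf
door's unpacking consumes (`hasHyperbolicBFSheafSeedOn_of_sheafSeedCheck` uses only `μ ≠ 0`; `Clean` is re-read by `RealisedBy`). -/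
def ClassDataRankFree (D : Design) : Prop := D.Clean ∧ D.mu ≠ 0

/-- **C0 AT RANK `r`**: (A1)-clean, `μ ≠ 0`, rank `r`, `m ≥ 1`. `ClassData` is `ClassDataR 4` (`classData_iff_classDataR_four`); the R-B
room (BF (10.7) needs rank `> dim X = 8`; director R19.262: R-B is the H2 room via `HasLocallyAlgebraicWeilAnchor 4 1`, NOT 18881)
reads `ClassDataR r`, `r ≥ 9` (or `≥ 8` where (10.7) is quoted with `≥`). -/
def ClassDataR (D : Design) (r : ℕ) : Prop := D.Clean ∧ D.mu ≠ 0 ∧ D.rank = r ∧ D.Positive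

theorem classData_iff_classDataR_four (D : Design) : D.ClassData ↔ D.ClassDataR 4 := by
  simp only [ClassData, ClassDataR, Nat.cast_ofNat]

theorem ClassDataR.rankFree {D : Design} {r : ℕ} (h : D.ClassDataR r) : D.ClassDataRankFree :=
  ⟨h.1, h.2.1⟩

theorem ClassData.rankFree {D : Design} (h : D.ClassData) : D.ClassDataRankFree :=
  ⟨h.1, h.2.1⟩

end Design

/-- (A1) is additive. (= `LinePhaseTorus.classScreen_add` of `LinePhaseTorusPadding.lean`, restated: that file's import cone is the
torus law.) -/
theorem classScreen_add {T T' : CWord → GaussianInt} (hT : ClassScreen T) (hT' : ClassScreen T') :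
    ClassScreen (T + T') :=
  ⟨fun w h1 h2 h3 => by rw [Pi.add_apply, hT.1 w h1 h2 h3, hT'.1 w h1 h2 h3, add_zero],
    fun w w' hw hw' hd => by rw [Pi.add_apply, Pi.add_apply, hT.2 w w' hw hw' hd, hT'.2 w w' hw hw' hd]⟩

theorem classScreen_zsmul {T : CWord → GaussianInt} (hT : ClassScreen T) (n : ℤ) : ClassScreen (n • T) :=
  ⟨fun w h1 h2 h3 => by rw [Pi.smul_apply, hT.1 w h1 h2 h3, smul_zero],
    fun w w' hw hw' hd => by rw [Pi.smul_apply, Pi.smul_apply, hT.2 w w' hw hw' hd]⟩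

/-- **THE APEX CELL of twist `a`**: the pure-`α` point `(a, 0, 0)` on every factor = the class of the LINE BUNDLE `𝒪(a·h_std)` boxed over
the four factors (`ch = e^{a h}`: coefficient `a^p` on every e-free word of degree `p`, `0` on e-words). (= `LinePhaseTorus.apexCell`,
restated.) -/
def apexCell (a : ℤ) : MCell := fun _ => (a, 0, 0)

theorem bphi_apexPt (a : ℤ) (l : Fin 6) :
    bphi ((a, 0, 0) : BPoint) l = if l = 3 ∨ l = 4 then 0 else (a : GaussianInt) ^ ldeg l := by
  fin_cases l <;> simp [bphi, phiVec, ldeg] <;> rfl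

theorem MCell.ch_apexCell (a : ℤ) (w : CWord) :
    (apexCell a).ch w = ∏ f, (if w f = 3 ∨ w f = 4 then 0 else (a : GaussianInt) ^ ldeg (w f)) := by
  rw [Fin.prod_univ_four]
  simp only [MCell.ch, chTensor, apexCell, bphi_apexPt]

/-- `ch(apex a) = a^p` on an e-free word of degree `p`. -/
theorem MCell.ch_apexCell_of_eFree (a : ℤ) {w : CWord} (hw : EFree w) :
    (apexCell a).ch w = (a : GaussianInt) ^ wdeg w := by
  rw [MCell.ch_apexCell, Finset.prod_congr rfl fun f _ => if_neg (not_or.2 (hw f)), Finset.prod_pow_eq_pow_sum]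
  simp only [wdeg, Fin.sum_univ_four]

/-- `ch(apex a) = 0` on a word with an `e` or `ē`. -/
theorem MCell.ch_apexCell_of_not_eFree (a : ℤ) {w : CWord} (hw : ¬ EFree w) : (apexCell a).ch w = 0 := by
  rw [MCell.ch_apexCell]
  obtain ⟨f, hf⟩ : ∃ f, w f = 3 ∨ w f = 4 := by
    by_contra hne
    exact hw fun f => ⟨fun h3 => hne ⟨f, Or.inl h3⟩, fun h4 => hne ⟨f, Or.inr h4⟩⟩
  exact Finset.prod_eq_zero (Finset.mem_univ f) (if_pos hf)

/-- **the apex is (A1)-neutral.** -/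
theorem classScreen_apexCell (a : ℤ) : ClassScreen (apexCell a).ch :=
  ⟨fun w h1 _ _ => MCell.ch_apexCell_of_not_eFree a h1,
    fun w w' hw hw' hd => by rw [MCell.ch_apexCell_of_eFree a hw, MCell.ch_apexCell_of_eFree a hw', hd]⟩

namespace Design

/-- **APEX PADDING `D⁺ = D + k·[apex a]`** (director R19.262 (3): «`RealisedBy` read on the padded `D⁺`» — `RealisedBy` pins
`ch₀(𝓔) = c₀(D) = rank D`, so a rank-`8` sheaf realises a rank-`8` design): add the apex cell of twist `a` to the `N`-side with
multiplicity `k` (multiplicities off the support are normalised to `0` first, so this is well defined whether or not the apex was already a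
cell). PROVED: `wch_padApex` (`wch(D⁺) = wch(D) + k·ch(apex a)`), `padApex_mu` (`μ` unchanged), `padApex_clean`, `padApex_coeff`
(`c_p(D⁺) = c_p(D) + k·a^p`), `padApex_rank` (`rank + k`), `padApex_positive`, `classDataR_padApex`. OBJECT-SIDE WARNING [pen, BF
Def. 4.1 `σ = Tr(− · exp(−At))`]: for the SHEAF `𝓔 ⊕ 𝒪(a h)^{⊕k}` with `k ≥ 2` EQUAL twists the block `H²(𝒪_X) ⊗ 𝔰𝔩_k ⊂ Ext²`
(`At(𝒪(ah)^{⊕k}) = a h ⊗ id`, `Tr` kills trace-free `M`) is killed by EVERY `σ_{q'}` — such a padded sheaf is NEVER `I`-semiregular on an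
abelian `8`-fold (`h^{0,2} = 28 ≠ 0`); DISTINCT twists `a₁ < … < a_k` avoid this block (`Ext²(𝒪(a_i h), 𝒪(a_j h)) = H²(𝒪((a_j − a_i)h)) = 0`,
Mumford §16) but leave a coincidence condition between the trace parts (`§5.2`). Padding is json-innocent and object-delicate. -/
def padApex (D : Design) (a k : ℤ) : Design where
  cfg := ⟨insert (apexCell a) D.cfg.lower, D.cfg.upper⟩
  mN := fun Z => (if Z ∈ D.cfg.lower then D.mN Z else 0) + (if Z = apexCell a then k else 0)
  mP := D.mP

/-- **`wch(D⁺) = wch(D) + k · ch(apex a)`.** -/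
theorem wch_padApex (D : Design) (a k : ℤ) : (D.padApex a k).wch = D.wch + k • (apexCell a).ch := by
  have h1 : ∑ Z ∈ insert (apexCell a) D.cfg.lower, (if Z ∈ D.cfg.lower then D.mN Z else 0) • Z.ch =
      ∑ Z ∈ D.cfg.lower, D.mN Z • Z.ch := by
    rw [← Finset.sum_subset (Finset.subset_insert (apexCell a) D.cfg.lower)
      (fun Z _ hZ => by rw [if_neg hZ, zero_zsmul])]
    exact Finset.sum_congr rfl fun Z hZ => by rw [if_pos hZ]
  have h2 : ∑ Z ∈ insert (apexCell a) D.cfg.lower, (if Z = apexCell a then k else 0) • Z.ch = k • (apexCell a).ch := by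
    rw [Finset.sum_congr rfl fun Z _ => ite_smul _ _ _ _]
    simp only [zero_zsmul, Finset.sum_ite_eq', Finset.mem_insert_self, if_true]
  simp only [Design.wch, MConfig.wch, padApex]
  rw [Finset.sum_congr rfl fun Z _ => add_zsmul _ _ _, Finset.sum_add_distrib, h1, h2]
  abel

/-- **`μ(D⁺) = μ(D)`** (the apex has no `eeee`-coefficient). -/
theorem padApex_mu (D : Design) (a k : ℤ) : (D.padApex a k).mu = D.mu := by
  simp only [Design.mu, wch_padApex, Pi.add_apply, Pi.smul_apply,
    MCell.ch_apexCell_of_not_eFree a not_eFree_eWord.1, smul_zero, add_zero]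

/-- **`D⁺` is (A1)-clean if `D` is.** -/
theorem padApex_clean (D : Design) (hD : D.Clean) (a k : ℤ) : (D.padApex a k).Clean := by
  rw [Design.Clean, wch_padApex]
  exact classScreen_add hD (classScreen_zsmul (classScreen_apexCell a) k)

/-- **`c_p(D⁺) = c_p(D) + k·a^p`.** -/
theorem padApex_coeff (D : Design) (a k : ℤ) (p : Fin 9) :
    (D.padApex a k).coeff p = D.coeff p + k * a ^ (p : ℕ) := by
  have h := (D.padApex a k).wch_refWord p
  rw [wch_padApex, Pi.add_apply, Pi.smul_apply, D.wch_refWord, MCell.ch_apexCell_of_eFree a (refWord_spec p).1,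
    (refWord_spec p).2] at h
  have h' : (((D.coeff p + k * a ^ (p : ℕ) : ℤ)) : GaussianInt) = (((D.padApex a k).coeff p : ℤ) : GaussianInt) := by
    rw [← h, zsmul_eq_mul, Int.cast_add, Int.cast_mul, Int.cast_pow]
  have h'' := congrArg Zsqrtd.re h'
  simpa only [Zsqrtd.re_intCast] using h''.symm

/-- **`rank(D⁺) = rank(D) + k`.** -/
theorem padApex_rank (D : Design) (a k : ℤ) : (D.padApex a k).rank = D.rank + k := by
  rw [Design.rank_eq_coeff, Design.rank_eq_coeff, padApex_coeff]
  simp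

/-- positivity survives padding with `k > 0`. -/
theorem padApex_positive (D : Design) (hD : D.Positive) (a : ℤ) {k : ℤ} (hk : 0 < k) : (D.padApex a k).Positive := by
  refine ⟨fun Z hZ => ?_, hD.2⟩
  simp only [padApex, Finset.mem_insert] at hZ ⊢
  by_cases h1 : Z ∈ D.cfg.lower
  · rw [if_pos h1]
    have := hD.1 Z h1
    split_ifs <;> omega
  · rw [if_neg h1]
    rcases hZ with h2 | h2
    · rw [if_pos h2]; simpa using hk
    · exact absurd h2 h1

/-- **C0 at rank `r` ⟹ C0 at rank `r + k` for the padded design** (`k ≥ 1`). -/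
theorem classDataR_padApex {D : Design} {r : ℕ} (h : D.ClassDataR r) (a : ℤ) {k : ℕ} (hk : 0 < k) :
    (D.padApex a k).ClassDataR (r + k) :=
  ⟨padApex_clean D h.1 a k, by rw [padApex_mu]; exact h.2.1,
    by rw [padApex_rank, h.2.2.1, Nat.cast_add, Int.cast_natCast], padApex_positive D h.2.2.2 a (by exact_mod_cast hk)⟩

end Design

/-! #### Dilation `D_m` on the json side (the `[α]^*`-dictionary of critic memo-h3-11 σ2; `dilPt` = `StrengthenDilation.dilPt`, restated) -/

/-- `D_m : (α, x, y) ↦ (m·α, m·x, m·y)` on factor points (= `StrengthenDilation.dilPt`). -/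
def dilPt (m : ℤ) (x : BPoint) : BPoint := (m * x.1, m * x.2.1, m * x.2.2)

/-- `D_m` on cells. -/
def MCell.dil (m : ℤ) (Z : MCell) : MCell := fun f => dilPt m (Z f)

/-- **`bphi (D_m x) l = m^{deg l} · bphi x l`** (letter degrees `0,1,1,1,1,2`). -/
theorem bphi_dilPt (m : ℤ) (x : BPoint) (l : Fin 6) :
    bphi (dilPt m x) l = (m : GaussianInt) ^ ldeg l * bphi x l := by
  obtain ⟨a, b, c⟩ := x
  fin_cases l <;> (simp [bphi, phiVec, dilPt, ldeg]; try ring)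

/-- **THE CLASS DILATION LAW `ch(D_m Z)(w) = m^{deg w} · ch(Z)(w)`** (the statement `StrengthenDilation.ChDilationLaw` names, with
`wdeg` for its `wordDeg`; kernel, from `bphi_dilPt` factor by factor). -/
theorem MCell.ch_dil (m : ℤ) (Z : MCell) (w : CWord) :
    (MCell.dil m Z).ch w = (m : GaussianInt) ^ wdeg w * Z.ch w := by
  simp only [MCell.ch, chTensor, MCell.dil, bphi_dilPt, wdeg, pow_add]
  ring

namespace Design

/-- **THE DILATED DESIGN `D_m ν`**: dilate every cell; a cell of `D_m ν` carries the total multiplicity of its preimages (so the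
definition is total in `m`, and for `m ≠ 0` — `D_m` injective — it is the plain relabelling). -/
def dil (m : ℤ) (D : Design) : Design where
  cfg := ⟨D.cfg.lower.image (MCell.dil m), D.cfg.upper.image (MCell.dil m)⟩
  mN := fun Z' => ∑ Z ∈ D.cfg.lower with MCell.dil m Z = Z', D.mN Z
  mP := fun P' => ∑ P ∈ D.cfg.upper with MCell.dil m P = P', D.mP P

/-- fibrewise resummation over the image. -/
private theorem sum_image_fibre (m : ℤ) (s : Finset MCell) (μ : MCell → ℤ) (w : CWord) :
    ∑ Z' ∈ s.image (MCell.dil m), (∑ Z ∈ s with MCell.dil m Z = Z', μ Z) • Z'.ch w =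
      ∑ Z ∈ s, μ Z • (MCell.dil m Z).ch w := by
  refine Finset.sum_image' _ fun Z₀ hZ₀ => ?_
  rw [Finset.sum_smul]
  exact Finset.sum_congr rfl fun Z hZ => by rw [(Finset.mem_filter.1 hZ).2]

/-- **`wch(D_m ν)(w) = m^{deg w} · wch(ν)(w)`.** -/
theorem dil_wch (m : ℤ) (D : Design) (w : CWord) :
    (D.dil m).wch w = (m : GaussianInt) ^ wdeg w * D.wch w := by
  simp only [Design.wch, MConfig.wch, Design.dil, Pi.sub_apply, Finset.sum_apply, Pi.smul_apply]
  rw [sum_image_fibre, sum_image_fibre]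
  simp only [MCell.ch_dil, zsmul_eq_mul, Finset.mul_sum, mul_sub]
  congr 1 <;> exact Finset.sum_congr rfl fun Z _ => by ring

/-- **(A1) is `D_m`-invariant.** -/
theorem dil_clean (m : ℤ) (D : Design) (hD : D.Clean) : (D.dil m).Clean := by
  refine ⟨fun w h1 h2 h3 => ?_, fun w w' hw hw' hd => ?_⟩
  · rw [dil_wch, hD.1 w h1 h2 h3, mul_zero]
  · rw [dil_wch, dil_wch, hD.2 w w' hw hw' hd, hd]

theorem wdeg_eWord : wdeg eWord = 4 := by decide

/-- **`μ(D_m ν) = m⁴ · μ(ν)`.** -/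
theorem dil_mu (m : ℤ) (D : Design) : (D.dil m).mu = ((m ^ 4 : ℤ) : GaussianInt) * D.mu := by
  rw [Design.mu, dil_wch, wdeg_eWord, Int.cast_pow]; rfl

/-- **`c_p(D_m ν) = m^p · c_p(ν)`.** -/
theorem dil_coeff (m : ℤ) (D : Design) (p : Fin 9) : (D.dil m).coeff p = m ^ (p : ℕ) * D.coeff p := by
  have h := (D.dil m).wch_refWord p
  rw [dil_wch, D.wch_refWord, (refWord_spec p).2] at h
  have h' : (((m ^ (p : ℕ) * D.coeff p : ℤ)) : GaussianInt) = (((D.dil m).coeff p : ℤ) : GaussianInt) := by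
    rw [← h, Int.cast_mul, Int.cast_pow]
  have h'' := congrArg Zsqrtd.re h'
  simpa only [Zsqrtd.re_intCast] using h''.symm

/-- the rank is `D_m`-invariant. -/
theorem dil_rank (m : ℤ) (D : Design) : (D.dil m).rank = D.rank := by
  rw [Design.rank_eq_coeff, Design.rank_eq_coeff, dil_coeff]
  simp

end Design

/-! ### §5.2 The trace-part test (json side; a NECESSARY condition for C7 — memo-15 (N-a)) -/

namespace Design

/-- **THE TRACE-PART TEST for the semiregularity window `I`** (idea-crit-6 memo-15 (N-a), generalised; json-decidable; **NOT implied by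
C0–C4** — a genuinely new necessary condition for C7 at any FAITHFUL locally free realisation, [PEN, 4 lines]): EITHER `5 ∈ I` (form degree
`q' = 4`, where `ch₄ = q h⁴ + w` and the test abstains) OR some `q' ≤ 6`, `q' ≠ 4`, with `q' + 1 ∈ I` has `c_{q'}(D) ≠ 0`. REASON: the trace
part `H²(𝒪_X) · id_𝓔 ⊂ Ext²(𝓔, 𝓔)` (`28`-dimensional on the abelian `8`-fold; `ξ ↦ ξ·id` is injective, `Tr(ξ·id) = rk·ξ`) is mapped by
Buchweitz–Flenner's `σ_{q'} = Tr(− · At^{q'})∕q'!` to `± ξ ∪ ch_{q'}(𝓔)`; for a faithful realisation `ch_{q'}(𝓔) = (c_{q'}(D)∕q'!)·h^{q'}`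
(`q' ≠ 4`), and `ξ ↦ ξ ∪ h^{q'}` is injective on `H^{0,2}` iff `q' ≤ 6` (hard Lefschetz for the ample `h_std`; `H^{q', q'+2} = 0` for
`q' ≥ 7`). So if the test FAILS every `σ_{q'}`, `q' + 1 ∈ I`, kills the trace part and `𝓔` is NOT `{q' | q'+1 ∈ I}`-semiregular: the
SHEAF door at window `I` needs the design to pass it. For the BF window of record `I = {4}` the test is **`c₃(D) ≠ 0`**
(`traceAlive_singleton_four_iff`); every window containing `1` passes (`c₀ = rank`, `traceAlive_of_one_mem`) — in particular the
KOSZUL WINDOW `{1,2,3,4}` of the zero-locus cycle door (`Design.traceAlive_koszulWindow`): there Bloch's `π_Z ∘ κ⁻¹ = ±δc₄(𝓔₀(t))`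
MIXES `σ₀ … σ₃` (hsemireg-c4-1 g1 LEMMA KC, `C4StabilitySpec.lean` v1.2 `KoszulCompat`, MIXING form — NOT the naive `σ₃ ∘ κ`, which
this file does not carry) and its trace part `η ↦ ±η ∪ c₃(𝓔₀(t))` is alive for `t ≫ 0`. So the test is VACUOUS on the Koszul window
and BITES on windows without `1` and `5`. [cite: BuchweitzFlenner2003, Def. 4.1 and Thm. 5.1] -/
def TraceAlive (D : Design) (I : Finset ℕ) : Prop :=
  5 ∈ I ∨ ∃ p : Fin 9, (p : ℕ) + 1 ∈ I ∧ (p : ℕ) ≤ 6 ∧ (p : ℕ) ≠ 4 ∧ D.coeff p ≠ 0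

/-- **for `I = {4}` (Bloch ∕ BF `σ₃` alone) the trace-part test reads `c₃(D) ≠ 0`.** -/
theorem traceAlive_singleton_four_iff (D : Design) : D.TraceAlive {4} ↔ D.coeff 3 ≠ 0 := by
  constructor
  · rintro (h | ⟨⟨p, hp9⟩, hp, -, -, hc⟩)
    · simp at h
    · simp only [Finset.mem_singleton] at hp
      obtain rfl : p = 3 := by omega
      exact hc
  · intro h
    exact Or.inr ⟨3, by decide, by decide, by decide, h⟩

/-- a window containing `1` (form degree `0`: `ch₀ = rank`) passes the test as soon as the rank is non-zero. -/
theorem traceAlive_of_one_mem (D : Design) {I : Finset ℕ} (h1 : 1 ∈ I) (hr : D.rank ≠ 0) : D.TraceAlive I := by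
  refine Or.inr ⟨0, by simpa using h1, by decide, by decide, fun h0 => hr ?_⟩
  rw [Design.rank_eq_coeff, h0, Int.cast_zero]

/-- the test is monotone in the window. -/
theorem TraceAlive.mono {D : Design} {I J : Finset ℕ} (h : D.TraceAlive I) (hIJ : I ⊆ J) : D.TraceAlive J := by
  rcases h with h | ⟨p, hp, h6, h4, hc⟩
  · exact Or.inl (hIJ h)
  · exact Or.inr ⟨p, hIJ hp, h6, h4, hc⟩

end Design

/-- **THE KOSZUL WINDOW `I_KC = {1, 2, 3, 4}`** (BF form degrees `{0,1,2,3}`; hsemireg-c4-1 g1, `C4StabilitySpec.lean` v1.2, (C1)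
`isISemiregular_of_koszulCompat`, consumed BY NAME, not imported): for a ZERO-LOCUS seed `Z = Z(s_t)` (`s_t ∈ H⁰(𝓔₀(t))` regular,
`t ≫ 0`, `𝓔₀` locally free) «`Z(s_t)` Bloch-semiregular ⟹ `𝓔₀` `{0,1,2,3}`-semiregular» — the cycle door through zero loci is DOMINATED
by the sheaf door at this window (director A1 pending); in this file's vocabulary that sheaf door is `SheafSeedCheck… C koszulWindow K 𝓔`
(`4 ∈ I_KC`, `I_KC ⊆ {0..8}`: the two side conditions hold, below). -/
def koszulWindow : Finset ℕ := {1, 2, 3, 4}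

theorem four_mem_koszulWindow : 4 ∈ koszulWindow := by decide

theorem le_eight_of_mem_koszulWindow : ∀ p ∈ koszulWindow, p ≤ 8 := by decide

/-- on the Koszul window the trace-part test is FREE (`1 ∈ I_KC`, `c₀ = rank ≠ 0`). -/
theorem Design.traceAlive_koszulWindow (D : Design) (hr : D.rank ≠ 0) : D.TraceAlive koszulWindow :=
  D.traceAlive_of_one_mem (by decide) hr

/-- … while on the Bloch ∕ BF window of record `{4}` it is the genuine condition `c₃(D) ≠ 0`. -/
theorem Design.traceAlive_blochWindow_iff (D : Design) : D.TraceAlive {4} ↔ D.coeff 3 ≠ 0 :=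
  D.traceAlive_singleton_four_iff

end JsonSideVTwo

/-! ### §5.3 Object side: the rank-free sheaf door; the tower-over-a-seed clauses (ORDER (c), cycle AND sheaf version); Σ-avoidance -/

section ChecksVTwo

variable {E₀ : AbelianVariety ℂ} {ψ₀ : E₀ ⟶ E₀}

/-- **THE RANK-FREE SHEAF-SEED CHECKER** (director R19.262 (3) «SeedChecker v2»): C0′ (`Clean ∧ μ ≠ 0`) in place of C0; otherwise
`SheafSeedCheck` verbatim (`4 ∈ I ⊆ {0..8}`, finite locally free, `I`-semiregular, `RealisedBy` against `h_std`). The rank is whatever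
`RealisedBy` says (`ch₀ = c₀(D)`): for the R-B room present a rank-`≥ 8` design, e.g. a padded `D.padApex a k` (§5.1). -/
def Design.SheafSeedCheckRankFree (D : Design) (C : ChernCharacterBetti) (I : Finset ℕ) (K : AnchorKit E₀ ψ₀)
    (𝓔 : (pad4Anchor E₀).X.left.Modules) : Prop :=
  D.ClassDataRankFree ∧ 4 ∈ I ∧ (∀ p ∈ I, p ≤ 8) ∧
    (∃ h𝓔 : IsFiniteLocallyFree 𝓔, IsISemiregular h𝓔 {q' | q' + 1 ∈ I}) ∧ D.RealisedBy C K.F (hStd E₀ K.η) 𝓔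

/-- **THE SHEAF-SEED CHECKER AT RANK `r`**: `ClassDataR r` in place of C0 (`SheafSeedCheck = SheafSeedCheckR 4`). -/
def Design.SheafSeedCheckR (D : Design) (r : ℕ) (C : ChernCharacterBetti) (I : Finset ℕ) (K : AnchorKit E₀ ψ₀)
    (𝓔 : (pad4Anchor E₀).X.left.Modules) : Prop :=
  D.ClassDataR r ∧ 4 ∈ I ∧ (∀ p ∈ I, p ≤ 8) ∧
    (∃ h𝓔 : IsFiniteLocallyFree 𝓔, IsISemiregular h𝓔 {q' | q' + 1 ∈ I}) ∧ D.RealisedBy C K.F (hStd E₀ K.η) 𝓔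

theorem Design.sheafSeedCheck_iff_sheafSeedCheckR_four {D : Design} {C : ChernCharacterBetti} {I : Finset ℕ}
    {K : AnchorKit E₀ ψ₀} {𝓔 : (pad4Anchor E₀).X.left.Modules} :
    D.SheafSeedCheck C I K 𝓔 ↔ D.SheafSeedCheckR 4 C I K 𝓔 := by
  simp only [Design.SheafSeedCheck, Design.SheafSeedCheckR, Design.classData_iff_classDataR_four]

theorem Design.SheafSeedCheckR.rankFree {D : Design} {r : ℕ} {C : ChernCharacterBetti} {I : Finset ℕ}
    {K : AnchorKit E₀ ψ₀} {𝓔 : (pad4Anchor E₀).X.left.Modules} (h : D.SheafSeedCheckR r C I K 𝓔) :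
    D.SheafSeedCheckRankFree C I K 𝓔 :=
  ⟨h.1.rankFree, h.2⟩

theorem Design.SheafSeedCheck.rankFree {D : Design} {C : ChernCharacterBetti} {I : Finset ℕ}
    {K : AnchorKit E₀ ψ₀} {𝓔 : (pad4Anchor E₀).X.left.Modules} (h : D.SheafSeedCheck C I K 𝓔) :
    D.SheafSeedCheckRankFree C I K 𝓔 :=
  ⟨h.1.rankFree, h.2⟩

/-- **A PASSING RANK-FREE (design, sheaf) PAIR GIVES THE TREE'S `HasHyperbolicBFSheafSeedOn C 4 1 I`** — the proof of
`hasHyperbolicBFSheafSeedOn_of_sheafSeedCheck` verbatim (it uses only `μ ≠ 0` of C0). Pure repackaging. -/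
theorem hasHyperbolicBFSheafSeedOn_of_sheafSeedCheckRankFree (hE : E₀.dim = 1) (hψ : ψ₀ ≫ ψ₀ = -(1 • 𝟙 E₀))
    {D : Design} {C : ChernCharacterBetti} {I : Finset ℕ} {K : AnchorKit E₀ ψ₀} {𝓔 : (pad4Anchor E₀).X.left.Modules}
    (h : D.SheafSeedCheckRankFree C I K 𝓔) : HasHyperbolicBFSheafSeedOn C 4 1 I := by
  obtain ⟨hC0, h4, hI8, ⟨h𝓔, hsr⟩, hR⟩ := h
  have hcl : CleanAtSeed C I K.F (symH (pad4Action E₀ ψ₀) K.pol.e K.pol.a) 𝓔 D.mu :=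
    cleanAtSeed_symH_of_hStd hE hψ K (cleanAtSeed_of_realisedBy hI8 hR)
  exact ⟨pad4Anchor E₀, pad4Action E₀ ψ₀, K.pol.e, K.pol.a, K.F.wOf D.mu, pad4Anchor_dim hE,
    pad4Action_comp_self hψ, K.pol.a_rational, K.pol.a_ne_zero, K.hyperbolic_symH hE hψ, K.F.wOf_mem _,
    K.F.wOf_rational _, K.F.wOf_ne_zero hC0.2, hasBFSheafSeedOn_of_cleanAtSeed h𝓔 h4 hsr hcl⟩

theorem hasHyperbolicBFSheafSeedOn_of_sheafSeedCheckR (hE : E₀.dim = 1) (hψ : ψ₀ ≫ ψ₀ = -(1 • 𝟙 E₀))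
    {D : Design} {r : ℕ} {C : ChernCharacterBetti} {I : Finset ℕ} {K : AnchorKit E₀ ψ₀}
    {𝓔 : (pad4Anchor E₀).X.left.Modules} (h : D.SheafSeedCheckR r C I K 𝓔) : HasHyperbolicBFSheafSeedOn C 4 1 I :=
  hasHyperbolicBFSheafSeedOn_of_sheafSeedCheckRankFree hE hψ h.rankFree

/-! #### The tower over a seed: kernel characters, twisted normal `H¹`, twisted `Ext²`, Σ-avoidance, the law (a named statement) -/

section TowerOverSeed

variable (P : AbelianVariety ℂ) (φ : P ⟶ P)

/-- **THE KERNEL CHARACTERS of an endomorphism `φ` of the anchor** (intended: an isogeny commuting with `ψ`, e.g. `φ = 𝟙 − ψ` with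
`ker φ = X[1 − i] ≅ (ℤ∕2)⁸`, `256` characters): the invertible `𝒪_X`-modules `L` with `φ^*L ≅ 𝒪_X` — i.e. `L = P_χ`, `χ ∈ (ker φ)^∨ = ker φ̂`
(Mumford §15, Thm. 1). A predicate on real carriers (Mathlib's module pull-back, the tree's `IsInvertibleModule` ∕ `unitModule`). -/
def IsKernelCharacter (L : P.X.left.Modules) : Prop :=
  Modules.IsInvertibleModule L ∧
    Nonempty ((Scheme.Modules.pullback φ.hom.hom.hom.left).obj L ≅ Modules.unitModule P.X.left)

variable {P} in
/-- the unit module is a kernel character of every `φ` (`φ^*𝒪 ≅ 𝒪`), GIVEN that `𝒪` is invertible and the pull-back iso — both folklore,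
supplied as hypotheses (this file proves nothing about modules). -/
theorem isKernelCharacter_unit (hinv : Modules.IsInvertibleModule (Modules.unitModule P.X.left))
    (e : (Scheme.Modules.pullback φ.hom.hom.hom.left).obj (Modules.unitModule P.X.left) ≅ Modules.unitModule P.X.left) :
    IsKernelCharacter P φ (Modules.unitModule P.X.left) :=
  ⟨hinv, ⟨e⟩⟩

/-- **(C7⁺, CYCLE VERSION) TWISTED NORMAL `H¹` VANISHING AT THE SEED along `φ`** (director ORDER (c) R19.214, re-pointed R19.218 to this
file; memo-h3-07 π1 `twistedNormalH1Vanishes`; MEMO-03 §3 of plan-lens-HodgeAV-strengthen; the ABSTRACT linear-algebra shape of record is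
hsemireg-c4-1 g1's `C4Stability.TwistedVanishing T χ₀ V` with `towerStep_injective_iff` — this is its REAL-CARRIER instance
`V χ := H¹(Z, 𝒩 ⊗ i^*P_χ)`, with `(ker φ)^∨` presented intrinsically by `IsKernelCharacter`, no enumeration of `X̂[1−i]` needed; for
ZERO-LOCUS seeds the cycle and sheaf versions coincide by their `twistedVanishing_iff_of_equiv`): for every NON-TRIVIAL kernel character
`L = P_χ` of `φ`, `H¹(Z, 𝒩_{Z∕X} ⊗ i^*P_χ) = 0` — on the tree's REAL `normalSheaf i`, `Modules.tensorObj`, `Scheme.Modules.pullback i`,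
`moduleSheafCohomology … 1`. This is what the unit-scale isogeny tower costs at the seed (the law below); it is NOT a condition of the stub
`stub_rung_pad4_seedAt` itself (one seed per anchor suffices there) — flagged: EXTRA, needed only by the tower ∕ the R-C room. -/
def TwistedNormalH1Vanishes {Z : Scheme.{0}} (i : Z ⟶ P.X.left) : Prop :=
  ∀ L : P.X.left.Modules, IsKernelCharacter P φ L → IsEmpty (L ≅ Modules.unitModule P.X.left) →
    Subsingleton (moduleSheafCohomology (Modules.tensorObj (normalSheaf i) ((Scheme.Modules.pullback i).obj L)) 1)

/-- **(C7⁺, SHEAF VERSION) TWISTED `Ext²` VANISHING along `φ`** for a (finite locally free) `𝓔`: `H²(X, 𝓗om(𝓔, 𝓔 ⊗ P_χ)) = 0`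
(`= Ext²(𝓔, 𝓔 ⊗ P_χ)` for locally free `𝓔`, Hartshorne III.6.3∕6.7) for every non-trivial kernel character. Critic memo-h3-11 σ2 [pen]:
`Ext²(φ^*𝓔, φ^*𝓔) = ⊕_χ Ext²(𝓔, 𝓔 ⊗ P_χ)`, `σ_{q'}` is `ker φ`-equivariant into the translation-INVARIANT `H^{q'+2}(Ω^{q'})`, so
**`φ^*𝓔` is `I`-semiregular ⟺ `𝓔` is AND `TwistedEndExt2Vanishes`** — pulling back never eases C7. [cite: Hartshorne1977, III.6.3 and III.6.7] -/
def TwistedEndExt2Vanishes (𝓔 : P.X.left.Modules) : Prop :=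
  ∀ L : P.X.left.Modules, IsKernelCharacter P φ L → IsEmpty (L ≅ Modules.unitModule P.X.left) →
    Subsingleton (moduleSheafCohomology (Modules.sheafHom 𝓔 (Modules.tensorObj 𝓔 L)) 2)

/-- **Mukai's `Σ(𝓔)`** = the invertible `L` with `𝓔 ⊗ L ≅ 𝓔` (`Σ(E) = {x ∈ Â | E ⊗ P_x ≅ E}`, a finite subgroup scheme of order `r²`
for `E` simple semi-homogeneous of rank `r`). [cite: Mukai1978, Prop. 7.1] -/
def sigmaSet {X : Scheme} (𝓔 : X.Modules) : Set X.Modules :=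
  {L | Modules.IsInvertibleModule L ∧ Nonempty (Modules.tensorObj 𝓔 L ≅ 𝓔)}

/-- **Σ-AVOIDANCE along `φ`, real-carrier form** (director R19.222 (4), lit-8 carrier f54f822a63820d12; the letter-level DECIDABLE proxy
with explicit jump finsets is hsemireg-c4-1 g1's `C4Stability.SigmaAvoidance`): no NON-TRIVIAL kernel character of `φ` lies in
`Σ(𝓔)` — `(ker φ)^∨ ∩ Σ(𝓔) = {1}`. For a SIMPLE SEMI-HOMOGENEOUS `𝓔` (the LETTERS of a monad; not the monad bundle) [pen 2 lines from
Mukai's `𝓔nd 𝓔 ≅ ⊕_{σ ∈ Σ(𝓔)} P_σ`]: `Ext²(𝓔, 𝓔 ⊗ P_χ) ≠ 0 ⟺ χ ∈ Σ(𝓔)`, so `TwistedEndExt2Vanishes ⟺ SigmaAvoidance` for such `𝓔`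
(NOT proved here). [cite: Mukai1978, Prop. 7.1] -/
def SigmaAvoidance (𝓔 : P.X.left.Modules) : Prop :=
  ∀ L : P.X.left.Modules, IsKernelCharacter P φ L → L ∈ sigmaSet 𝓔 → Nonempty (L ≅ Modules.unitModule P.X.left)

/-- **THE TOWER-OVER-A-SEED LAW (cycle version) — A NAMED STATEMENT (`Prop`), NEITHER PROVED NOR ASSERTED HERE** [PEN ×1 + critic
memo-h3-11 σ2; MEMO-03 §3; memo-h3-07 π1]: for the (intended: étale, `ψ`-commuting) isogeny `φ`, the preimage `φ⁻¹Z = Z ×_X X`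
(`pullback.snd i φ`) of an lci codimension-`4` seed is Bloch-semiregular in the `8`-fold iff `Z` is AND the twisted normal `H¹` vanish
(`H¹(φ⁻¹Z, 𝒩) = ⊕_χ H¹(Z, 𝒩 ⊗ P_χ|_Z)`, Bloch's `π` is `ker φ`-equivariant into the translation-invariant `H^{p+1}(Ω^{p−1})` and kills every
`χ ≠ 1` summand). Consumed as a hypothesis `(hlaw : TowerOverSeedLaw P φ)`. -/
def TowerOverSeedLaw : Prop :=
  ∀ ⦃Z : Scheme.{0}⦄ (i : Z ⟶ P.X.left), IsClosedImmersion i → IsRegularImmersionOfCodim i 4 →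
    (IsBlochSemiregular (Limits.pullback.snd i φ.hom.hom.hom.left) (2 * 4) 4 ↔
      IsBlochSemiregular i (2 * 4) 4 ∧ TwistedNormalH1Vanishes P φ i)

variable {P φ} in
/-- how the law is consumed: a semiregular seed with the twisted vanishing climbs one storey. -/
theorem isBlochSemiregular_preimage_of_law (hlaw : TowerOverSeedLaw P φ) {Z : Scheme.{0}} {i : Z ⟶ P.X.left}
    (hci : IsClosedImmersion i) (hreg : IsRegularImmersionOfCodim i 4) (hsr : IsBlochSemiregular i (2 * 4) 4)
    (htw : TwistedNormalH1Vanishes P φ i) :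
    IsBlochSemiregular (Limits.pullback.snd i φ.hom.hom.hom.left) (2 * 4) 4 :=
  (hlaw i hci hreg).2 ⟨hsr, htw⟩

variable {P φ} in
/-- … and conversely the law says the storey above is semiregular ONLY IF the seed is. -/
theorem isBlochSemiregular_of_preimage_of_law (hlaw : TowerOverSeedLaw P φ) {Z : Scheme.{0}} {i : Z ⟶ P.X.left}
    (hci : IsClosedImmersion i) (hreg : IsRegularImmersionOfCodim i 4)
    (h : IsBlochSemiregular (Limits.pullback.snd i φ.hom.hom.hom.left) (2 * 4) 4) :
    IsBlochSemiregular i (2 * 4) 4 ∧ TwistedNormalH1Vanishes P φ i :=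
  (hlaw i hci hreg).1 h

end TowerOverSeed

/-- **THE SEED CHECKER WITH TOWER CLAUSE (lci door + C7⁺ along `φ`)**: `SeedCheck ∧ TwistedNormalH1Vanishes` — what a seed must pass so
that (GIVEN `TowerOverSeedLaw`) its preimage under `φ` is again Bloch-semiregular (the class side of the storey, `h ↦ m·h`, `w ↦ m⁴·w`, is
free: `StrengthenScale.hasHyperbolicBlochSeed_of_scaled`, cited not restated — director R19.230). -/
def Design.SeedCheckTower (D : Design) (K : AnchorKit E₀ ψ₀) {Z : Scheme.{0}} (i : Z ⟶ (pad4Anchor E₀).X.left) (q : ℚ)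
    (φ : pad4Anchor E₀ ⟶ pad4Anchor E₀) : Prop :=
  D.SeedCheck K i q ∧ TwistedNormalH1Vanishes (pad4Anchor E₀) φ i

theorem Design.SeedCheckTower.seedCheck {D : Design} {K : AnchorKit E₀ ψ₀} {Z : Scheme.{0}}
    {i : Z ⟶ (pad4Anchor E₀).X.left} {q : ℚ} {φ : pad4Anchor E₀ ⟶ pad4Anchor E₀} (h : D.SeedCheckTower K i q φ) :
    D.SeedCheck K i q :=
  h.1

/-- a passing (design, presentation, `φ`) triple has a Bloch-semiregular preimage seed, GIVEN the law. -/
theorem Design.SeedCheckTower.preimage_semiregular {D : Design} {K : AnchorKit E₀ ψ₀} {Z : Scheme.{0}}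
    {i : Z ⟶ (pad4Anchor E₀).X.left} {q : ℚ} {φ : pad4Anchor E₀ ⟶ pad4Anchor E₀} (h : D.SeedCheckTower K i q φ)
    (hlaw : TowerOverSeedLaw (pad4Anchor E₀) φ) :
    IsBlochSemiregular (Limits.pullback.snd i φ.hom.hom.hom.left) (2 * 4) 4 :=
  isBlochSemiregular_preimage_of_law hlaw h.1.2.1 h.1.2.2.1 h.1.2.2.2.2.2.1 h.2

/-- **THE SHEAF-SEED CHECKER WITH TOWER CLAUSE (sheaf door + C7⁺)**: rank-free check ∧ `TwistedEndExt2Vanishes`. -/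
def Design.SheafSeedCheckTower (D : Design) (C : ChernCharacterBetti) (I : Finset ℕ) (K : AnchorKit E₀ ψ₀)
    (𝓔 : (pad4Anchor E₀).X.left.Modules) (φ : pad4Anchor E₀ ⟶ pad4Anchor E₀) : Prop :=
  D.SheafSeedCheckRankFree C I K 𝓔 ∧ TwistedEndExt2Vanishes (pad4Anchor E₀) φ 𝓔

/-! #### `[α]^*`-covariance of `RealisedBy` (critic memo-h3-11 σ2: the two-line lemma, made concrete) -/

/-- `wOf (n·μ) = n · wOf μ` for an INTEGER `n` (`Re(nμ) = n Re μ`, `Im(nμ) = n Im μ`). -/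
theorem WeilFrame.wOf_intCast_mul (F : WeilFrame E₀ ψ₀) (n : ℤ) (μ : GaussianInt) :
    F.wOf ((n : GaussianInt) * μ) = ((n : ℚ) : ℂ) • F.wOf μ := by
  simp only [WeilFrame.wOf, Zsqrtd.re_mul, Zsqrtd.im_mul, Zsqrtd.re_intCast, Zsqrtd.im_intCast, zero_mul,
    mul_zero, add_zero, smul_add, smul_smul, Int.cast_mul, Rat.cast_mul]

/-- `φ^* wOf μ = wOf (m⁴ μ)` when `φ^*` scales the Weil frame by `m⁴`. -/
theorem WeilFrame.map_wOf_of_frame (F : WeilFrame E₀ ψ₀) (φ : pad4Anchor E₀ ⟶ pad4Anchor E₀) (m : ℤ)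
    (hr₁ : complexBetti.map φ.hom.hom.hom (2 * 4) F.rOne = (((m ^ 4 : ℤ) : ℚ) : ℂ) • F.rOne)
    (hr₂ : complexBetti.map φ.hom.hom.hom (2 * 4) F.rTwo = (((m ^ 4 : ℤ) : ℚ) : ℂ) • F.rTwo) (μ : GaussianInt) :
    complexBetti.map φ.hom.hom.hom (2 * 4) (F.wOf μ) = F.wOf (((m ^ 4 : ℤ) : GaussianInt) * μ) := by
  rw [WeilFrame.wOf_intCast_mul, WeilFrame.wOf, map_add, map_smul, map_smul, hr₁, hr₂, smul_add, smul_smul, smul_smul,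
    smul_smul, smul_smul, mul_comm ((((m ^ 4 : ℤ) : ℚ) : ℂ)) (((μ.re : ℚ) : ℂ)),
    mul_comm ((((m ^ 4 : ℤ) : ℚ) : ℂ)) (((μ.im : ℚ) : ℂ))]

/-- **`RealisedBy` IS `[α]^*`-COVARIANT** (critic memo-h3-11 σ2's two-line lemma, made concrete): if the vector bundle `𝓔` realises `D`
through the frame `(h, r₁, r₂)` and the anchor endomorphism `φ` acts on the frame as `[α]^*` does — `φ^*h = m·h`, `φ^*r_j = m⁴·r_j`
(`m = |α|²`; per factor `[α]^*` multiplies `u, v, e, ē` by `αᾱ` and the point class by `m²` — critic σ2, pencil; SUPPLIED AS HYPOTHESES,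
not proved here) — then `φ^*𝓔` realises the DILATED design `D_m ν` (`c_p ↦ m^p c_p`, `μ ↦ m⁴ μ`; §5.1). Proof: `ch ∘ φ^* = φ^* ∘ ch`
(`ChernCharacterBetti.map_ch`), `φ^*(h^p) = (φ^*h)^p` (`map_cupPowTwo`), bilinearity. `IsISemiregular` is NOT covariant — its defect is
exactly `TwistedEndExt2Vanishes` (above). -/
theorem Design.realisedBy_dil_pullback {D : Design} {C : ChernCharacterBetti} {F : WeilFrame E₀ ψ₀}
    {h : complexBetti (pad4Anchor E₀).X 2} {𝓔 : (pad4Anchor E₀).X.left.Modules} (hR : D.RealisedBy C F h 𝓔)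
    (h𝓔 : IsVectorBundle 𝓔) (φ : pad4Anchor E₀ ⟶ pad4Anchor E₀) (m : ℤ)
    (hh : complexBetti.map φ.hom.hom.hom 2 h = ((m : ℚ) : ℂ) • h)
    (hr₁ : complexBetti.map φ.hom.hom.hom (2 * 4) F.rOne = (((m ^ 4 : ℤ) : ℚ) : ℂ) • F.rOne)
    (hr₂ : complexBetti.map φ.hom.hom.hom (2 * 4) F.rTwo = (((m ^ 4 : ℤ) : ℚ) : ℂ) • F.rTwo) :
    (D.dil m).RealisedBy C F h ((Scheme.Modules.pullback φ.hom.hom.hom.left).obj 𝓔) := by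
  have key : ∀ p : ℕ, complexBetti.map φ.hom.hom.hom (2 * p) (cupPowTwo h p) = (((m : ℚ) : ℂ)) ^ p • cupPowTwo h p := by
    intro p
    have hh' : singularCohomology.map ℂ ℂ (Motives.AlgPoints.mapContinuous (L := ℂ) φ.hom.hom.hom) 2 h =
        ((m : ℚ) : ℂ) • h := hh
    show singularCohomology.map ℂ ℂ (Motives.AlgPoints.mapContinuous (L := ℂ) φ.hom.hom.hom) (2 * p) (cupPowTwo h p) = _
    rw [map_cupPowTwo, hh', cupPowTwo_smul_aux]
  refine ⟨Design.dil_clean m D hR.1, fun p hp => ?_, ?_⟩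
  · rw [← C.map_ch φ.hom.hom.hom 𝓔 h𝓔 p, hR.2.1 p hp, map_smul, key, smul_smul, Design.dil_coeff]
    congr 1
    push_cast
    ring
  · rw [← C.map_ch φ.hom.hom.hom 𝓔 h𝓔 4, hR.2.2, map_add, map_smul, key, smul_smul,
      WeilFrame.map_wOf_of_frame F φ m hr₁ hr₂, Design.dil_coeff, Design.dil_mu, show ((4 : Fin 9) : ℕ) = 4 from rfl]
    congr 1
    congr 1
    push_cast
    ring

end ChecksVTwo

end VTwo

/-! ## §6 v3 (g2, 2026-08-29) — ADDITIVE: PRESENTATIONS. The word frame; «the bundle realises the tensor»; (A1)@seed FROM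
EXACTNESS (`ChernCharacterBetti.ch_shortExact`, kernel — g0's pencil sentence); kernel ∕ cokernel ∕ monad presentations ⟹
`RealisedBy`; letters with multiplicity; TWIST-BLINDNESS typed (`ChEquiv`). No declaration of §1–§5 is changed. -/

section VThree

/-! ### §6.1 JSON side: the side tensors `T_N`, `T_P`; words by degree; `μ̄ = conj μ` on 𝔅(μ₄) -/

section JsonSideVThree

namespace Design

/-- the `N`-side tensor `T_N(D) = Σ_N m_N · ch(N)` — the class tensor the `N`-bundle `𝓝` of a display must carry. -/
def wchN (D : Design) : CWord → GaussianInt := ∑ Z ∈ D.cfg.lower, D.mN Z • Z.ch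

/-- the `P`-side tensor `T_P(D) = Σ_P m_P · ch(P)`. -/
def wchP (D : Design) : CWord → GaussianInt := ∑ P ∈ D.cfg.upper, D.mP P • P.ch

/-- `T(D) = T_N(D) − T_P(D)` (FILE A's orientation `[𝓔] = [𝓝] − [𝓟]` in `K⁰`). [`rfl`] -/
theorem wch_eq_wchN_sub_wchP (D : Design) : D.wch = D.wchN - D.wchP := rfl

end Design

/-- the words of degree `p` (`wdeg` is decidable; `6⁴ = 1296` words in all). -/
def wordsOfDeg (p : ℕ) : Finset CWord := Finset.univ.filter fun w => wdeg w = p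

/-- the e-FREE words of degree `p` (the monomials of `h^p ∕ p!`). -/
def eFreeWordsOfDeg (p : ℕ) : Finset CWord := (wordsOfDeg p).filter fun w => EFree w

theorem mem_wordsOfDeg {p : ℕ} {w : CWord} : w ∈ wordsOfDeg p ↔ wdeg w = p := by
  simp [wordsOfDeg]

theorem mem_eFreeWordsOfDeg {p : ℕ} {w : CWord} : w ∈ eFreeWordsOfDeg p ↔ wdeg w = p ∧ EFree w := by
  simp [eFreeWordsOfDeg, wordsOfDeg]

theorem wdeg_ebarWord : wdeg ebarWord = 4 := by decide

/-- on a balanced factor point the letter `ē` (index `4`) is the CONJUGATE of the letter `e` (index `3`): `β̄ = conj β`. -/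
theorem bphi_four_eq_star (x : BPoint) : bphi x 4 = star (bphi x 3) := by
  ext <;> simp [bphi, phiVec]

/-- hence `ch(Z)(ēēēē) = conj (ch(Z)(eeee))` for every 𝔅(μ₄) cell. -/
theorem MCell.ch_ebarWord_eq_star (Z : MCell) : Z.ch ebarWord = star (Z.ch eWord) := by
  have h3 : ∀ f, eWord f = 3 := by decide
  have h4 : ∀ f, ebarWord f = 4 := by decide
  simp only [MCell.ch, chTensor, h3, h4, bphi_four_eq_star, star_mul']

/-- **`μ̄(D) = conj μ(D)`** for every design (integer multiplicities, 𝔅(μ₄) cells) — the clause pad4lib's `pass` asks and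
`ClassScreen` omits holds automatically on designs of record. -/
theorem Design.mubar_eq_star_mu (D : Design) : D.mubar = star D.mu := by
  simp only [Design.mubar, Design.mu, Design.wch, MConfig.wch, Pi.sub_apply, Finset.sum_apply, Pi.smul_apply,
    star_sub, star_sum, star_zsmul, MCell.ch_ebarWord_eq_star]

end JsonSideVThree

/-! ### §6.2 The word frame (INTERFACE; obligation O-WF, design-independent, once per anchor) -/

section WordFrameSection

/-- **THE WORD FRAME** of the anchor `S⁴ = pad4Anchor E₀` (INTERFACE — an instance is the obligation O-WF, NOT asserted here;
design-independent, once per anchor, like the `AnchorKit`): a class `cls p w ∈ H^{2p}(S⁴(ℂ); ℂ)` for every word `w` of the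
class frame and every degree `p` (meaningful at `p = wdeg w`). DICTIONARY with the cell's frame (pad4lib `LETTERS`, w1h1
`phi_letter`): `cls (wdeg w) w = ×_f ℓ(w_f)` with the letter classes `1`, `u_f = pr₁^*η`, `v_f = pr₂^*η`, `e_f`, `ē_f`
(the two `ψ`-eigen-classes of `H¹(E₀) ⊗ H¹(E₀) ⊂ H²(S_f)`), `p_f = u_f v_f` (point class) on the factor `S_f = E₀ × E₀`,
exterior-multiplied over the four factors. Only its LAWS (`WordFrame.LinksTo`) are consumed. -/
structure WordFrame (E₀ : AbelianVariety ℂ) where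
  /-- the class of the word `w`, read in degree `p` -/
  cls (p : ℕ) (w : CWord) : complexBetti (pad4Anchor E₀).X (2 * p)

variable {E₀ : AbelianVariety ℂ} {ψ₀ : E₀ ⟶ E₀}

/-- **THE WORD FRAME IS LINKED TO THE FRAME `(h, r₁, r₂)`** (the laws of the dictionary, a `Prop`; part of O-WF):
(F1) `Σ_{e-free w, wdeg w = p} cls p w = h^p ∕ p!` for `p ≤ 8` — `h = Σ_f (u_f + v_f)` with `u_f² = v_f² = 0`,
`u_f v_f = p_f`, so the multinomial expansion of `h^p` hits every e-free word of degree `p` exactly `p!` times;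
(F2) `r₁ = cls₄ eeee + cls₄ ēēēē`, `r₂ = i·(cls₄ eeee − cls₄ ēēēē)` (the `WeilFrame` dictionary). -/
structure WordFrame.LinksTo (Φ : WordFrame E₀) (F : WeilFrame E₀ ψ₀) (h : complexBetti (pad4Anchor E₀).X 2) : Prop where
  /-- (F1) `h^p ∕ p!` is the sum of the e-free words of degree `p` -/
  sum_eFree : ∀ p : Fin 9, ∑ w ∈ eFreeWordsOfDeg p, Φ.cls p w = (((p : ℕ).factorial : ℕ) : ℂ)⁻¹ • cupPowTwo h p
  /-- (F2) `r₁ = eeee + ēēēē` -/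
  rOne_eq : F.rOne = Φ.cls 4 eWord + Φ.cls 4 ebarWord
  /-- (F2) `r₂ = i(eeee − ēēēē)` -/
  rTwo_eq : F.rTwo = Complex.I • (Φ.cls 4 eWord - Φ.cls 4 ebarWord)

/-- **THE CLASS A TENSOR NAMES** in degree `p`, read in the word frame: `T ↦ Σ_{wdeg w = p} T(w) · cls p w` (additive in `T`;
`ℤ[i] → ℂ` is `GaussianInt.toComplex`). -/
def WordFrame.classOf (Φ : WordFrame E₀) (p : ℕ) : (CWord → GaussianInt) →+ complexBetti (pad4Anchor E₀).X (2 * p) where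
  toFun T := ∑ w ∈ wordsOfDeg p, GaussianInt.toComplex (T w) • Φ.cls p w
  map_zero' := by simp only [Pi.zero_apply, map_zero, zero_smul, Finset.sum_const_zero]
  map_add' T T' := by simp only [Pi.add_apply, map_add, add_smul, Finset.sum_add_distrib]

theorem WordFrame.classOf_apply (Φ : WordFrame E₀) (p : ℕ) (T : CWord → GaussianInt) :
    Φ.classOf p T = ∑ w ∈ wordsOfDeg p, GaussianInt.toComplex (T w) • Φ.cls p w := rfl

/-- the class a tensor names splits as its e-free part plus its e-mixed part. -/
theorem WordFrame.classOf_split (Φ : WordFrame E₀) (p : ℕ) (T : CWord → GaussianInt) :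
    Φ.classOf p T = ∑ w ∈ eFreeWordsOfDeg p, GaussianInt.toComplex (T w) • Φ.cls p w +
      ∑ w ∈ (wordsOfDeg p).filter (fun w => ¬ EFree w), GaussianInt.toComplex (T w) • Φ.cls p w := by
  rw [WordFrame.classOf_apply, eFreeWordsOfDeg, Finset.sum_filter_add_sum_filter_not]

/-- for an (A1)-clean design the e-free part of degree `p` is `c_p(D) · Σ_{e-free, deg p} cls p w`. -/
theorem Design.sum_eFree_smul_of_clean (D : Design) (hD : D.Clean) (Φ : WordFrame E₀) (p : Fin 9) :
    ∑ w ∈ eFreeWordsOfDeg p, GaussianInt.toComplex (D.wch w) • Φ.cls p w =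
      ((D.coeff p : ℤ) : ℂ) • ∑ w ∈ eFreeWordsOfDeg p, Φ.cls p w := by
  rw [Finset.smul_sum]
  refine Finset.sum_congr rfl fun w hw => ?_
  obtain ⟨hdeg, hfree⟩ := mem_eFreeWordsOfDeg.1 hw
  have hp : (⟨wdeg w, Nat.lt_succ_of_le (wdeg_le_eight w)⟩ : Fin 9) = p := Fin.ext hdeg
  rw [D.wch_eq_coeff_of_clean hD hfree, map_intCast, hp]

/-- for an (A1)-clean design the e-mixed part vanishes in every degree `p ≠ 4` (clause (i) of the screen; `eeee`, `ēēēē`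
have degree `4`). -/
theorem Design.sum_eMixed_eq_zero_of_clean (D : Design) (hD : D.Clean) (Φ : WordFrame E₀) {p : ℕ} (hp : p ≠ 4) :
    ∑ w ∈ (wordsOfDeg p).filter (fun w => ¬ EFree w), GaussianInt.toComplex (D.wch w) • Φ.cls p w = 0 := by
  refine Finset.sum_eq_zero fun w hw => ?_
  rw [Finset.mem_filter, mem_wordsOfDeg] at hw
  have h1 : w ≠ eWord := fun h => hp (by rw [← hw.1, h]; exact Design.wdeg_eWord)
  have h2 : w ≠ ebarWord := fun h => hp (by rw [← hw.1, h]; exact wdeg_ebarWord)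
  rw [hD.1 w hw.2 h1 h2, map_zero, zero_smul]

/-- for an (A1)-clean design the e-mixed part of degree `4` is `μ · cls₄ eeee + μ̄ · cls₄ ēēēē`. -/
theorem Design.sum_eMixed_four_of_clean (D : Design) (hD : D.Clean) (Φ : WordFrame E₀) :
    ∑ w ∈ (wordsOfDeg 4).filter (fun w => ¬ EFree w), GaussianInt.toComplex (D.wch w) • Φ.cls 4 w =
      GaussianInt.toComplex D.mu • Φ.cls 4 eWord + GaussianInt.toComplex D.mubar • Φ.cls 4 ebarWord := by
  have he : eWord ∈ (wordsOfDeg 4).filter (fun w => ¬ EFree w) :=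
    Finset.mem_filter.2 ⟨mem_wordsOfDeg.2 Design.wdeg_eWord, not_eFree_eWord.1⟩
  have heb : ebarWord ∈ (wordsOfDeg 4).filter (fun w => ¬ EFree w) :=
    Finset.mem_filter.2 ⟨mem_wordsOfDeg.2 wdeg_ebarWord, not_eFree_eWord.2.1⟩
  rw [Finset.sum_eq_add_of_mem eWord ebarWord he heb not_eFree_eWord.2.2 fun c hc hne => by
    rw [hD.1 c (Finset.mem_filter.1 hc).2 hne.1 hne.2, map_zero, zero_smul]]
  rfl

/-- **(A1) OF THE DESIGN ⟹ THE CLASS ITS TENSOR NAMES IS `(c_p ∕ p!)·h^p` IN DEGREES `p ≠ 4`.** -/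
theorem Design.classOf_wch_of_ne_four (D : Design) {Φ : WordFrame E₀} {F : WeilFrame E₀ ψ₀}
    {h : complexBetti (pad4Anchor E₀).X 2} (hΦ : Φ.LinksTo F h) (hD : D.Clean) (p : Fin 9) (hp : (p : ℕ) ≠ 4) :
    Φ.classOf p D.wch = ((((D.coeff p : ℤ) : ℚ) / ((p : ℕ).factorial : ℚ) : ℚ) : ℂ) • cupPowTwo h p := by
  rw [WordFrame.classOf_split, D.sum_eFree_smul_of_clean hD Φ p, hΦ.sum_eFree p,
    D.sum_eMixed_eq_zero_of_clean hD Φ hp, add_zero, smul_smul]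
  congr 1
  push_cast
  ring

/-- **(A1) OF THE DESIGN ⟹ THE CLASS ITS TENSOR NAMES IN DEGREE `4` IS `(c₄ ∕ 24)·h⁴ + wOf μ`** (`μ̄ = conj μ`, (F2), and
`Re μ · r₁ + Im μ · r₂ = μ · eeee + μ̄ · ēēēē`). -/
theorem Design.classOf_wch_four (D : Design) {Φ : WordFrame E₀} {F : WeilFrame E₀ ψ₀}
    {h : complexBetti (pad4Anchor E₀).X 2} (hΦ : Φ.LinksTo F h) (hD : D.Clean) :
    Φ.classOf 4 D.wch = ((((D.coeff 4 : ℤ) : ℚ) / 24 : ℚ) : ℂ) • cupPowTwo h 4 + F.wOf D.mu := by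
  have hfree : ∑ w ∈ eFreeWordsOfDeg 4, GaussianInt.toComplex (D.wch w) • Φ.cls 4 w =
      ((D.coeff 4 : ℤ) : ℂ) • ∑ w ∈ eFreeWordsOfDeg 4, Φ.cls 4 w := D.sum_eFree_smul_of_clean hD Φ 4
  have hF1 : ∑ w ∈ eFreeWordsOfDeg 4, Φ.cls 4 w = ((Nat.factorial 4 : ℕ) : ℂ)⁻¹ • cupPowTwo h 4 := hΦ.sum_eFree 4
  rw [WordFrame.classOf_split, D.sum_eMixed_four_of_clean hD Φ, hfree, hF1, Design.mubar_eq_star_mu,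
    GaussianInt.toComplex_star, WeilFrame.wOf, hΦ.rOne_eq, hΦ.rTwo_eq, GaussianInt.toComplex_def, smul_smul]
  simp only [map_add, map_mul, map_intCast, Complex.conj_I, Rat.cast_intCast, Rat.cast_div, Rat.cast_ofNat,
    show (Nat.factorial 4 : ℕ) = 24 from rfl, Nat.cast_ofNat]
  module

end WordFrameSection

/-! ### §6.3 «The sheaf realises the tensor»; exactness; letters with multiplicity; twist-blindness -/

section Realisation

variable {E₀ : AbelianVariety ℂ} {ψ₀ : E₀ ⟶ E₀} {C : ChernCharacterBetti} {Φ : WordFrame E₀}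

/-- **«THE SHEAF `𝓕` REALISES THE TENSOR `T`»** (through the Chern character theory `C` and the word frame `Φ`):
`ch_p(𝓕) = Σ_{wdeg w = p} T(w) · cls p w` for `p = 0, …, 8`. For a cell `Z` and `T = ch(Z)` this is the MODELLING SENTENCE
«`ch 𝒪(X_Z) = ⊗_f φ(Z_f)` in the frame» (obligation O-cells, per cell, `LetterKit`); for `T = T(D)` it is the statement the
sheaf door consumes (`Design.realisedBy_of_realisesTensor`). -/
def RealisesTensor (C : ChernCharacterBetti) (Φ : WordFrame E₀) (𝓕 : (pad4Anchor E₀).X.left.Modules)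
    (T : CWord → GaussianInt) : Prop :=
  ∀ p : Fin 9, C.ch (pad4Anchor E₀).X 𝓕 p = Φ.classOf p T

/-- **THE COLLAPSE: a sheaf realising the tensor of an (A1)-clean design REALISES THE DESIGN** (`Design.RealisedBy`, §4) —
through any word frame linked to `(h, r₁, r₂)`. This is (A1@Z) ⟸ (A1) made kernel: the class side of C5–C8 is decided by
C0's `Clean` once the presentation realises `T(D)`. -/
theorem Design.realisedBy_of_realisesTensor {D : Design} {F : WeilFrame E₀ ψ₀} {h : complexBetti (pad4Anchor E₀).X 2}
    {𝓔 : (pad4Anchor E₀).X.left.Modules} (hΦ : Φ.LinksTo F h) (hD : D.Clean) (hR : RealisesTensor C Φ 𝓔 D.wch) :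
    D.RealisedBy C F h 𝓔 :=
  ⟨hD, fun p hp => (hR p).trans (D.classOf_wch_of_ne_four hΦ hD p hp), (hR 4).trans (D.classOf_wch_four hΦ hD)⟩

/-- isomorphic sheaves realise the same tensor (`ch_congr`). -/
theorem RealisesTensor.congr_iso {𝓕 𝓕' : (pad4Anchor E₀).X.left.Modules} {T : CWord → GaussianInt}
    (hT : RealisesTensor C Φ 𝓕 T) (e : 𝓕 ≅ 𝓕') : RealisesTensor C Φ 𝓕' T :=
  fun p => (C.ch_congr e p).symm.trans (hT p)

/-- a zero sheaf realises the zero tensor. -/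
theorem realisesTensor_zero_of_isZero {𝓕 : (pad4Anchor E₀).X.left.Modules} (h𝓕 : Limits.IsZero 𝓕) :
    RealisesTensor C Φ 𝓕 0 :=
  fun p => by rw [C.ch_eq_zero_of_isZero h𝓕, map_zero]

/-- **EXACTNESS, middle term**: in `0 → 𝓕₁ → 𝓕₂ → 𝓕₃ → 0` with `𝓕₁`, `𝓕₃` vector bundles realising `T₁`, `T₃`, the middle
term realises `T₁ + T₃` (`ChernCharacterBetti.ch_shortExact`). -/
theorem RealisesTensor.shortExact_mid {S : ShortComplex (pad4Anchor E₀).X.left.Modules} (hS : S.ShortExact)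
    (h₁ : IsVectorBundle S.X₁) (h₃ : IsVectorBundle S.X₃) {T₁ T₃ : CWord → GaussianInt}
    (hT₁ : RealisesTensor C Φ S.X₁ T₁) (hT₃ : RealisesTensor C Φ S.X₃ T₃) : RealisesTensor C Φ S.X₂ (T₁ + T₃) :=
  fun p => by rw [C.ch_shortExact S hS h₁ h₃ p, hT₁ p, hT₃ p, map_add]

/-- **EXACTNESS, kernel**: in `0 → 𝓕₁ → 𝓕₂ → 𝓕₃ → 0` (`𝓕₁`, `𝓕₃` vector bundles) with `𝓕₂`, `𝓕₃` realising `T₂`, `T₃`,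
the kernel `𝓕₁` realises `T₂ − T₃`. -/
theorem RealisesTensor.shortExact_left {S : ShortComplex (pad4Anchor E₀).X.left.Modules} (hS : S.ShortExact)
    (h₁ : IsVectorBundle S.X₁) (h₃ : IsVectorBundle S.X₃) {T₂ T₃ : CWord → GaussianInt}
    (hT₂ : RealisesTensor C Φ S.X₂ T₂) (hT₃ : RealisesTensor C Φ S.X₃ T₃) : RealisesTensor C Φ S.X₁ (T₂ - T₃) :=
  fun p => by rw [map_sub, ← hT₂ p, ← hT₃ p, C.ch_shortExact S hS h₁ h₃ p, add_sub_cancel_right]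

/-- **EXACTNESS, cokernel**: in `0 → 𝓕₁ → 𝓕₂ → 𝓕₃ → 0` (`𝓕₁`, `𝓕₃` vector bundles) with `𝓕₁`, `𝓕₂` realising `T₁`, `T₂`,
the cokernel `𝓕₃` realises `T₂ − T₁`. -/
theorem RealisesTensor.shortExact_right {S : ShortComplex (pad4Anchor E₀).X.left.Modules} (hS : S.ShortExact)
    (h₁ : IsVectorBundle S.X₁) (h₃ : IsVectorBundle S.X₃) {T₁ T₂ : CWord → GaussianInt}
    (hT₁ : RealisesTensor C Φ S.X₁ T₁) (hT₂ : RealisesTensor C Φ S.X₂ T₂) : RealisesTensor C Φ S.X₃ (T₂ - T₁) :=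
  fun p => by rw [map_sub, ← hT₁ p, ← hT₂ p, C.ch_shortExact S hS h₁ h₃ p, add_sub_cancel_left]

/-- direct sums of vector bundles realise the sum of the tensors (`ch_biprod`). -/
theorem RealisesTensor.biprod {𝓕 𝓖 : (pad4Anchor E₀).X.left.Modules} (h𝓕 : IsVectorBundle 𝓕) (h𝓖 : IsVectorBundle 𝓖)
    {T T' : CWord → GaussianInt} (hT : RealisesTensor C Φ 𝓕 T) (hT' : RealisesTensor C Φ 𝓖 T') :
    RealisesTensor C Φ (𝓕 ⊞ 𝓖) (T + T') :=
  fun p => by rw [C.ch_biprod 𝓕 𝓖 h𝓕 h𝓖 p, hT p, hT' p, map_add]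

/-- **«`𝓝` HAS THE CHERN CHARACTER OF THE LETTER FAMILY `L` WITH MULTIPLICITIES `m` ON `s`»**: `ch_p(𝓝) = Σ_{Z ∈ s} m_Z ch_p(L_Z)`.
HOW `𝓝` was assembled from the letters — direct sum `⊕ L_Z^{⊕ m_Z}`, iterated extensions, or `m_Z` DISTINCT `Pic⁰`-twists
`⊕_j L_Z ⊗ α_j` — is NOT recorded: only the Chern character is (twist-blindness, `hasChOfLetters_of_copies`). -/
def HasChOfLetters (C : ChernCharacterBetti) (𝓝 : (pad4Anchor E₀).X.left.Modules) (s : Finset MCell) (m : MCell → ℤ)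
    (L : MCell → (pad4Anchor E₀).X.left.Modules) : Prop :=
  ∀ p : Fin 9, C.ch (pad4Anchor E₀).X 𝓝 p = ∑ Z ∈ s, m Z • C.ch (pad4Anchor E₀).X (L Z) p

/-- letters realising their cells, summed with multiplicities, realise the weighted tensor `Σ m_Z ch(Z)`. -/
theorem realisesTensor_of_hasChOfLetters {𝓝 : (pad4Anchor E₀).X.left.Modules} {s : Finset MCell} {m : MCell → ℤ}
    {L : MCell → (pad4Anchor E₀).X.left.Modules} (hN : HasChOfLetters C 𝓝 s m L)
    (hL : ∀ Z ∈ s, RealisesTensor C Φ (L Z) Z.ch) : RealisesTensor C Φ 𝓝 (∑ Z ∈ s, m Z • Z.ch) := by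
  intro p
  rw [hN p, map_sum]
  exact Finset.sum_congr rfl fun Z hZ => by rw [map_zsmul, hL Z hZ p]

/-- the `N`-bundle of a display realises `T_N(D)`. -/
theorem Design.realisesTensor_wchN (D : Design) {𝓝 : (pad4Anchor E₀).X.left.Modules}
    {L : MCell → (pad4Anchor E₀).X.left.Modules} (hN : HasChOfLetters C 𝓝 D.cfg.lower D.mN L)
    (hL : ∀ Z ∈ D.cfg.lower, RealisesTensor C Φ (L Z) Z.ch) : RealisesTensor C Φ 𝓝 D.wchN :=
  realisesTensor_of_hasChOfLetters hN hL

/-- the `P`-bundle of a display realises `T_P(D)`. -/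
theorem Design.realisesTensor_wchP (D : Design) {𝓟 : (pad4Anchor E₀).X.left.Modules}
    {L : MCell → (pad4Anchor E₀).X.left.Modules} (hP : HasChOfLetters C 𝓟 D.cfg.upper D.mP L)
    (hL : ∀ P ∈ D.cfg.upper, RealisesTensor C Φ (L P) P.ch) : RealisesTensor C Φ 𝓟 D.wchP :=
  realisesTensor_of_hasChOfLetters hP hL

/-! #### Twist-blindness -/

/-- **ch-EQUIVALENCE** of two sheaves on the anchor: the same Chern character in degrees `≤ 8`. THE CASE OF RECORD (MATH, not a
field of `ChernCharacterBetti`, hence a HYPOTHESIS here): `L' = L ⊗ α` with `α ∈ Pic⁰(S⁴)` — `c₁(α) = 0` in `H²(S⁴(ℂ); ℚ)` and `ch`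
is multiplicative, so `ch(L ⊗ α) = ch(L)·ch(α) = ch(L)`; likewise `At(L ⊗ α) = At(L)` in `H¹(Ω¹)`. Consequence: EVERY CLASS-SIDE
PREDICATE of this file (`RealisesTensor`, `HasChOfLetters`, `RealisedBy`, `CleanAtSeed`, (σ)) is blind to `Pic⁰`-twists of the
letters; twists are presentation data seen only by the `Hom`∕`Ext` pattern of the display (the bc5∕monad instruments Λ_pc, C3,
HALL) and by the object conjuncts C5–C7 evaluated on the realised `𝓔`∕`Z`. -/
def ChEquiv (C : ChernCharacterBetti) (L L' : (pad4Anchor E₀).X.left.Modules) : Prop :=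
  ∀ p : Fin 9, C.ch (pad4Anchor E₀).X L' p = C.ch (pad4Anchor E₀).X L p

theorem chEquiv_refl (L : (pad4Anchor E₀).X.left.Modules) : ChEquiv C L L := fun _ => rfl

theorem ChEquiv.symm {L L' : (pad4Anchor E₀).X.left.Modules} (e : ChEquiv C L L') : ChEquiv C L' L :=
  fun p => (e p).symm

theorem ChEquiv.trans {L L' L'' : (pad4Anchor E₀).X.left.Modules} (e : ChEquiv C L L') (e' : ChEquiv C L' L'') :
    ChEquiv C L L'' :=
  fun p => (e' p).trans (e p)

/-- isomorphic sheaves are ch-equivalent. -/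
theorem chEquiv_of_iso {L L' : (pad4Anchor E₀).X.left.Modules} (e : L ≅ L') : ChEquiv C L L' :=
  fun p => (C.ch_congr e p).symm

/-- **a ch-equivalent sheaf realises the same tensor** (twist-blindness of `RealisesTensor`). -/
theorem RealisesTensor.of_chEquiv {L L' : (pad4Anchor E₀).X.left.Modules} {T : CWord → GaussianInt}
    (hT : RealisesTensor C Φ L T) (e : ChEquiv C L L') : RealisesTensor C Φ L' T :=
  fun p => (e p).trans (hT p)

/-- **«`𝓝` HAS THE CHERN CHARACTER OF `n_Z` COPIES `L'_Z,0, …, L'_Z,n_Z−1` PER CELL»** (a display with twisted ∕ deformed copies: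
`ch_p(𝓝) = Σ_{Z ∈ s} Σ_{j < n_Z} ch_p(L'_{Z,j})`). -/
def HasChOfCopies (C : ChernCharacterBetti) (𝓝 : (pad4Anchor E₀).X.left.Modules) (s : Finset MCell) (n : MCell → ℕ)
    (L' : MCell → ℕ → (pad4Anchor E₀).X.left.Modules) : Prop :=
  ∀ p : Fin 9, C.ch (pad4Anchor E₀).X 𝓝 p = ∑ Z ∈ s, ∑ j ∈ Finset.range (n Z), C.ch (pad4Anchor E₀).X (L' Z j) p

/-- **TWIST-BLINDNESS OF THE LETTER COUNT**: if every copy `L'_{Z,j}` is ch-equivalent to the letter bundle `L_Z` (e.g. a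
`Pic⁰`-twist of it), then `𝓝` has the Chern character of the letters `L` with multiplicities `n` — a twisted copy counts as one
more copy of the same cell. -/
theorem hasChOfLetters_of_copies {𝓝 : (pad4Anchor E₀).X.left.Modules} {s : Finset MCell} {n : MCell → ℕ}
    {L' : MCell → ℕ → (pad4Anchor E₀).X.left.Modules} {L : MCell → (pad4Anchor E₀).X.left.Modules}
    (hN : HasChOfCopies C 𝓝 s n L') (hL : ∀ Z ∈ s, ∀ j ∈ Finset.range (n Z), ChEquiv C (L Z) (L' Z j)) :
    HasChOfLetters C 𝓝 s (fun Z => (n Z : ℤ)) L := by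
  intro p
  rw [hN p]
  refine Finset.sum_congr rfl fun Z hZ => ?_
  rw [Finset.sum_congr rfl fun j hj => hL Z hZ j hj p, Finset.sum_const, Finset.card_range, natCast_zsmul]

/-- the smallest instance, to show the bookkeeping predicates are dischargeable from the tree's `ch_biprod`: the direct sum of
two letter bundles has the Chern character of the two letters with multiplicity one. -/
theorem hasChOfLetters_pair {Z₁ Z₂ : MCell} (hne : Z₁ ≠ Z₂) {L : MCell → (pad4Anchor E₀).X.left.Modules}
    (h₁ : IsVectorBundle (L Z₁)) (h₂ : IsVectorBundle (L Z₂)) :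
    HasChOfLetters C (L Z₁ ⊞ L Z₂) {Z₁, Z₂} (fun _ => 1) L :=
  fun p => by rw [C.ch_biprod _ _ h₁ h₂ p, Finset.sum_pair hne, one_zsmul, one_zsmul]

/-- … and the direct sum of two (possibly differently twisted) copies `L'_{Z,0} ⊞ L'_{Z,1}` of one cell has the Chern character
of two copies. -/
theorem hasChOfCopies_pair {Z : MCell} {L' : MCell → ℕ → (pad4Anchor E₀).X.left.Modules}
    (h₀ : IsVectorBundle (L' Z 0)) (h₁ : IsVectorBundle (L' Z 1)) :
    HasChOfCopies C (L' Z 0 ⊞ L' Z 1) {Z} (fun _ => 2) L' :=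
  fun p => by rw [C.ch_biprod _ _ h₀ h₁ p, Finset.sum_singleton, Finset.sum_range_succ, Finset.sum_range_one]

end Realisation

/-! ### §6.4 Presentations ⟹ `RealisedBy` (kernel ∕ cokernel ∕ monad); the letter kit; the word kit; the sheaf door end-to-end -/

section Presentations

variable {E₀ : AbelianVariety ℂ} {ψ₀ : E₀ ⟶ E₀} {C : ChernCharacterBetti} {Φ : WordFrame E₀} {D : Design}
  {𝓔 : (pad4Anchor E₀).X.left.Modules}

/-- **A KERNEL PRESENTATION of `𝓔` by the design `D`** (the DOWN display `0 → 𝓔 → 𝓝 → 𝓟 → 0`: `𝓔 = ker(𝓝 ↠ 𝓟)`): a short exact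
sequence of `𝒪_{S⁴}`-modules with `𝓔 ≅` its kernel, kernel and cokernel VECTOR BUNDLES (what `ch_shortExact` consumes), the
middle term realising `T_N(D)` and the right term realising `T_P(D)` (e.g. via `Design.realisesTensor_wchN ∕ _wchP` from a
`LetterKit` and `HasChOfLetters`; the maps of the display, their ranks and degeneracy loci are the presenter's business — this
structure records only what the class side reads). -/
structure KernelPresentation (C : ChernCharacterBetti) (Φ : WordFrame E₀) (D : Design)
    (𝓔 : (pad4Anchor E₀).X.left.Modules) where
  /-- `0 → 𝓔' → 𝓝 → 𝓟 → 0` -/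
  S : ShortComplex (pad4Anchor E₀).X.left.Modules
  shortExact : S.ShortExact
  /-- `𝓔' ≅ 𝓔` -/
  iso : S.X₁ ≅ 𝓔
  isVectorBundle₁ : IsVectorBundle S.X₁
  isVectorBundle₃ : IsVectorBundle S.X₃
  /-- `𝓝` realises `T_N(D)` -/
  realisesN : RealisesTensor C Φ S.X₂ D.wchN
  /-- `𝓟` realises `T_P(D)` -/
  realisesP : RealisesTensor C Φ S.X₃ D.wchP

/-- a kernel presentation realises `T(D) = T_N − T_P`. -/
theorem KernelPresentation.realisesTensor (π : KernelPresentation C Φ D 𝓔) : RealisesTensor C Φ 𝓔 D.wch := by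
  rw [Design.wch_eq_wchN_sub_wchP]
  exact (RealisesTensor.shortExact_left π.shortExact π.isVectorBundle₁ π.isVectorBundle₃ π.realisesN π.realisesP).congr_iso
    π.iso

/-- **(A1@Z) FROM EXACTNESS, kernel door: a kernel presentation of an (A1)-clean design realises the design.** -/
theorem KernelPresentation.realisedBy {F : WeilFrame E₀ ψ₀} {h : complexBetti (pad4Anchor E₀).X 2}
    (π : KernelPresentation C Φ D 𝓔) (hΦ : Φ.LinksTo F h) (hD : D.Clean) : D.RealisedBy C F h 𝓔 :=
  Design.realisedBy_of_realisesTensor hΦ hD π.realisesTensor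

/-- **A COKERNEL PRESENTATION of `𝓔` by `D`** (the UP display `0 → 𝓟 → 𝓝 → 𝓔 → 0`: `𝓔 = coker(𝓟 ↪ 𝓝)`; same `K⁰`-class
`[𝓝] − [𝓟]`). `𝓟` and `𝓔'` must be vector bundles. -/
structure CokernelPresentation (C : ChernCharacterBetti) (Φ : WordFrame E₀) (D : Design)
    (𝓔 : (pad4Anchor E₀).X.left.Modules) where
  /-- `0 → 𝓟 → 𝓝 → 𝓔' → 0` -/
  S : ShortComplex (pad4Anchor E₀).X.left.Modules
  shortExact : S.ShortExact
  /-- `𝓔' ≅ 𝓔` -/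
  iso : S.X₃ ≅ 𝓔
  isVectorBundle₁ : IsVectorBundle S.X₁
  isVectorBundle₃ : IsVectorBundle S.X₃
  /-- `𝓟` realises `T_P(D)` -/
  realisesP : RealisesTensor C Φ S.X₁ D.wchP
  /-- `𝓝` realises `T_N(D)` -/
  realisesN : RealisesTensor C Φ S.X₂ D.wchN

theorem CokernelPresentation.realisesTensor (π : CokernelPresentation C Φ D 𝓔) : RealisesTensor C Φ 𝓔 D.wch := by
  rw [Design.wch_eq_wchN_sub_wchP]
  exact (RealisesTensor.shortExact_right π.shortExact π.isVectorBundle₁ π.isVectorBundle₃ π.realisesP π.realisesN).congr_iso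
    π.iso

/-- **(A1@Z) FROM EXACTNESS, cokernel door.** -/
theorem CokernelPresentation.realisedBy {F : WeilFrame E₀ ψ₀} {h : complexBetti (pad4Anchor E₀).X 2}
    (π : CokernelPresentation C Φ D 𝓔) (hΦ : Φ.LinksTo F h) (hD : D.Clean) : D.RealisedBy C F h 𝓔 :=
  Design.realisedBy_of_realisesTensor hΦ hD π.realisesTensor

/-- **A MONAD PRESENTATION of `𝓔` by `D`** (`𝓐 ↪ 𝓑 ↠ 𝓒`, `𝓔 = ker(b) ∕ im(a)`), as the two short exact sequences
`0 → 𝓚 → 𝓑 → 𝓒 → 0` and `0 → 𝓐 → 𝓚 → 𝓔 → 0`, with the side tensors `T_A`, `T_B`, `T_C` the three terms realise and the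
bookkeeping identity `T_B − T_C − T_A = T(D)` (how the design's cells are distributed over `𝓐`, `𝓑`, `𝓒` — the json's `"split"`
key — is presentation data; only this identity is read). Vector-bundle hypotheses where `ch_shortExact` needs them. -/
structure MonadPresentation (C : ChernCharacterBetti) (Φ : WordFrame E₀) (D : Design)
    (𝓔 : (pad4Anchor E₀).X.left.Modules) where
  /-- `0 → 𝓚 → 𝓑 → 𝓒 → 0` (`𝓚 = ker b`) -/
  S₁ : ShortComplex (pad4Anchor E₀).X.left.Modules
  /-- `0 → 𝓐 → 𝓚' → 𝓔' → 0` (`𝓔' = 𝓚' ∕ 𝓐`) -/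
  S₂ : ShortComplex (pad4Anchor E₀).X.left.Modules
  shortExact₁ : S₁.ShortExact
  shortExact₂ : S₂.ShortExact
  /-- `𝓚 ≅ 𝓚'` -/
  isoK : S₁.X₁ ≅ S₂.X₂
  /-- `𝓔' ≅ 𝓔` -/
  iso : S₂.X₃ ≅ 𝓔
  isVectorBundleK : IsVectorBundle S₁.X₁
  isVectorBundleC : IsVectorBundle S₁.X₃
  isVectorBundleA : IsVectorBundle S₂.X₁
  isVectorBundleE : IsVectorBundle S₂.X₃
  /-- the side tensors -/
  TA : CWord → GaussianInt
  TB : CWord → GaussianInt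
  TC : CWord → GaussianInt
  realisesA : RealisesTensor C Φ S₂.X₁ TA
  realisesB : RealisesTensor C Φ S₁.X₂ TB
  realisesC : RealisesTensor C Φ S₁.X₃ TC
  /-- `[𝓔] = [𝓑] − [𝓒] − [𝓐]` names `T(D)` -/
  tensor_eq : TB - TC - TA = D.wch

theorem MonadPresentation.realisesTensor (π : MonadPresentation C Φ D 𝓔) : RealisesTensor C Φ 𝓔 D.wch := by
  have hK : RealisesTensor C Φ π.S₂.X₂ (π.TB - π.TC) :=
    (RealisesTensor.shortExact_left π.shortExact₁ π.isVectorBundleK π.isVectorBundleC π.realisesB π.realisesC).congr_iso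
      π.isoK
  rw [← π.tensor_eq]
  exact (RealisesTensor.shortExact_right π.shortExact₂ π.isVectorBundleA π.isVectorBundleE π.realisesA hK).congr_iso π.iso

/-- **(A1@Z) FROM EXACTNESS, monad door.** -/
theorem MonadPresentation.realisedBy {F : WeilFrame E₀ ψ₀} {h : complexBetti (pad4Anchor E₀).X 2}
    (π : MonadPresentation C Φ D 𝓔) (hΦ : Φ.LinksTo F h) (hD : D.Clean) : D.RealisedBy C F h 𝓔 :=
  Design.realisedBy_of_realisesTensor hΦ hD π.realisesTensor

/-- **THE LETTER KIT on a set of cells `s`** (obligation O-cells — a CONSTRUCTION, not asserted: for each cell `Z ∈ s` a line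
bundle `L_Z` on `S⁴` — rank `≤ 1`, so a vector bundle with `ch(L_Z) = exp c₁(L_Z)` by `ch_of_hasRankLE_one` — realising the
cell's tensor `ch(Z)` in the word frame; intended instance: `L_Z = ⊠_f L(Z_f)`, `L(α, β)` the line bundle on `E₀ × E₀` with
`c₁ = α(u + v) + β e + β̄ ē`). Design-dependent only through the finitely many cells of the support. -/
structure LetterKit (C : ChernCharacterBetti) (Φ : WordFrame E₀) (s : Finset MCell) where
  /-- the letter bundles -/
  L : MCell → (pad4Anchor E₀).X.left.Modules
  rankLEOne : ∀ Z ∈ s, HasRankLE (L Z) 1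
  realises : ∀ Z ∈ s, RealisesTensor C Φ (L Z) Z.ch

theorem LetterKit.isVectorBundle {s : Finset MCell} (k : LetterKit C Φ s) {Z : MCell} (hZ : Z ∈ s) :
    IsVectorBundle (k.L Z) :=
  (k.rankLEOne Z hZ).isVectorBundle

/-- with a letter kit on the `N`-cells, any `𝓝` with the letters' Chern character (multiplicities `m_N`) realises `T_N(D)`. -/
theorem LetterKit.realisesTensor_wchN (k : LetterKit C Φ D.cfg.lower) {𝓝 : (pad4Anchor E₀).X.left.Modules}
    (hN : HasChOfLetters C 𝓝 D.cfg.lower D.mN k.L) : RealisesTensor C Φ 𝓝 D.wchN :=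
  D.realisesTensor_wchN hN k.realises

/-- with a letter kit on the `P`-cells, any `𝓟` with the letters' Chern character (multiplicities `m_P`) realises `T_P(D)`. -/
theorem LetterKit.realisesTensor_wchP (k : LetterKit C Φ D.cfg.upper) {𝓟 : (pad4Anchor E₀).X.left.Modules}
    (hP : HasChOfLetters C 𝓟 D.cfg.upper D.mP k.L) : RealisesTensor C Φ 𝓟 D.wchP :=
  D.realisesTensor_wchP hP k.realises

/-- **A KERNEL PRESENTATION ASSEMBLED FROM ITS THREE INGREDIENTS** — the display's short exact sequence with vector-bundle ends
(OBJECT, the presenter's), letter kits on the `N`- and `P`-cells (O-cells), and the Chern-character bookkeeping of `𝓝`, `𝓟` against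
the letters with the design's multiplicities (twist-blind). -/
def KernelPresentation.ofLetters {S : ShortComplex (pad4Anchor E₀).X.left.Modules} (hS : S.ShortExact) (e : S.X₁ ≅ 𝓔)
    (h₁ : IsVectorBundle S.X₁) (h₃ : IsVectorBundle S.X₃) (kN : LetterKit C Φ D.cfg.lower) (kP : LetterKit C Φ D.cfg.upper)
    (hN : HasChOfLetters C S.X₂ D.cfg.lower D.mN kN.L) (hP : HasChOfLetters C S.X₃ D.cfg.upper D.mP kP.L) :
    KernelPresentation C Φ D 𝓔 :=
  ⟨S, hS, e, h₁, h₃, kN.realisesTensor_wchN hN, kP.realisesTensor_wchP hP⟩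

/-- the cokernel twin. -/
def CokernelPresentation.ofLetters {S : ShortComplex (pad4Anchor E₀).X.left.Modules} (hS : S.ShortExact) (e : S.X₃ ≅ 𝓔)
    (h₁ : IsVectorBundle S.X₁) (h₃ : IsVectorBundle S.X₃) (kP : LetterKit C Φ D.cfg.upper) (kN : LetterKit C Φ D.cfg.lower)
    (hP : HasChOfLetters C S.X₁ D.cfg.upper D.mP kP.L) (hN : HasChOfLetters C S.X₂ D.cfg.lower D.mN kN.L) :
    CokernelPresentation C Φ D 𝓔 :=
  ⟨S, hS, e, h₁, h₃, kP.realisesTensor_wchP hP, kN.realisesTensor_wchN hN⟩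

/-- **THE WORD KIT of `(E₀, ψ₀)`** = the anchor kit (§4: `η`, Weil frame, polarisation, hyperbolicity) + a word frame LINKED to
`(h_std, r₁, r₂)` (O-WF). Design-independent, once per anchor; a structure (data), NOT constructed here. -/
structure WordKit (E₀ : AbelianVariety ℂ) (ψ₀ : E₀ ⟶ E₀) where
  /-- O-W, O-pol, O-hyp -/
  kit : AnchorKit E₀ ψ₀
  /-- O-WF -/
  Φ : WordFrame E₀
  links : Φ.LinksTo kit.F (hStd E₀ kit.η)

/-- **THE SHEAF DOOR END-TO-END FROM A PRESENTATION**: a kernel presentation of a design passing C0′ (`Clean ∧ μ ≠ 0`) by a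
finite locally free, `I`-semiregular `𝓔` (`4 ∈ I ⊆ {0..8}`) passes the rank-free sheaf-seed checker of §5.3 — hence gives the
tree's `HasHyperbolicBFSheafSeedOn C 4 1 I` (`hasHyperbolicBFSheafSeedOn_of_sheafSeedCheckRankFree`). The (A1@Z) conjunct is
DISCHARGED by exactness; what remains object-side is C5 (locally free) and C7 (semiregular). -/
theorem Design.sheafSeedCheckRankFree_of_kernelPresentation (W : WordKit E₀ ψ₀) (π : KernelPresentation C W.Φ D 𝓔)
    (hC0 : D.ClassDataRankFree) {I : Finset ℕ} (h4 : 4 ∈ I) (hI : ∀ p ∈ I, p ≤ 8) (h𝓔 : IsFiniteLocallyFree 𝓔)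
    (hsr : IsISemiregular h𝓔 {q' | q' + 1 ∈ I}) : D.SheafSeedCheckRankFree C I W.kit 𝓔 :=
  ⟨hC0, h4, hI, ⟨h𝓔, hsr⟩, π.realisedBy W.links hC0.1⟩

theorem Design.sheafSeedCheckRankFree_of_cokernelPresentation (W : WordKit E₀ ψ₀) (π : CokernelPresentation C W.Φ D 𝓔)
    (hC0 : D.ClassDataRankFree) {I : Finset ℕ} (h4 : 4 ∈ I) (hI : ∀ p ∈ I, p ≤ 8) (h𝓔 : IsFiniteLocallyFree 𝓔)
    (hsr : IsISemiregular h𝓔 {q' | q' + 1 ∈ I}) : D.SheafSeedCheckRankFree C I W.kit 𝓔 :=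
  ⟨hC0, h4, hI, ⟨h𝓔, hsr⟩, π.realisedBy W.links hC0.1⟩

theorem Design.sheafSeedCheckRankFree_of_monadPresentation (W : WordKit E₀ ψ₀) (π : MonadPresentation C W.Φ D 𝓔)
    (hC0 : D.ClassDataRankFree) {I : Finset ℕ} (h4 : 4 ∈ I) (hI : ∀ p ∈ I, p ≤ 8) (h𝓔 : IsFiniteLocallyFree 𝓔)
    (hsr : IsISemiregular h𝓔 {q' | q' + 1 ∈ I}) : D.SheafSeedCheckRankFree C I W.kit 𝓔 :=
  ⟨hC0, h4, hI, ⟨h𝓔, hsr⟩, π.realisedBy W.links hC0.1⟩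

/-- … and therefore the tree's one-model sheaf seed `HasHyperbolicBFSheafSeedOn C 4 1 I` (kernel door; the other two alike). -/
theorem hasHyperbolicBFSheafSeedOn_of_kernelPresentation (hE : E₀.dim = 1) (hψ : ψ₀ ≫ ψ₀ = -(1 • 𝟙 E₀))
    (W : WordKit E₀ ψ₀) (π : KernelPresentation C W.Φ D 𝓔) (hC0 : D.ClassDataRankFree) {I : Finset ℕ} (h4 : 4 ∈ I)
    (hI : ∀ p ∈ I, p ≤ 8) (h𝓔 : IsFiniteLocallyFree 𝓔) (hsr : IsISemiregular h𝓔 {q' | q' + 1 ∈ I}) :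
    HasHyperbolicBFSheafSeedOn C 4 1 I :=
  hasHyperbolicBFSheafSeedOn_of_sheafSeedCheckRankFree hE hψ
    (D.sheafSeedCheckRankFree_of_kernelPresentation W π hC0 h4 hI h𝓔 hsr)

end Presentations

end VThree

/-! ## §7 v4 (g3, 2026-08-29) — ADDITIVE: the twist `D(t)` and partner coverage (json); Chern classes from `ch` by Newton on the carrier,
the `W`-coordinate of `c₄`, zero schemes and the top-Chern-class localisation law — the (σ) object half, typed. No declaration of §1–§6 is changed. -/

section VFour

/-! ### §7.1 JSON side: the twist `D(t)` — cells `(α, β) ↦ (α + t, β)` on every factor (`𝓔 ↦ 𝓔(tH)`, `H = Σ_f pr_f^* x₀`) -/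

section JsonSideVFour

/-- the twist by `t` on a factor point: `(α, Re β, Im β) ↦ (α + t, Re β, Im β)` (the factor line bundle `⊗ 𝒪(t·x₀)`: `α ↦ α + t`,
`β` fixed). -/
def twPt (t : ℤ) (x : BPoint) : BPoint := (x.1 + t, x.2.1, x.2.2)

theorem twPt_neg_twPt (t : ℤ) (x : BPoint) : twPt (-t) (twPt t x) = x := by
  obtain ⟨a, b, c⟩ := x
  simp [twPt]

/-- the twist on cells (factor by factor). -/
def MCell.tw (t : ℤ) (Z : MCell) : MCell := fun f => twPt t (Z f)

theorem MCell.tw_neg_tw (t : ℤ) (Z : MCell) : MCell.tw (-t) (MCell.tw t Z) = Z :=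
  funext fun f => twPt_neg_twPt t (Z f)

theorem MCell.tw_injective (t : ℤ) : Function.Injective (MCell.tw t) := fun Z Z' h => by
  simpa only [MCell.tw_neg_tw] using congrArg (MCell.tw (-t)) h

/-- the twist as an embedding of cells. -/
def MCell.twEmb (t : ℤ) : MCell ↪ MCell := ⟨MCell.tw t, MCell.tw_injective t⟩

@[simp] theorem MCell.twEmb_apply (t : ℤ) (Z : MCell) : MCell.twEmb t Z = MCell.tw t Z := rfl

/-- differences are twist-invariant … -/
theorem bsub_twPt (t : ℤ) (x y : BPoint) : bsub (twPt t x) (twPt t y) = bsub x y := by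
  obtain ⟨a, b, c⟩ := x; obtain ⟨a', b', c'⟩ := y
  show (a + t - (a' + t), b - b', c - c') = (a - a', b - b', c - c')
  rw [add_sub_add_right_eq_sub]

/-- … so the effective order `P ≤ Z` (`MCell.le`: `Hom(L_P, L_Z) ≠ 0`) is twist-invariant. -/
theorem MCell.le_tw_iff (t : ℤ) (P Z : MCell) : MCell.le (MCell.tw t P) (MCell.tw t Z) ↔ MCell.le P Z := by
  simp only [MCell.le, MCell.tw, bsub_twPt]

/-- **THE LETTER OPERATOR `M_t` OF THE TWIST**: `φ(x + t) = M_t · φ(x)` on letter vectors `(1, α, α, β, β̄, α² − |β|²)` — rows: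
`1 ↦ 1`, `u ↦ u + t·1`, `v ↦ v + t·1`, `e ↦ e`, `ē ↦ ē`, `p ↦ p + t·u + t·v + t²·1`. -/
def twKer (t : ℤ) : Fin 6 → Fin 6 → ℤ :=
  ![![1, 0, 0, 0, 0, 0], ![t, 1, 0, 0, 0, 0], ![t, 0, 1, 0, 0, 0], ![0, 0, 0, 1, 0, 0], ![0, 0, 0, 0, 1, 0],
    ![t ^ 2, t, t, 0, 0, 1]]

/-- **`φ(x + t)_l = Σ_{l'} M_t(l, l') φ(x)_{l'}`.** -/
theorem bphi_twPt (t : ℤ) (x : BPoint) (l : Fin 6) :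
    bphi (twPt t x) l = ∑ l', ((twKer t l l' : ℤ) : GaussianInt) * bphi x l' := by
  obtain ⟨a, b, c⟩ := x
  fin_cases l <;> simp [bphi, phiVec, twPt, twKer, Fin.sum_univ_succ] <;> ring

/-- **THE INDUCED OPERATOR `M_t^{⊗4}` ON CLASS FUNCTIONS**: `(M_t^{⊗4} T)(w) = Σ_{w'} (Π_f M_t(w_f, w'_f)) · T(w')` (`ℤ[i]`-linear). -/
def twOp (t : ℤ) : (CWord → GaussianInt) →ₗ[GaussianInt] (CWord → GaussianInt) where
  toFun T w := ∑ w' : CWord, ((∏ f, twKer t (w f) (w' f) : ℤ) : GaussianInt) * T w'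
  map_add' T T' := by
    funext w
    simp only [Pi.add_apply, mul_add, Finset.sum_add_distrib]
  map_smul' c T := by
    funext w
    simp only [Pi.smul_apply, smul_eq_mul, RingHom.id_apply, Finset.mul_sum]
    exact Finset.sum_congr rfl fun _ _ => by ring

theorem twOp_apply (t : ℤ) (T : CWord → GaussianInt) (w : CWord) :
    twOp t T w = ∑ w' : CWord, ((∏ f, twKer t (w f) (w' f) : ℤ) : GaussianInt) * T w' :=
  rfl

theorem chTensor_eq_prod {R : Type*} [CommRing R] (v : Fin 4 → Fin 6 → R) (w : CWord) :
    chTensor v w = ∏ f, v f (w f) := by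
  simp [chTensor, Fin.prod_univ_four]

/-- **THE CLASS TWIST LAW `ch(Z + t) = M_t^{⊗4} ch(Z)`** (kernel, factor by factor from `bphi_twPt`). -/
theorem MCell.ch_tw (t : ℤ) (Z : MCell) : (MCell.tw t Z).ch = twOp t Z.ch := by
  funext w
  rw [twOp_apply]
  simp only [MCell.ch, chTensor_eq_prod, MCell.tw, bphi_twPt]
  rw [Finset.prod_univ_sum, Fintype.piFinset_univ]
  refine Finset.sum_congr rfl fun w' _ => ?_
  rw [Int.cast_prod, ← Finset.prod_mul_distrib]

theorem eWord_apply (f : Fin 4) : eWord f = 3 := by fin_cases f <;> rfl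
theorem ebarWord_apply (f : Fin 4) : ebarWord f = 4 := by fin_cases f <;> rfl
theorem rankWord_apply (f : Fin 4) : Design.rankWord f = 0 := by fin_cases f <;> rfl

/-- the rows `e`, `ē`, `1` and the columns `e`, `ē` of `M_t` are unit vectors. -/
theorem twKer_row_three (t : ℤ) (l : Fin 6) : twKer t 3 l = if l = 3 then 1 else 0 := by fin_cases l <;> rfl
theorem twKer_row_four (t : ℤ) (l : Fin 6) : twKer t 4 l = if l = 4 then 1 else 0 := by fin_cases l <;> rfl
theorem twKer_row_zero (t : ℤ) (l : Fin 6) : twKer t 0 l = if l = 0 then 1 else 0 := by fin_cases l <;> rfl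
theorem twKer_col_three (t : ℤ) (l : Fin 6) : twKer t l 3 = if l = 3 then 1 else 0 := by fin_cases l <;> rfl
theorem twKer_col_four (t : ℤ) (l : Fin 6) : twKer t l 4 = if l = 4 then 1 else 0 := by fin_cases l <;> rfl

/-- a unit row `l₀` of `M_t`: `(M_t^{⊗4} T)` at the constant word `l₀l₀l₀l₀` is `T` there. -/
private theorem twOp_apply_const_of_row (t : ℤ) {l₀ : Fin 6} (hrow : ∀ l, twKer t l₀ l = if l = l₀ then 1 else 0)
    (T : CWord → GaussianInt) {w₀ : CWord} (hw₀ : ∀ f, w₀ f = l₀) : twOp t T w₀ = T w₀ := by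
  rw [twOp_apply, Finset.sum_eq_single w₀]
  · simp [hw₀, hrow]
  · intro w' _ hw'
    obtain ⟨f, hf⟩ : ∃ f, w' f ≠ l₀ := by
      by_contra h
      push Not at h
      exact hw' (funext fun f => by rw [h f, hw₀ f])
    rw [Finset.prod_eq_zero (Finset.mem_univ f) (by rw [hw₀ f, hrow, if_neg hf]), Int.cast_zero, zero_mul]
  · simp

/-- **`μ`, `μ̄` and the rank are twist-invariant** on class functions: `M_t^{⊗4}` fixes the coefficients of `eeee`, `ēēēē`, `1111`. -/
theorem twOp_apply_eWord (t : ℤ) (T : CWord → GaussianInt) : twOp t T eWord = T eWord :=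
  twOp_apply_const_of_row t (twKer_row_three t) T eWord_apply

theorem twOp_apply_ebarWord (t : ℤ) (T : CWord → GaussianInt) : twOp t T ebarWord = T ebarWord :=
  twOp_apply_const_of_row t (twKer_row_four t) T ebarWord_apply

theorem twOp_apply_rankWord (t : ℤ) (T : CWord → GaussianInt) : twOp t T Design.rankWord = T Design.rankWord :=
  twOp_apply_const_of_row t (twKer_row_zero t) T rankWord_apply

/-- a unit column `l₀` of `M_t`: `M_t^{⊗4}` fixes the word function of `l₀l₀l₀l₀`. -/
private theorem twOp_wordFn_of_col (t : ℤ) {l₀ : Fin 6} (hcol : ∀ l, twKer t l l₀ = if l = l₀ then 1 else 0)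
    {w₀ : CWord} (hw₀ : ∀ f, w₀ f = l₀) : twOp t (wordFn w₀) = wordFn w₀ := by
  funext w
  rw [twOp_apply, Finset.sum_eq_single w₀]
  · by_cases hw : w = w₀
    · subst hw
      simp [wordFn, hw₀, hcol]
    · obtain ⟨f, hf⟩ : ∃ f, w f ≠ l₀ := by
        by_contra h
        push Not at h
        exact hw (funext fun f => by rw [h f, hw₀ f])
      rw [Finset.prod_eq_zero (Finset.mem_univ f) (by rw [hw₀ f, hcol, if_neg hf]), Int.cast_zero, zero_mul]
      simp [wordFn, hw]
  · intro w' _ hw'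
    simp [wordFn, hw']
  · simp

theorem twOp_wordFn_eWord (t : ℤ) : twOp t (wordFn eWord) = wordFn eWord :=
  twOp_wordFn_of_col t (twKer_col_three t) eWord_apply

theorem twOp_wordFn_ebarWord (t : ℤ) : twOp t (wordFn ebarWord) = wordFn ebarWord :=
  twOp_wordFn_of_col t (twKer_col_four t) ebarWord_apply

/-! #### The generating function of `M_t`: `Σ_{l' e-free} M_t(l, l') X^{deg l'} = (X + t)^{deg l}` for e-free `l` -/

open Polynomial in
/-- the letter generating polynomial of row `l` of `M_t` over the e-free letters. -/
def twPoly (t : ℤ) (l : Fin 6) : ℤ[X] :=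
  ∑ l' : Fin 6, if l' ≠ 3 ∧ l' ≠ 4 then C (twKer t l l') * X ^ ldeg l' else 0

open Polynomial in
/-- **`Σ_{l' e-free} M_t(l, l') X^{deg l'} = (X + t)^{deg l}`** for e-free `l`, and `0` for `l = e, ē`. -/
theorem twPoly_eq (t : ℤ) (l : Fin 6) : twPoly t l = if l ≠ 3 ∧ l ≠ 4 then (X + C t) ^ ldeg l else 0 := by
  fin_cases l <;> simp [twPoly, twKer, ldeg, Fin.sum_univ_succ] <;> ring

open Polynomial in
/-- the four-factor generating function: `Σ_{w'} (Π_f M_t(w_f, w'_f)) · [w' e-free] X^{deg w'} = Π_f twPoly(w_f)`. -/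
theorem sum_twKer_monomial (t : ℤ) (w : CWord) :
    (∑ w' : CWord, if EFree w' then C (∏ f, twKer t (w f) (w' f)) * X ^ wdeg w' else 0) = ∏ f, twPoly t (w f) := by
  simp only [twPoly]
  rw [Finset.prod_univ_sum, Fintype.piFinset_univ]
  refine Finset.sum_congr rfl fun w' _ => ?_
  rw [Fintype.prod_ite_zero]
  by_cases hw' : EFree w'
  · rw [if_pos hw', if_pos hw', Finset.prod_mul_distrib, map_prod, Finset.prod_pow_eq_pow_sum]
    simp [wdeg, Fin.sum_univ_four]
  · rw [if_neg hw', if_neg hw']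

open Polynomial in
/-- **THE TWIST OF `h^k∕k!`**: `(M_t^{⊗4} ĥ_k)(w) = [w e-free] · C(deg w, k) · t^{deg w − k}` (the coefficient of `X^k` in
`(X + t)^{deg w}`; zero for `k > deg w`). Over `ℤ`. -/
theorem sum_twKer_hHat (t : ℤ) (k : ℕ) (w : CWord) :
    (∑ w' : CWord, (∏ f, twKer t (w f) (w' f)) * (hHat k w' : ℤ)) =
      if EFree w then t ^ (wdeg w - k) * (wdeg w).choose k else 0 := by
  have key := congrArg (fun P : ℤ[X] => P.coeff k) (sum_twKer_monomial t w)
  simp only [finsetSum_coeff] at key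
  have lhs : ∀ w' : CWord, (if EFree w' then C (∏ f, twKer t (w f) (w' f)) * X ^ wdeg w' else 0 : ℤ[X]).coeff k =
      (∏ f, twKer t (w f) (w' f)) * (hHat k w' : ℤ) := by
    intro w'
    by_cases hw' : EFree w'
    · rw [if_pos hw', coeff_C_mul_X_pow]
      by_cases hk : wdeg w' = k
      · simp [hHat, hw', hk]
      · rw [if_neg (Ne.symm hk)]
        simp [hHat, hk]
    · simp [hHat, hw']
  simp only [lhs] at key
  rw [key]
  by_cases hw : EFree w
  · have hprod : (∏ f, twPoly t (w f)) = (X + C t) ^ wdeg w := by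
      simp only [twPoly_eq]
      rw [Fintype.prod_ite_zero, if_pos (fun f => hw f), Finset.prod_pow_eq_pow_sum]
      simp [wdeg, Fin.sum_univ_four]
    rw [hprod, coeff_X_add_C_pow, if_pos hw]
  · obtain ⟨f, hf⟩ : ∃ f, ¬ (w f ≠ 3 ∧ w f ≠ 4) := by
      by_contra h
      push Not at h
      exact hw fun f => h f
    rw [Finset.prod_eq_zero (Finset.mem_univ f) (by rw [twPoly_eq, if_neg hf]), coeff_zero, if_neg hw]

theorem intCast_hHat (k : ℕ) (w : CWord) : (((hHat k w : ℤ)) : GaussianInt) = hHat k w := by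
  by_cases h : EFree w ∧ wdeg w = k <;> simp [hHat, h]

/-- … over `ℤ[i]`: `M_t^{⊗4} ĥ_k = Σ_j C(j, k) t^{j−k} ĥ_j`, pointwise. -/
theorem twOp_hHat_apply (t : ℤ) (k : ℕ) (w : CWord) :
    twOp t (hHat k) w = if EFree w then (t : GaussianInt) ^ (wdeg w - k) * (((wdeg w).choose k : ℕ) : GaussianInt) else 0 := by
  rw [twOp_apply]
  have h := congrArg (fun z : ℤ => (z : GaussianInt)) (sum_twKer_hHat t k w)
  simp only [Int.cast_sum, Int.cast_mul, Int.cast_ite, Int.cast_zero, Int.cast_pow, Int.cast_natCast, intCast_hHat] at h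
  exact h

/-! #### (A1) is twist-invariant -/

theorem classScreen_zero' : ClassScreen (0 : CWord → GaussianInt) :=
  ⟨fun _ _ _ _ => rfl, fun _ _ _ _ _ => rfl⟩

theorem classScreen_smul' {T : CWord → GaussianInt} (hT : ClassScreen T) (c : GaussianInt) : ClassScreen (c • T) :=
  ⟨fun w h1 h2 h3 => by simp [hT.1 w h1 h2 h3], fun w w' hw hw' hd => by simp [hT.2 w w' hw hw' hd]⟩

theorem classScreen_sum' {ι : Type*} (s : Finset ι) {T : ι → CWord → GaussianInt} (hT : ∀ i ∈ s, ClassScreen (T i)) :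
    ClassScreen (∑ i ∈ s, T i) := by
  classical
  induction s using Finset.induction_on with
  | empty => simpa using classScreen_zero'
  | insert a s ha ih =>
    rw [Finset.sum_insert ha]
    exact classScreen_add (hT a (Finset.mem_insert_self a s)) (ih fun i hi => hT i (Finset.mem_insert_of_mem hi))

theorem classScreen_wordFn_eWord : ClassScreen (wordFn eWord : CWord → GaussianInt) :=
  ⟨fun w _ h2 _ => by simp [wordFn, h2], fun w w' hw hw' _ => by
    have h1 : w ≠ eWord := fun h => not_eFree_eWord.1 (h ▸ hw)
    have h1' : w' ≠ eWord := fun h => not_eFree_eWord.1 (h ▸ hw')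
    simp [wordFn, h1, h1']⟩

theorem classScreen_wordFn_ebarWord : ClassScreen (wordFn ebarWord : CWord → GaussianInt) :=
  ⟨fun w _ _ h3 => by simp [wordFn, h3], fun w w' hw hw' _ => by
    have h1 : w ≠ ebarWord := fun h => not_eFree_eWord.2.1 (h ▸ hw)
    have h1' : w' ≠ ebarWord := fun h => not_eFree_eWord.2.1 (h ▸ hw')
    simp [wordFn, h1, h1']⟩

theorem classScreen_twOp_hHat (t : ℤ) (k : ℕ) : ClassScreen (twOp t (hHat k : CWord → GaussianInt)) :=
  ⟨fun w h1 _ _ => by rw [twOp_hHat_apply, if_neg h1], fun w w' hw hw' hd => by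
    rw [twOp_hHat_apply, twOp_hHat_apply, if_pos hw, if_pos hw', hd]⟩

/-- **`M_t^{⊗4}` PRESERVES THE CLASS SCREEN (A1)**: `ℚ[h] ⊕ W` is `M_t`-stable (`ĥ_k ↦ Σ_j C(j,k) t^{j−k} ĥ_j`, `eeee`, `ēēēē`
fixed). -/
theorem classScreen_twOp (t : ℤ) {T : CWord → GaussianInt} (hT : ClassScreen T) : ClassScreen (twOp t T) := by
  obtain ⟨q, w₁, w₂, rfl⟩ := (inQhW_iff_classScreen T).2 hT
  rw [map_add, map_add, map_sum, map_smul, map_smul, twOp_wordFn_eWord, twOp_wordFn_ebarWord]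
  refine classScreen_add (classScreen_add (classScreen_sum' _ fun k _ => ?_) (classScreen_smul' classScreen_wordFn_eWord w₁))
    (classScreen_smul' classScreen_wordFn_ebarWord w₂)
  rw [map_smul]
  exact classScreen_smul' (classScreen_twOp_hHat t k) (q k)

namespace Design

/-- **THE TWISTED DESIGN `D(t)`** (the json of `𝓔(tH)`: every cell twisted by `t`, multiplicities carried along). -/
def tw (t : ℤ) (D : Design) : Design where
  cfg := ⟨D.cfg.lower.map (MCell.twEmb t), D.cfg.upper.map (MCell.twEmb t)⟩
  mN := fun Z => D.mN (MCell.tw (-t) Z)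
  mP := fun P => D.mP (MCell.tw (-t) P)

/-- **`wch(D(t)) = M_t^{⊗4} wch(D)`.** -/
theorem tw_wch (t : ℤ) (D : Design) : (D.tw t).wch = twOp t D.wch := by
  simp only [Design.wch, MConfig.wch, Design.tw, Finset.sum_map, MCell.twEmb_apply, MCell.tw_neg_tw, map_sub, map_sum,
    map_zsmul, MCell.ch_tw]

/-- **`μ(D(t)) = μ(D)`** — the `W`-coordinate is twist-invariant. -/
theorem tw_mu (t : ℤ) (D : Design) : (D.tw t).mu = D.mu := by
  rw [Design.mu, tw_wch, twOp_apply_eWord]; rfl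

theorem tw_mubar (t : ℤ) (D : Design) : (D.tw t).mubar = D.mubar := by
  rw [Design.mubar, tw_wch, twOp_apply_ebarWord]; rfl

/-- the rank is twist-invariant. -/
theorem tw_rank (t : ℤ) (D : Design) : (D.tw t).rank = D.rank := by
  rw [Design.rank, tw_wch, twOp_apply_rankWord]; rfl

/-- **(A1) is twist-invariant: `D` clean ⟹ `D(t)` clean.** -/
theorem tw_clean (t : ℤ) (D : Design) (hD : D.Clean) : (D.tw t).Clean := by
  rw [Design.Clean, tw_wch]
  exact classScreen_twOp t hD

/-- positivity of multiplicities is twist-invariant. -/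
theorem tw_positive_iff (t : ℤ) (D : Design) : (D.tw t).Positive ↔ D.Positive := by
  simp only [Design.Positive, Design.tw, Finset.forall_mem_map, MCell.twEmb_apply, MCell.tw_neg_tw]

/-- **C0 is twist-invariant.** -/
theorem tw_classData (t : ℤ) (D : Design) (hD : D.ClassData) : (D.tw t).ClassData :=
  ⟨tw_clean t D hD.1, by rw [tw_mu]; exact hD.2.1, by rw [tw_rank]; exact hD.2.2.1, (tw_positive_iff t D).2 hD.2.2.2⟩

/-- **THE FRAME DECOMPOSITION OF A CLEAN DESIGN**: `wch(D) = Σ_k c_k(D) · ĥ_k + μ · eeee + μ̄ · ēēēē`. -/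
theorem wch_decomp_of_clean (D : Design) (hD : D.Clean) :
    D.wch = (∑ k : Fin 9, ((D.coeff k : ℤ) : GaussianInt) • (hHat k : CWord → GaussianInt)) +
      D.mu • wordFn eWord + D.mubar • wordFn ebarWord := by
  obtain ⟨he, heb, hne⟩ := (not_eFree_eWord : ¬ EFree eWord ∧ _)
  funext w
  simp only [Pi.add_apply, Finset.sum_apply, Pi.smul_apply, smul_eq_mul]
  by_cases hw : EFree w
  · have h1 : w ≠ eWord := fun h => he (h ▸ hw)
    have h2 : w ≠ ebarWord := fun h => heb (h ▸ hw)
    rw [D.wch_eq_coeff_of_clean hD hw]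
    have hlt : wdeg w < 9 := Nat.lt_succ_of_le (wdeg_le_eight w)
    rw [Finset.sum_eq_single (⟨wdeg w, hlt⟩ : Fin 9)]
    · simp [hHat, wordFn, hw, h1, h2]
    · intro k _ hk
      have : wdeg w ≠ (k : ℕ) := fun h => hk (Fin.ext h.symm)
      simp [hHat, this]
    · simp
  · by_cases h1 : w = eWord
    · subst h1
      simp [hHat, wordFn, he, hne, Design.mu]
    · by_cases h2 : w = ebarWord
      · subst h2
        simp [hHat, wordFn, heb, hne.symm, Design.mubar]
      · simp [hHat, wordFn, hw, h1, h2, hD.1 w hw h1 h2]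

/-- **THE TWIST LAW FOR THE COEFFICIENTS: `c_p(D(t)) = Σ_{d} C(p, d) t^{p−d} c_d(D)`** (`(h + t)^p`-reexpansion of `c_d h^d∕d!`
bookkeeping: `ch(𝓔(tH)) = ch(𝓔)·e^{tH}` read in `ℚ[h]`; `C(p, d) = 0` for `d > p`). For a clean design. -/
theorem tw_coeff (t : ℤ) (D : Design) (hD : D.Clean) (p : Fin 9) :
    (D.tw t).coeff p = ∑ d : Fin 9, ((p : ℕ).choose d : ℤ) * t ^ ((p : ℕ) - d) * D.coeff d := by
  have hne : refWord p ≠ eWord := fun e => not_eFree_eWord.1 (e ▸ (refWord_spec p).1)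
  have hne' : refWord p ≠ ebarWord := fun e => not_eFree_eWord.2.1 (e ▸ (refWord_spec p).1)
  have h := (D.tw t).wch_refWord p
  rw [tw_wch, D.wch_decomp_of_clean hD] at h
  simp only [map_add, map_sum, map_smul, twOp_wordFn_eWord, twOp_wordFn_ebarWord, Pi.add_apply, Finset.sum_apply,
    Pi.smul_apply, smul_eq_mul, twOp_hHat_apply, (refWord_spec p).2, wordFn, if_neg hne, if_neg hne', mul_zero,
    add_zero] at h
  simp only [if_pos (refWord_spec p).1] at h
  have h' : (((∑ d : Fin 9, ((p : ℕ).choose d : ℤ) * t ^ ((p : ℕ) - d) * D.coeff d : ℤ)) : GaussianInt) =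
      (((D.tw t).coeff p : ℤ) : GaussianInt) := by
    rw [← h]
    push_cast
    exact Finset.sum_congr rfl fun d _ => by ring
  have h'' := congrArg Zsqrtd.re h'
  simpa only [Zsqrtd.re_intCast] using h''.symm

end Design

/-! ### §7.2 JSON side: PARTNER COVERAGE of a two-term display (the first layer of C3, typed) -/

namespace Design

/-- **PARTNER COVERAGE, UP display** `0 → ⊕_P L_P^{m_P} → ⊕_N L_N^{m_N} → 𝓔 → 0`: every `P`-cell with `m_P > 0` has a LIVE partner
`N` (`m_N > 0`, `Hom(L_P, L_N) ≠ 0` i.e. `P ≤ N` in the effective order — a summand with no live partner maps to zero and the display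
is not injective). A NECESSARY json condition; decidable (`decide` on a design of record); the «partner-less orbits» of the R-B screens. -/
def PartnerUp (D : Design) : Prop :=
  ∀ P ∈ D.cfg.upper, 0 < D.mP P → ∃ N ∈ D.cfg.lower, 0 < D.mN N ∧ MCell.le P N

/-- **PARTNER COVERAGE, DOWN display** `0 → 𝓔 → ⊕_N L_N^{m_N} → ⊕_P L_P^{m_P} → 0`: every `P`-cell with `m_P > 0` RECEIVES from a
live `N ≤ P` (else the display is not surjective). Necessary, decidable. -/
def PartnerDown (D : Design) : Prop :=
  ∀ P ∈ D.cfg.upper, 0 < D.mP P → ∃ N ∈ D.cfg.lower, 0 < D.mN N ∧ MCell.le N P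

/-- the LIVE NEIGHBOURHOOD of a set `U` of `P`-cells in the UP display: the `N`-cells of the support receiving a live arc `P ≤ N` from `U`. -/
def nbhdUp (D : Design) (U : Finset MCell) : Finset MCell := D.cfg.lower.filter fun N => ∃ P ∈ U, MCell.le P N

/-- … in the DOWN display: the `N`-cells of the support with a live arc `N ≤ P` into `U`. -/
def nbhdDown (D : Design) (U : Finset MCell) : Finset MCell := D.cfg.lower.filter fun N => ∃ P ∈ U, MCell.le N P

/-- **HALL₀, UP display** (C3 of the seed-condition list; the design instance of the abstract weighted Hall condition
`Cruxes/BlochSeedDiscOne/ColourForgetHall.lean`'s `Hall E m n` with `E = (· ≤ ·)`, `m = m_P`, `n = m_N`): every set `U` of `P`-cells of the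
support is covered by the capacity of its live neighbourhood, `Σ_{P ∈ U} m_P ≤ Σ_{N ∈ Γ(U)} m_N` (supply–demand feasibility of «ship every
`L_P^{m_P}` along live arcs into the `L_N^{m_N}`»; necessary for an injective display with generic maps). Decidable (powerset quantifier). -/
def HallUp (D : Design) : Prop := ∀ U ∈ D.cfg.upper.powerset, ∑ P ∈ U, D.mP P ≤ ∑ N ∈ D.nbhdUp U, D.mN N

/-- **HALL₀, DOWN display** (reversed arcs). -/
def HallDown (D : Design) : Prop := ∀ U ∈ D.cfg.upper.powerset, ∑ P ∈ U, D.mP P ≤ ∑ N ∈ D.nbhdDown U, D.mN N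

/-- **PARTNER COVERAGE IS THE SINGLETON LAYER OF HALL₀** (UP): for a design with positive multiplicities, `HallUp ⟹ PartnerUp`
(`U = {P}`: `0 < m_P ≤ Σ_{N ∈ Γ{P}} m_N` forces a live `N` with `m_N > 0`). So §7.2 is IMPLIED BY C3, not a new condition. -/
theorem partnerUp_of_hallUp (D : Design) (h : D.HallUp) : D.PartnerUp := by
  intro P hP hmP
  have hU := h {P} (Finset.mem_powerset.2 (Finset.singleton_subset_iff.2 hP))
  rw [Finset.sum_singleton] at hU
  by_contra hne
  push Not at hne
  have hle : ∑ N ∈ D.nbhdUp {P}, D.mN N ≤ 0 := Finset.sum_nonpos fun N hN => by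
    obtain ⟨hNl, P', hP', hle⟩ := Finset.mem_filter.1 hN
    rw [Finset.mem_singleton.1 hP'] at hle
    exact not_lt.1 fun hpos => hne N hNl hpos hle
  exact absurd (hmP.trans_le (hU.trans hle)) (lt_irrefl 0)

/-- … and DOWN: `HallDown ⟹ PartnerDown`. -/
theorem partnerDown_of_hallDown (D : Design) (h : D.HallDown) : D.PartnerDown := by
  intro P hP hmP
  have hU := h {P} (Finset.mem_powerset.2 (Finset.singleton_subset_iff.2 hP))
  rw [Finset.sum_singleton] at hU
  by_contra hne
  push Not at hne
  have hle : ∑ N ∈ D.nbhdDown {P}, D.mN N ≤ 0 := Finset.sum_nonpos fun N hN => by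
    obtain ⟨hNl, P', hP', hle⟩ := Finset.mem_filter.1 hN
    rw [Finset.mem_singleton.1 hP'] at hle
    exact not_lt.1 fun hpos => hne N hNl hpos hle
  exact absurd (hmP.trans_le (hU.trans hle)) (lt_irrefl 0)

private theorem exists_mem_map_iff' {f : MCell ↪ MCell} {s : Finset MCell} {p : MCell → Prop} :
    (∃ y ∈ s.map f, p y) ↔ ∃ x ∈ s, p (f x) := by
  constructor
  · rintro ⟨y, hy, hp⟩
    obtain ⟨x, hx, rfl⟩ := Finset.mem_map.1 hy
    exact ⟨x, hx, hp⟩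
  · rintro ⟨x, hx, hp⟩
    exact ⟨f x, Finset.mem_map_of_mem f hx, hp⟩

/-- partner coverage is twist-invariant (the effective order is). -/
theorem tw_partnerUp_iff (t : ℤ) (D : Design) : (D.tw t).PartnerUp ↔ D.PartnerUp := by
  simp only [PartnerUp, Design.tw, Finset.forall_mem_map, exists_mem_map_iff', MCell.twEmb_apply, MCell.tw_neg_tw,
    MCell.le_tw_iff]

theorem tw_partnerDown_iff (t : ℤ) (D : Design) : (D.tw t).PartnerDown ↔ D.PartnerDown := by
  simp only [PartnerDown, Design.tw, Finset.forall_mem_map, exists_mem_map_iff', MCell.twEmb_apply, MCell.tw_neg_tw,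
    MCell.le_tw_iff]

/-- the live neighbourhood is transported by the twist. -/
theorem tw_nbhdUp (t : ℤ) (D : Design) (U : Finset MCell) :
    (D.tw t).nbhdUp (U.map (MCell.twEmb t)) = (D.nbhdUp U).map (MCell.twEmb t) := by
  rw [nbhdUp, nbhdUp, show (D.tw t).cfg.lower = D.cfg.lower.map (MCell.twEmb t) from rfl, Finset.filter_map]
  congr 1
  exact Finset.filter_congr fun N _ => by
    simp only [Function.comp_apply, exists_mem_map_iff', MCell.twEmb_apply, MCell.le_tw_iff]

theorem tw_nbhdDown (t : ℤ) (D : Design) (U : Finset MCell) :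
    (D.tw t).nbhdDown (U.map (MCell.twEmb t)) = (D.nbhdDown U).map (MCell.twEmb t) := by
  rw [nbhdDown, nbhdDown, show (D.tw t).cfg.lower = D.cfg.lower.map (MCell.twEmb t) from rfl, Finset.filter_map]
  congr 1
  exact Finset.filter_congr fun N _ => by
    simp only [Function.comp_apply, exists_mem_map_iff', MCell.twEmb_apply, MCell.le_tw_iff]

/-- **HALL₀ (C3) is twist-invariant** (UP): the live arcs and the masses are transported by `(α, β) ↦ (α + t, β)`. -/
theorem tw_hallUp_iff (t : ℤ) (D : Design) : (D.tw t).HallUp ↔ D.HallUp := by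
  constructor
  · intro h U hU
    have hU' : U.map (MCell.twEmb t) ∈ (D.tw t).cfg.upper.powerset :=
      Finset.mem_powerset.2 (Finset.map_subset_map.2 (Finset.mem_powerset.1 hU))
    have h' := h _ hU'
    rw [tw_nbhdUp, Finset.sum_map, Finset.sum_map] at h'
    simpa only [Design.tw, MCell.twEmb_apply, MCell.tw_neg_tw] using h'
  · intro h U' hU'
    obtain ⟨U, hU, rfl⟩ := Finset.subset_map_iff.1 (Finset.mem_powerset.1 hU')
    have h' := h U (Finset.mem_powerset.2 hU)
    rw [tw_nbhdUp, Finset.sum_map, Finset.sum_map]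
    simpa only [Design.tw, MCell.twEmb_apply, MCell.tw_neg_tw] using h'

/-- … and DOWN. -/
theorem tw_hallDown_iff (t : ℤ) (D : Design) : (D.tw t).HallDown ↔ D.HallDown := by
  constructor
  · intro h U hU
    have hU' : U.map (MCell.twEmb t) ∈ (D.tw t).cfg.upper.powerset :=
      Finset.mem_powerset.2 (Finset.map_subset_map.2 (Finset.mem_powerset.1 hU))
    have h' := h _ hU'
    rw [tw_nbhdDown, Finset.sum_map, Finset.sum_map] at h'
    simpa only [Design.tw, MCell.twEmb_apply, MCell.tw_neg_tw] using h'
  · intro h U' hU'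
    obtain ⟨U, hU, rfl⟩ := Finset.subset_map_iff.1 (Finset.mem_powerset.1 hU')
    have h' := h U (Finset.mem_powerset.2 hU)
    rw [tw_nbhdDown, Finset.sum_map, Finset.sum_map]
    simpa only [Design.tw, MCell.twEmb_apply, MCell.tw_neg_tw] using h'

/-- §7.2e TOY (kernel `decide`, the decidability claims exercised): one `P`-cell at the origin, one `N`-cell at the apex `(1, 0, 0)⁴`,
multiplicities `1`: UP partner ∕ Hall hold (`0 ≤ (1,0,0)`), DOWN partner fails (`(1,0,0) ≰ 0`). Nothing of record. -/
private def toyDesign : Design := ⟨⟨{apexCell 1}, {apexCell 0}⟩, fun _ => 1, fun _ => 1⟩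

example : toyDesign.PartnerUp ∧ toyDesign.HallUp ∧ ¬ toyDesign.PartnerDown := by
  unfold Design.PartnerUp Design.HallUp Design.PartnerDown Design.nbhdUp
  decide

end Design

end JsonSideVFour

/-! ### §7.3 OBJECT side: Chern classes `c₁ … c₄` from `ch` by Newton ON THE CARRIER; the `W`-coordinate of `c₄` -/

section ChernFromCh

/-- **`xⁱ ∪ xʲ = xⁱ⁺ʲ`** for a degree-`2` class (associativity of `∪`, Hatcher §3.2 p. 211; any degree book-keeping
proof `hdeg` will do, by proof irrelevance). [cite: HatcherAT2002, §3.2 p. 211] -/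
theorem cupProduct_cupPowTwo_cupPowTwo {Y : Type} [TopologicalSpace Y] (x : singularCohomology ℂ ℂ Y 2) (i j : ℕ) :
    ∀ hdeg : 2 * i + 2 * j = 2 * (i + j), cupProduct hdeg (cupPowTwo x i) (cupPowTwo x j) = cupPowTwo x (i + j) := by
  induction j with
  | zero =>
    intro hdeg
    exact cupProduct_one _
  | succ j ih =>
    intro hdeg
    rw [cupPowTwo_succ x j, show cupPowTwo x (i + (j + 1)) =
      cupProduct (two_mul_add_two (i + j)) (cupPowTwo x (i + j)) x from rfl, ← ih (by omega)]
    exact (cupProduct_assoc _ _ _ _ _ _ _).symm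

variable (C : ChernCharacterBetti) (X : Motives.SchemeOver ℂ) (𝓕 : X.left.Modules)

/-- **`c₁(𝓕) = ch₁(𝓕)`** (Newton, degree `1`). [cite: Fulton1998, Example 3.2.3] -/
def chernOne : complexBetti X (2 * 1) := C.ch X 𝓕 1

/-- **`c₂(𝓕) = ½ ch₁² − ch₂`** (Newton: `ch₂ = ½(c₁² − 2c₂)`). [cite: Fulton1998, Example 3.2.3] -/
def chernTwo : complexBetti X (2 * 2) :=
  (1 / 2 : ℂ) • cupPowTwo (C.ch X 𝓕 1) 2 - C.ch X 𝓕 2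

/-- **`c₃(𝓕) = ⅙ ch₁³ − ch₁ ∪ ch₂ + 2 ch₃`** (Newton: `ch₃ = ⅙(c₁³ − 3c₁c₂ + 3c₃)`). [cite: Fulton1998, Example 3.2.3] -/
def chernThree : complexBetti X (2 * 3) :=
  (1 / 6 : ℂ) • cupPowTwo (C.ch X 𝓕 1) 3 - cupProduct (rfl : 2 * 1 + 2 * 2 = 2 * 3) (C.ch X 𝓕 1) (C.ch X 𝓕 2) +
    (2 : ℂ) • C.ch X 𝓕 3

/-- **THE FOURTH CHERN CLASS FROM THE CHERN CHARACTER** (Newton's identity in degree `4`, `p_k = k!·ch_k`,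
`24 c₄ = p₁⁴ − 6p₁²p₂ + 3p₂² + 8p₁p₃ − 6p₄`): `c₄ = (1∕24) ch₁⁴ − ½ ch₁² ∪ ch₂ + ½ ch₂ ∪ ch₂ + 2 ch₁ ∪ ch₃ − 6 ch₄` — on the
real carrier `H⁸(X(ℂ); ℂ)` with the tree's `cupProduct` ∕ `cupPowTwo`; for a rank-`4` vector bundle this IS its top Chern class
(the intended instance of `C` is the topological Chern character). A DEFINITION (the coefficient `−6` of `ch₄` is the whole point:
the `W`-coordinate of `c₄` is `−6μ`). [cite: Fulton1998, Example 3.2.3] -/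
def chernFour : complexBetti X (2 * 4) :=
  (1 / 24 : ℂ) • cupPowTwo (C.ch X 𝓕 1) 4 -
    (1 / 2 : ℂ) • cupProduct (rfl : 2 * 2 + 2 * 2 = 2 * 4) (cupPowTwo (C.ch X 𝓕 1) 2) (C.ch X 𝓕 2) +
    (1 / 2 : ℂ) • cupProduct (rfl : 2 * 2 + 2 * 2 = 2 * 4) (C.ch X 𝓕 2) (C.ch X 𝓕 2) +
    (2 : ℂ) • cupProduct (rfl : 2 * 1 + 2 * 3 = 2 * 4) (C.ch X 𝓕 1) (C.ch X 𝓕 3) -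
    (6 : ℂ) • C.ch X 𝓕 4

variable {C X 𝓕}

/-- **NEWTON IN `ℚ[h] ⊕ W`: if `ch_p(𝓕) = a_p · h^p` (`p = 1, 2, 3`) and `ch₄(𝓕) = q · h⁴ + w`, then
`c₄(𝓕) = q' · h⁴ − 6 · w`** with the explicit `q' = a₁⁴∕24 − a₁²a₂∕2 + a₂²∕2 + 2a₁a₃ − 6q` — bilinearity of `∪` and `hⁱ ∪ hʲ = hⁱ⁺ʲ`;
NO relation `h ∪ w = 0` is needed in degree `4` (the `W`-part enters only through `ch₄`, linearly). [cite: Fulton1998, Example 3.2.3] -/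
theorem chernFour_eq_of_ch_eq {h : complexBetti X 2} {w : complexBetti X (2 * 4)} {a₁ a₂ a₃ q : ℂ}
    (h1 : C.ch X 𝓕 1 = a₁ • cupPowTwo h 1) (h2 : C.ch X 𝓕 2 = a₂ • cupPowTwo h 2) (h3 : C.ch X 𝓕 3 = a₃ • cupPowTwo h 3)
    (h4 : C.ch X 𝓕 4 = q • cupPowTwo h 4 + w) :
    chernFour C X 𝓕 = (a₁ ^ 4 / 24 - a₁ ^ 2 * a₂ / 2 + a₂ ^ 2 / 2 + 2 * (a₁ * a₃) - 6 * q) • cupPowTwo h 4 - (6 : ℂ) • w := by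
  have e1 : C.ch X 𝓕 1 = a₁ • h := by rw [h1, cupPowTwo_one]
  have p22 : cupProduct (rfl : 2 * 2 + 2 * 2 = 2 * 4) (cupPowTwo h 2) (cupPowTwo h 2) = cupPowTwo h 4 :=
    cupProduct_cupPowTwo_cupPowTwo h 2 2 rfl
  have p13 : cupProduct (rfl : 2 * 1 + 2 * 3 = 2 * 4) h (cupPowTwo h 3) = cupPowTwo h 4 := by
    have e := cupProduct_cupPowTwo_cupPowTwo h 1 3 rfl
    rwa [cupPowTwo_one] at e
  simp only [chernFour, e1, h2, h3, h4, cupPowTwo_smul_aux, map_smul, LinearMap.smul_apply, smul_smul, p22, p13,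
    smul_add]
  module

end ChernFromCh

/-! #### The `W`-coordinate theorem on the anchor and the (σ) object half from a zero scheme -/

section SigmaObject

variable {E₀ : AbelianVariety ℂ} {ψ₀ : E₀ ⟶ E₀} {C : ChernCharacterBetti}

/-- **THE `W`-COORDINATE THEOREM**: if `𝓕` is (A1)-clean at the seed in a window containing `1, 2, 3` with `W`-coordinate `μ`
(`CleanAtSeed C I F h 𝓕 μ`: `ch_p = c_p·hᵖ`, `p = 1,2,3`; `ch₄ = q·h⁴ + wOf μ`), then
**`c₄(𝓕) = q'·h⁴ + wOf(−6μ)`** for some rational `q'` — the top Chern class of a realisation of a design with `eeee`-coefficient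
`μ` has `W`-coordinate `−6μ ≠ 0`; g0's pencil sentence «the `W`-coordinate of `[Z(s)] = c₄(𝓔(tH))` is `−6μ`», kernel-checked. -/
theorem chernFour_eq_of_cleanAtSeed {I : Finset ℕ} {F : WeilFrame E₀ ψ₀} {h : complexBetti (pad4Anchor E₀).X 2}
    {𝓕 : (pad4Anchor E₀).X.left.Modules} {μ : GaussianInt} (hcl : CleanAtSeed C I F h 𝓕 μ) (h1 : 1 ∈ I) (h2 : 2 ∈ I)
    (h3 : 3 ∈ I) :
    ∃ q' : ℚ, chernFour C (pad4Anchor E₀).X 𝓕 = ((q' : ℚ) : ℂ) • cupPowTwo h 4 + F.wOf ((-6 : ℤ) * μ) := by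
  obtain ⟨c, q, hc, hq⟩ := hcl
  refine ⟨c 1 ^ 4 / 24 - c 1 ^ 2 * c 2 / 2 + c 2 ^ 2 / 2 + 2 * (c 1 * c 3) - 6 * q, ?_⟩
  rw [chernFour_eq_of_ch_eq (hc 1 h1 (by decide)) (hc 2 h2 (by decide)) (hc 3 h3 (by decide)) hq,
    WeilFrame.wOf_intCast_mul, sub_eq_add_neg, ← neg_smul]
  congr 1
  · push_cast; ring_nf
  · norm_num

/-- **THE ZERO SCHEME OF A SECTION** (a predicate on honest carriers; Fulton B.3.4, §14.1): `i : Z ↪ X` IS the zero scheme of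
the section `s : 𝒪_X → 𝓕` — `i` is a closed immersion, `i^*s = 0`, and every `g : T → X` with `g^*s = 0` factors through `i`
(uniquely, `i` being a monomorphism). Mathlib's module pull-back `Scheme.Modules.pullback`, the tree's `Modules.unitModule`.
[cite: Fulton1998, §14.1 and B.3.4] -/
def IsZeroSchemeOf {X : Scheme.{0}} {𝓕 : X.Modules} (s : Modules.unitModule X ⟶ 𝓕) {Z : Scheme.{0}} (i : Z ⟶ X) : Prop :=
  IsClosedImmersion i ∧ (Scheme.Modules.pullback i).map s = 0 ∧
    ∀ ⦃T : Scheme.{0}⦄ (g : T ⟶ X), (Scheme.Modules.pullback g).map s = 0 → ∃ g' : T ⟶ Z, g' ≫ i = g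

theorem IsZeroSchemeOf.isClosedImmersion {X : Scheme.{0}} {𝓕 : X.Modules} {s : Modules.unitModule X ⟶ 𝓕} {Z : Scheme.{0}}
    {i : Z ⟶ X} (hZ : IsZeroSchemeOf s i) : IsClosedImmersion i :=
  hZ.1

/-- **THE TOP-CHERN-CLASS LOCALISATION LAW at rank `4` — A NAMED STATEMENT (`Prop`) about the Chern character theory `C`,
NEITHER PROVED NOR ASSERTED HERE** (consumed as `(hloc : TopChernFourLocalisation C)`): for a vector bundle `𝓕` of constant rank `4`
on a complex scheme `X` and a section `s` with zero scheme `i : Z ↪ X`, the class `c₄(𝓕) ∈ H⁸(X(ℂ); ℂ)` is SUPPORTED ON `Z` (vanishes on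
`(X ∖ Z)(ℂ)`). For the intended (topological) instance this holds for EVERY section, regular or not: on `U = X ∖ Z(s)` the section is
nowhere zero, so `𝓕|_U` is an extension of a rank-`3` bundle `𝓕'` by `𝒪_U` and `c₄(𝓕)|_U = c₄(𝒪_U)·… = c₄(𝓕') = 0` (Whitney sum and
vanishing above the rank, Fulton Thm. 3.2 (a), (e); Newton's `chernFour` IS `c₄` for a rank-`4` bundle); for a REGULAR section it is the
shadow of Fulton's `[Z(s)] = c₄(𝓕) ∩ [X]` (Example 14.1.1, Prop. 14.1 (b)) read through the cycle class (§19.1). It is NOT derivable from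
the fields of `ChernCharacterBetti` (no restriction to opens, no vanishing above the rank; the tree's `Motives.ChernClassTheory` axiomatises
`c_i` over a `PreWeilCohomology`, not over `complexBetti`, and has no zero-scheme clause either), hence a NAMED LAW.
[cite: Fulton1998, Example 14.1.1, Prop. 14.1 (b), Thm. 3.2 and §19.1] -/
def TopChernFourLocalisation (C : ChernCharacterBetti) : Prop :=
  ∀ (X : Motives.SchemeOver ℂ) (𝓕 : X.left.Modules), HasRank 𝓕 4 →
    ∀ (s : Modules.unitModule X.left ⟶ 𝓕) ⦃Z : Scheme.{0}⦄ (i : Z ⟶ X.left), IsZeroSchemeOf s i →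
      chernFour C X 𝓕 ∈ classesSupportedOn X (Set.range i.base) (2 * 4)

/-- **(σ) OBJECT HALF FROM A ZERO SCHEME, against any frame**: a rank-`4` vector bundle `𝓕` on the anchor, (A1)-clean at the seed in a
window `⊇ {1, 2, 3}` with `W`-coordinate `μ` against `(h, F)`, and the zero scheme `i : Z ↪ S⁴` of a section of `𝓕` give — GIVEN the law —
**`q·h⁴ + wOf μ` supported on `Z` for an explicit rational `q`** (`= −q'∕6`: rescale `c₄ = q'h⁴ − 6·wOf μ` by `−1∕6` inside the
`ℂ`-submodule `classesSupportedOn`). -/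
theorem supported_of_zeroScheme {I : Finset ℕ} {F : WeilFrame E₀ ψ₀} {h : complexBetti (pad4Anchor E₀).X 2}
    {𝓕 : (pad4Anchor E₀).X.left.Modules} {μ : GaussianInt} (hloc : TopChernFourLocalisation C) (hrk : HasRank 𝓕 4)
    (hcl : CleanAtSeed C I F h 𝓕 μ) (h1 : 1 ∈ I) (h2 : 2 ∈ I) (h3 : 3 ∈ I) (s : Modules.unitModule (pad4Anchor E₀).X.left ⟶ 𝓕)
    {Z : Scheme.{0}} {i : Z ⟶ (pad4Anchor E₀).X.left} (hZ : IsZeroSchemeOf s i) :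
    ∃ q : ℚ, ((q : ℚ) : ℂ) • cupPowTwo h 4 + F.wOf μ ∈ classesSupportedOn (pad4Anchor E₀).X (Set.range i.base) (2 * 4) := by
  obtain ⟨q', hq'⟩ := chernFour_eq_of_cleanAtSeed hcl h1 h2 h3
  have hmem := hloc (pad4Anchor E₀).X 𝓕 hrk s i hZ
  rw [hq', WeilFrame.wOf_intCast_mul] at hmem
  have hmem' := Submodule.smul_mem _ ((((-1 : ℚ) / 6 : ℚ)) : ℂ) hmem
  refine ⟨-1 / 6 * q', ?_⟩
  convert hmem' using 1
  rw [smul_add, smul_smul, smul_smul, ← Rat.cast_mul, ← Rat.cast_mul]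
  norm_num

/-- **… and against the kit's `h_K = symH = 2t·h_std`** (the form `Design.SeedCheck` ∕ `ClassCheck` read): check (A1@Z) against
`h_std`, consume against `h_K` (`h_std⁴ = (2t)⁻⁴ · h_K⁴`). -/
theorem supported_symH_of_zeroScheme (hE : E₀.dim = 1) (hψ : ψ₀ ≫ ψ₀ = -(1 • 𝟙 E₀)) (K : AnchorKit E₀ ψ₀) {I : Finset ℕ}
    {𝓕 : (pad4Anchor E₀).X.left.Modules} {μ : GaussianInt} (hloc : TopChernFourLocalisation C) (hrk : HasRank 𝓕 4)
    (hcl : CleanAtSeed C I K.F (hStd E₀ K.η) 𝓕 μ) (h1 : 1 ∈ I) (h2 : 2 ∈ I) (h3 : 3 ∈ I)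
    (s : Modules.unitModule (pad4Anchor E₀).X.left ⟶ 𝓕) {Z : Scheme.{0}} {i : Z ⟶ (pad4Anchor E₀).X.left}
    (hZ : IsZeroSchemeOf s i) :
    ∃ q : ℚ, ((q : ℚ) : ℂ) • cupPowTwo (symH (pad4Action E₀ ψ₀) K.pol.e K.pol.a) 4 + K.F.wOf μ ∈
      classesSupportedOn (pad4Anchor E₀).X (Set.range i.base) (2 * 4) :=
  supported_of_zeroScheme hloc hrk (cleanAtSeed_symH_of_hStd hE hψ K hcl) h1 h2 h3 s hZ

/-- **THE LCI DOOR END-TO-END FROM A ZERO SCHEME** — a predicate-to-predicate theorem, GIVEN the law: a design `D` passing C0, a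
rank-`4` vector bundle `𝓕` on the anchor (A1)-clean at the seed with THE DESIGN'S `μ` in a window `⊇ {1,2,3}` (e.g. a presentation of a
design `D'` with `μ(D') = μ(D)` — the TWISTED design `D(t)`, §7.1, `Design.tw_mu`), a section `s` of `𝓕` whose zero scheme `i : Z ↪ S⁴`
passes C5 (regular immersion of codimension `4`), C6 (integral, codimension `≥ 4` pointwise) and C7 (Bloch-semiregular) ⟹
**`D.SeedCheck K i q` for some `q`**, hence (`seedData_of_seedCheck`) the conclusion of `stub_rung_pad4_seedAt` on that anchor. The
(σ) conjunct is DISCHARGED (modulo the law); C5–C7 stay hypotheses on the object. -/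
theorem Design.seedCheck_of_zeroScheme (hE : E₀.dim = 1) (hψ : ψ₀ ≫ ψ₀ = -(1 • 𝟙 E₀)) {D : Design} (hC0 : D.ClassData)
    (K : AnchorKit E₀ ψ₀) {I : Finset ℕ} {𝓕 : (pad4Anchor E₀).X.left.Modules} (hloc : TopChernFourLocalisation C)
    (hrk : HasRank 𝓕 4) (hcl : CleanAtSeed C I K.F (hStd E₀ K.η) 𝓕 D.mu) (h1 : 1 ∈ I) (h2 : 2 ∈ I) (h3 : 3 ∈ I)
    (s : Modules.unitModule (pad4Anchor E₀).X.left ⟶ 𝓕) {Z : Scheme.{0}} {i : Z ⟶ (pad4Anchor E₀).X.left}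
    (hZ : IsZeroSchemeOf s i) (hreg : IsRegularImmersionOfCodim i 4) (hint : AlgebraicGeometry.IsIntegral Z)
    (hcoh : ∀ z ∈ Set.range i.base, ((4 : ℕ) : ℕ∞) ≤ Order.coheight z) (hsr : IsBlochSemiregular i (2 * 4) 4) :
    ∃ q : ℚ, D.SeedCheck K i q := by
  obtain ⟨q, hq⟩ := supported_symH_of_zeroScheme hE hψ K hloc hrk hcl h1 h2 h3 s hZ
  exact ⟨q, hC0, hZ.isClosedImmersion, hreg, hint, hcoh, hsr, hq⟩

/-- … so such data on EVERY CM anchor give the crux `BlochSeedDiscOne` BY NAME (hypothesis-carrying; via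
`blochSeedDiscOne_of_seedChecks`). Nothing is asserted: no bundle, section or zero scheme is constructed in this file. -/
theorem blochSeedDiscOne_of_zeroSchemes (hloc : TopChernFourLocalisation C)
    (h : ∀ (E₀ : AbelianVariety ℂ) (ψ₀ : E₀ ⟶ E₀), E₀.dim = 1 → ψ₀ ≫ ψ₀ = -(1 • 𝟙 E₀) →
      ∃ (D : Design) (_ : D.ClassData) (K : AnchorKit E₀ ψ₀) (I : Finset ℕ) (_ : 1 ∈ I) (_ : 2 ∈ I) (_ : 3 ∈ I)
        (𝓕 : (pad4Anchor E₀).X.left.Modules) (_ : HasRank 𝓕 4) (_ : CleanAtSeed C I K.F (hStd E₀ K.η) 𝓕 D.mu)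
        (s : Modules.unitModule (pad4Anchor E₀).X.left ⟶ 𝓕) (Z : Scheme.{0}) (i : Z ⟶ (pad4Anchor E₀).X.left),
        IsZeroSchemeOf s i ∧ IsRegularImmersionOfCodim i 4 ∧ AlgebraicGeometry.IsIntegral Z ∧
          (∀ z ∈ Set.range i.base, ((4 : ℕ) : ℕ∞) ≤ Order.coheight z) ∧ IsBlochSemiregular i (2 * 4) 4) :
    Summit.HodgeConjecture.HodgeConjecture.Theses.EightfoldBlochSeeds.BlochSeedDiscOne :=
  blochSeedDiscOne_of_seedChecks fun E₀ ψ₀ hE hψ => by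
    obtain ⟨D, hC0, K, I, h1, h2, h3, 𝓕, hrk, hcl, s, Z, i, hZ, hreg, hint, hcoh, hsr⟩ := h E₀ ψ₀ hE hψ
    obtain ⟨q, hq⟩ := D.seedCheck_of_zeroScheme hE hψ hC0 K hloc hrk hcl h1 h2 h3 s hZ hreg hint hcoh hsr
    exact ⟨D, K, Z, i, q, hq⟩

/-- the members `1, 2, 3` of the Koszul window `{1, 2, 3, 4}`. [`decide`] -/
theorem one_two_three_mem_koszulWindow : 1 ∈ koszulWindow ∧ 2 ∈ koszulWindow ∧ 3 ∈ koszulWindow := by decide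

/-- **(A1@Z) WITH THE DESIGN'S `μ` FROM A PRESENTATION OF ANOTHER DESIGN WITH THE SAME `μ`** — the twisted design `D(t)` of a
presentation of `𝓔(tH)` is the case in point (`Design.tw_mu`): `μ` is all the lci door reads of the design tensor. -/
theorem cleanAtSeed_of_realisedBy_of_mu_eq {D D' : Design} {F : WeilFrame E₀ ψ₀} {h : complexBetti (pad4Anchor E₀).X 2}
    {𝓕 : (pad4Anchor E₀).X.left.Modules} {I : Finset ℕ} (hI : ∀ p ∈ I, p ≤ 8) (hR : D'.RealisedBy C F h 𝓕)
    (hmu : D'.mu = D.mu) : CleanAtSeed C I F h 𝓕 D.mu :=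
  hmu ▸ cleanAtSeed_of_realisedBy hI hR

/-- **THE TWISTED KERNEL ROUTE, END TO END (lci door), GIVEN THE LAW**: `D` passes C0; `𝓕 ≅ ker(𝓝 ↠ 𝓟)` is a kernel presentation of
the TWISTED design `D(t)` through a word frame linked to the kit's `(h_std, W)` (so `𝓕` plays `𝓔(tH)`; (A1) of `D(t)` is `Design.tw_clean`,
its `μ` is `μ(D)` by `Design.tw_mu`); `𝓕` has rank `4`; `s` is a section of `𝓕` whose ZERO SCHEME `i : Z ↪ S⁴` passes C5, C6, C7 ⟹
`D.SeedCheck K i q` for some `q`. The remaining MATHEMATICS is exactly: the display maps (presenter), rank `4`, the choice of `t` and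
`s` with `Z(s)` regular ∕ integral ∕ Bloch-semiregular — and the law. -/
theorem Design.seedCheck_of_twistedKernelPresentation (hE : E₀.dim = 1) (hψ : ψ₀ ≫ ψ₀ = -(1 • 𝟙 E₀)) {D : Design}
    (hC0 : D.ClassData) (K : AnchorKit E₀ ψ₀) {Φ : WordFrame E₀} (hΦ : Φ.LinksTo K.F (hStd E₀ K.η)) (t : ℤ)
    {𝓕 : (pad4Anchor E₀).X.left.Modules} (π : KernelPresentation C Φ (D.tw t) 𝓕) (hloc : TopChernFourLocalisation C)
    (hrk : HasRank 𝓕 4) (s : Modules.unitModule (pad4Anchor E₀).X.left ⟶ 𝓕) {Z : Scheme.{0}}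
    {i : Z ⟶ (pad4Anchor E₀).X.left} (hZ : IsZeroSchemeOf s i) (hreg : IsRegularImmersionOfCodim i 4)
    (hint : AlgebraicGeometry.IsIntegral Z) (hcoh : ∀ z ∈ Set.range i.base, ((4 : ℕ) : ℕ∞) ≤ Order.coheight z)
    (hsr : IsBlochSemiregular i (2 * 4) 4) : ∃ q : ℚ, D.SeedCheck K i q :=
  D.seedCheck_of_zeroScheme hE hψ hC0 K hloc hrk
    (cleanAtSeed_of_realisedBy_of_mu_eq le_eight_of_mem_koszulWindow (π.realisedBy hΦ (D.tw_clean t hC0.1)) (D.tw_mu t))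
    one_two_three_mem_koszulWindow.1 one_two_three_mem_koszulWindow.2.1 one_two_three_mem_koszulWindow.2.2 s hZ hreg hint
    hcoh hsr

/-- **… and the twisted COKERNEL route** (`𝓕 ≅ coker(𝓟 ↪ 𝓝)` presenting `D(t)`). -/
theorem Design.seedCheck_of_twistedCokernelPresentation (hE : E₀.dim = 1) (hψ : ψ₀ ≫ ψ₀ = -(1 • 𝟙 E₀)) {D : Design}
    (hC0 : D.ClassData) (K : AnchorKit E₀ ψ₀) {Φ : WordFrame E₀} (hΦ : Φ.LinksTo K.F (hStd E₀ K.η)) (t : ℤ)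
    {𝓕 : (pad4Anchor E₀).X.left.Modules} (π : CokernelPresentation C Φ (D.tw t) 𝓕) (hloc : TopChernFourLocalisation C)
    (hrk : HasRank 𝓕 4) (s : Modules.unitModule (pad4Anchor E₀).X.left ⟶ 𝓕) {Z : Scheme.{0}}
    {i : Z ⟶ (pad4Anchor E₀).X.left} (hZ : IsZeroSchemeOf s i) (hreg : IsRegularImmersionOfCodim i 4)
    (hint : AlgebraicGeometry.IsIntegral Z) (hcoh : ∀ z ∈ Set.range i.base, ((4 : ℕ) : ℕ∞) ≤ Order.coheight z)
    (hsr : IsBlochSemiregular i (2 * 4) 4) : ∃ q : ℚ, D.SeedCheck K i q :=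
  D.seedCheck_of_zeroScheme hE hψ hC0 K hloc hrk
    (cleanAtSeed_of_realisedBy_of_mu_eq le_eight_of_mem_koszulWindow (π.realisedBy hΦ (D.tw_clean t hC0.1)) (D.tw_mu t))
    one_two_three_mem_koszulWindow.1 one_two_three_mem_koszulWindow.2.1 one_two_three_mem_koszulWindow.2.2 s hZ hreg hint
    hcoh hsr

end SigmaObject

end VFour

/-! ## Audit: nothing is decided here

`blochSeedDiscOne_of_certificates` ∕ `blochSeedDiscOne_of_seedChecks` and `seedData_of_certificate` ∕ `seedData_of_seedCheck`
carry a `SeedCertificate` ∕ a passing `Design.SeedCheck` among their hypotheses (data no one has constructed);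
`hasHyperbolicBFSheafSeedOn_of_sheafSeedCheck` likewise. `WeilFrame`, `Polarisation`, `AnchorKit`, `SeedCertificate` are
structures (data); `Design.Clean ∕ Positive ∕ ClassData ∕ RealisedBy ∕ SeedCheck ∕ SheafSeedCheck`, `ClassScreenLE`,
`HStdHyperbolic`, `ClassCheck`, `CleanAtSeed` are predicates. The obligations O-W (a `WeilFrame`), O-pol (a `Polarisation`),
O-hyp (`HStdHyperbolic`) — together an `AnchorKit` for every `(E₀, ψ₀, hE, hψ)` — are design-independent typer tasks, NOT
discharged here. No named fact, no `sorry`; axioms standard. HC ∕ HC_CM ∕ HC_AV ∕ `BlochSeedDiscOne` are NOT proved here.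
v2 (§5): defs `Design.ClassDataRankFree`, `Design.ClassDataR`, `apexCell`, `Design.padApex`, `dilPt`, `MCell.dil`, `Design.dil`,
`Design.TraceAlive`, `Design.SheafSeedCheckRankFree`, `Design.SheafSeedCheckR`, `IsKernelCharacter`, `TwistedNormalH1Vanishes`,
`TwistedEndExt2Vanishes`, `sigmaSet`, `SigmaAvoidance`, `TowerOverSeedLaw` (a `Prop`, consumed only as a hypothesis), `Design.SeedCheckTower`,
`Design.SheafSeedCheckTower`; every v2 `theorem` is proved (json algebra, repackaging, or linear algebra from `map_ch`∕`map_cupPowTwo` under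
stated hypotheses). No `sorry`, no new axiom, no instance, no notation.
v3 (§6): defs `Design.wchN`, `Design.wchP`, `wordsOfDeg`, `eFreeWordsOfDeg`, `WordFrame.classOf` (an `AddMonoidHom`), `RealisesTensor`,
`HasChOfLetters`, `ChEquiv`, `HasChOfCopies`, `KernelPresentation.ofLetters`, `CokernelPresentation.ofLetters` (repackagings); structures `WordFrame`, `KernelPresentation`, `CokernelPresentation`, `MonadPresentation`,
`LetterKit`, `WordKit` (data; none constructed here) and `WordFrame.LinksTo` (a `Prop`-valued structure = the laws (F1)–(F2), consumed only
as a hypothesis); every v3 `theorem` is proved (word algebra over `ℤ[i]`, linear algebra in `H^{2p}`, `ch_shortExact`∕`ch_biprod`∕`ch_congr`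
under the stated hypotheses). The obligations O-WF (a linked `WordFrame`) and O-cells (a `LetterKit`) are typer tasks, NOT discharged here.
No `sorry`, no new axiom, no instance, no notation.
v4 (§7): defs `twPt`, `MCell.tw`, `MCell.twEmb`, `twKer`, `twOp` (a `ℤ[i]`-linear map), `twPoly`, `Design.tw`, `Design.PartnerUp`,
`Design.PartnerDown`, `Design.nbhdUp ∕ nbhdDown`, `Design.HallUp ∕ HallDown`, the private two-cell `toyDesign` (a `decide` example), `chernOne`, `chernTwo`, `chernThree`, `chernFour`, `IsZeroSchemeOf` (predicates ∕ constructions on the json or on honest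
carriers) and `TopChernFourLocalisation` (a `Prop` — the one piece of MATHEMATICS, Fulton 14.1, the (σ) object half rests on — consumed only as a
hypothesis, never asserted); every v4 `theorem` is proved (letter ∕ word algebra over `ℤ[i]` and `ℤ[X]`, bilinearity ∕ associativity of `∪`,
submodule closure, repackaging). `supported_of_zeroScheme`, `Design.seedCheck_of_zeroScheme`, `Design.seedCheck_of_twistedKernelPresentation ∕
…Cokernel…`, `blochSeedDiscOne_of_zeroSchemes` carry the law AND a rank-`4` bundle with a section and its zero scheme passing C5–C7 among their
hypotheses (data no one has constructed). No `sorry`, no new axiom, no instance, no notation. -/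

end Summit.HodgeConjecture.HodgeConjecture.Cruxes.BlochSeedDiscOne.SeedChecker

end
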